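import Mathlib.Analysis.SpecialFunctions.SmoothTransition
import Mathlib.Analysis.SpecialFunctions.Trigonometric.Inverse
import Mathlib.Analysis.SpecialFunctions.Trigonometric.DerivHyp
import Mathlib.Analysis.SpecialFunctions.Trigonometric.Series
import Mathlib.Analysis.Real.Pi.Bounds
import Mathlib.NumberTheory.ZetaValues
import Mathlib.Analysis.Normed.Group.AddCircle
import Mathlib.Analysis.SpecialFunctions.Gaussian.GaussianIntegral
import Literature.Analysis.FunctionSpaces.TorusCoordinateFunctions
import Literature.Analysis.FunctionSpaces.TorusLinearisedNSShear
import Literature.Analysis.FluidPDE.WeakSolution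
import Literature.Analysis.FluidPDE.PassiveScalar
import Literature.Analysis.FluidPDE.PassiveVector
import HarnessLib

/-!
# Sawtooth (triangle-wave) shear: Rayleigh dispersion data, and the rounded-sawtooth pulse cascade on the 2-torus (notions)

Definitions only, plus a proved elementary API (positivity, the phase clock, the pulse normalisation).
No statements, no named facts, no axioms.

**Part 1 — Rayleigh dispersion data of the exact triangle-wave shear.** For the inviscid linear stability
(Rayleigh) problem of a parallel flow whose profile is a broken line, the eigenfunction is piecewise
`A e^{αz} + B e^{−αz}` and the eigenvalue relation follows from Rayleigh's jump conditions at the corners,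
`Δ[(U − c)φ′ − U′φ] = 0`, `Δ[φ/(U − c)] = 0` (Drazin 2002, §8.3 (8.36)–(8.38); Examples 8.3–8.4: vortex sheet
`c² = −1`, piecewise-linear shear layer (8.41)).  For the PERIODIC triangle-wave profile `U(y) = arcsin (sin y)`
(slope `±1`, vorticity `∓1` jumping by `±2` at the corners) at streamwise wavenumber `k` (in units of the base
frequency) and cross-stream Bloch phase `β`, the same jump conditions give a `2 × 2` system whose solvability
condition is recorded here as `sawC2 k β = (π/2 + 2Σ₀)² − 4|S_β|²` with the lattice sums `sawSigma0`, `sawS` in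
closed form (cell `ad-ideate`, seat ad-p2, ROUND-2 §4.1 — a DERIVED object: the periodic broken-line case is not
printed in Drazin 2002; the method is).  The flow is unstable iff `sawC2 < 0`, with growth rate `k √(−c²)` per unit
strain (`sawSigma`).  `sawC2prod` is the PRODUCT FORM
`(π/2 − sinh πk/(k(cosh πk − cos πβ)))(π/2 − sinh πk/(k(cosh πk + cos πβ)))` (ROUND-2 §4.4) and `sawC2zero` the
`β = 0` lattice form `(π/2 − coth(kπ)/k)² − (k sinh kπ)⁻²`.  `triWave` is the slope-`±1` triangle wave of period `1`.

**Part 2 — the rounded-sawtooth pulse cascade on `𝕋²`.** Alternating piecewise-linear ("sawtooth") shears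
`H_α(x,y) = (−2α|y − ½|, 0)`, `V_α(x,y) = (0, −2α|x − ½|)`, each played for half a period, are the time-periodic
Lipschitz field of Elgindi–Liss–Mattingly (2025, §1: `u_α = V_α` on `[0,½)`, `H_α` on `[½,1)`; their Remark 1.4:
the pulses may be made smooth in time, `φ(t)H₁` with `∫φ = α` = the strain per pulse).  The cascade of the cell's
seat ad-p2 (ROUND-2 §1, §5–§6) replays such pulse pairs at frequencies `N_j = N₀ ρN^j`, with Gaussian-rounded
corners of width `δ_j = δ₀ d^{−j}`, strain `γ` per half-pulse delivered by a normalised flat bump, and phase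
durations `2 · 45/(π⁴(j+1)⁴)` which sum to exactly `1` (`ζ(4) = π⁴/90`), so that the field is smooth on
`[0,1) × 𝕋²` and all phases are played before `t = 1`: `CascadeParams`, `CascadeParams.field`, the scalar `datum`,
and the parametrised predicates the route `SawtoothPulseCascade` states its items with — `CascadeFieldSmooth`,
`K1FixedFraction` (a fixed fraction of the scalar variance is dissipated before `t = 1`, uniformly in small `κ`,
over the tree's `Torus.IsClassicalScalarTransportOn` / `Torus.eScalarDissipation`), `ShearCombDatum`,
`CascadeParams.tInject`, `K2PhaseGrowth` (per-phase `L²` growth of the tree's linearised Navier–Stokes =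
passive-vector (`A = 1`) weak solutions `Torus.IsWeakPassiveVectorOn` about the time-shifted cascade field).

**Part 3 — proved API.** `sawQ ∈ (0,1)` for `k > 0`; `triWave 0 = 0`, `1`-periodicity, `|triWave| ≤ 1/4`;
`tri θ = θ` on `[−π/2, π/2]`; the phase clock: `tHalf j > 0`, `HasSum (2·tHalf) 1`, `tStart j = Σ_{i<j} 2 tHalf i`,
`0 ≤ tStart j < 1`, `StrictMono tStart`, `tStart → 1`; the bump: `0 ≤ bump`, `bump = 0` off `(0,1)`,
`∫₀¹ bump = 1`; hence each half-pulse carries strain exactly `γ`: `∫ rateH j = γ = ∫ rateV j` over its half-slot.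

**Part 4 — the product form, proved.** `normSq_sawS` (`|S_β|² = (e^{−kπ}/2k)²(1−q)²(2+2cos 2πβ)/D²`,
`D = 1 − 2q cos 2πβ + q²`); `sawC2_eq_sawC2prod` (THE PRODUCT FORM, every `k ≠ 0` and every `β`);
`sawC2prod_zero` / `sawC2_zero_eq_sawC2zero` (at `β = 0` the product and lattice forms agree); `sq_mul_neg_sawC2zero`
(half-angle form `k²(−c²) = (x − tanh x)(coth x − x)`, `x = πk/2`); `sawC2zero_neg_iff` / `sawC2zero_pos_iff`
(unstable iff `x tanh x < 1`, stable iff `x tanh x > 1` — the analogue of Drazin's broken-line jet criterion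
`α tanh α = 1`, Exercise 8.10); `sawC2zero_pos_of_one_le`, `sawC2zero_natCast_pos` (integer harmonics are neutral);
`sawC2_half_nonneg` (`β = ½` is a perfect square); `sq_mul_neg_sawC2_le_max` (Bloch domination by `β = 0`);
`tendsto_sawC2zero_zero` (long-wave limit `c²(k,0) → −π²/12` as `k → 0⁺`).

**Part 5 — the maximal Kelvin–Helmholtz rate, proved.** `sq_mul_neg_sawC2zero_le_sawSigmaStar_sq`
(`k²(−c²(k,0)) ≤ σ⋆² = 0.30982²` for all `k > 0`: `y coth y − 1 − y²/4 ≤ σ⋆²` via the degree-16 Taylor minorant of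
`e^{2y} − 1` and an explicit weighted-sum-of-squares certificate checked by `ring`), `sq_mul_neg_sawC2zero_le` (the
route's support `SawtoothSigmaMax`: `≤ 0.3099²`), `sq_mul_neg_sawC2_le_sawSigmaStar_sq` (every Bloch phase),
`sawSigma_le_sawSigmaStar` (`σ(k,β) ≤ σ⋆` for all real `k, β`).

**Part 6 — the band edge, proved.** `sawC2zero_neg_of_le` (`c²(k,0) < 0` for `0 < k ≤ 0.7637`), `sawC2zero_pos_of_ge`
(`0 < c²(k,0)` for `k ≥ 0.7638`), `sawtoothBandEdge` (the conjunction, ad-p2's SawtoothBandEdge verbatim): one exponential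
comparison at each bracket point (`Real.exp_bound'`, `Real.sum_le_exp_of_nonneg`, `Real.pi_gt_d6` / `Real.pi_lt_d6`).

**Part 7 — uniform hyperbolicity of the exact pulse pair with an explicit threshold, proved.** Off the corner strips the
Jacobian of one exact H-then-V pulse pair (and of any string of them, across phases) is a product of Elgindi–Liss–Mattingly's
four matrices `A(r,s) = [[1 + rsγ², rγ],[sγ, 1]]`, `r,s = ±1` (`pulseJac`; `α = γ`); ELM (§1.2.2, §3.1, Lemma 3.1) prove cone
invariance with expansion `≥ δ₁α²` per factor "for a suitable δ₁ and all α sufficiently large". Here: for every aperture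
`m > 1` and `γ² ≥ m(m+2)/(m−1)` the cone `{γ|v₂| ≤ m|v₁|}` is invariant under all four matrices and `|v₁|` grows by at least
`γ² − 1 − m` per factor for EVERY itinerary (`sawtooth_cone_step`, `itinJac_growth`; backward twin `itinJacInv_growth` on the
stable cone); `m = 2`: all `γ ≥ 2√2`, factor `γ² − 3`, sup-norm form `itinJac_norm_growth_two`, Euclidean one-step factor
`≥ γ²/2` (`pulseJac_euclidSq_growth_two`); on the route's box `γ ≥ 4` the factor is `≥ 13` (`itinJac_growth_routeBox`);
`|tr A| ≥ γ² − 2` (`abs_trace_pulseJac`); slopes `±1` of `tri` / `triWave` (`hasDerivAt_tri_of_mem_Ioo`, …).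

**Part 8 — the localised fixed-fraction predicate.** `Jrate r κ = ⌈log(1/κ)/(2 log r)⌉₊` and `K1Localised P r` (a fixed
fraction of the datum's variance is dissipated by `tStart (Jrate r κ + A)`, uniformly in small `κ`; ad-p2 ROUND-3, K3′ line v2,
verbatim bodies), with `eScalarDissipation_mono_right` and the corollary `K1FixedFraction_of_K1Localised` (proved).

**Part 9 — the field on each half-slot is a single shear (proved).** `CascadeParams.field_eq_of_mem_H` /
`field_eq_of_mem_V` (`field t x = (rateH j t · U j (x₂), 0)` on `[tStart j, tStart j + tHalf j]`, `(0, rateV j t · U j (x₁))` on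
`[tStart j + tHalf j, tStart (j+1)]`), the vanishing lemmas `rateV_eq_zero_of_mem_H`, `rateH_eq_zero_of_mem_H_of_ne`,
`rateH_eq_zero_of_mem_V`, `rateV_eq_zero_of_mem_V_of_ne`, and `rateH_nonneg` / `rateV_nonneg`.

Provenance: definitions file of the cell `ad-ideate` (summit `AnomalousDissipation`), seat ad-p2, rung F-D1-p2, for the
route `SawtoothPulseCascade` — draft `run/shared/lean/pub/ad-ideate/ad-ideate-p2/leaf/SawtoothCascadeDefs-v4.lean` (v4,
sha256 c4fd065a…, farm rc 0: v2 sha256 68a9ea56… + no notation + `sawSigmaStar` + the finite K2 window; items elaborated jointly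
in `leaf/K2Sketch.lean` and `Sketch2.lean`), landed verbatim in every definition body up to docstring tags, with the appended
proved API, by the cell's literature seat (precedent: `LatticeShearWords`).
[cite: Drazin2002, §8.3 (8.36)–(8.38) (Rayleigh jump conditions for broken-line profiles; Examples 8.3–8.4)]
[cite: ElgindiLissMattingly2025, §1 (alternating sawtooth shears H_α, V_α, u_α) and Rmk. 1.4 (smooth-in-time pulses)]
[cite: BrueDeLellisCMP2023, §2 Question 2.1 (the target the predicates serve)]
[cite: MyersHillSturmanWilson2022, App. A Lemma 7 (invariant expanding cones / minimum expansion factors for orthogonal non-monotonic shears)] [problem: turb]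
-/

open Set Filter

namespace Literature.Analysis.FluidPDE.SawtoothCascade

noncomputable section

/-! ## Part 1 — Rayleigh dispersion data of the triangle-wave shear -/

/-- `q = e^{-2πk}` (decay factor of the piecewise-exponential Rayleigh eigenfunction across one half-period).
[cite: Drazin2002, §8.3 (8.38)] -/
def sawQ (k : ℝ) : ℝ := Real.exp (-(2 * Real.pi * k))

/-- Lattice sum `Σ₀(k, β) = Σ_m e^{2πiβm} G_k(2πm)`, `G_k(y) = -e^{-k|y|}/(2k)`, in closed form:
`Σ₀ = -(1 - q²) / (2k (1 - 2q cos 2πβ + q²))` (cell `ad-ideate` ad-p2 ROUND-2 §4.1; derived from Rayleigh's jump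
conditions). [cite: Drazin2002, §8.3 (8.36)–(8.38)] -/
def sawSigma0 (k β : ℝ) : ℝ :=
  (-(1 - sawQ k ^ 2)) / (2 * k * (1 - 2 * sawQ k * Real.cos (2 * Real.pi * β) + sawQ k ^ 2))

/-- Lattice sum `S_β(k) = Σ_m e^{2πiβm} G_k(π + 2πm)` in closed form:
`S_β = -(e^{-kπ}/2k) · (1/(1 - z q) + z̄/(1 - z̄ q))`, `z = e^{2πiβ}` (ad-p2 ROUND-2 §4.1).
[cite: Drazin2002, §8.3 (8.36)–(8.38)] -/
def sawS (k β : ℝ) : ℂ :=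
  let q : ℂ := ((sawQ k : ℝ) : ℂ)
  let z : ℂ := Complex.exp (((2 * Real.pi * β : ℝ) : ℂ) * Complex.I)
  (-(((Real.exp (-(k * Real.pi)) / (2 * k) : ℝ) : ℂ))) * (1 / (1 - z * q) + (starRingEnd ℂ z) / (1 - (starRingEnd ℂ z) * q))

/-- `c²(k, β) = (π/2 + 2Σ₀)² − 4|S_β|²` — squared complex phase speed of the triangle-wave shear
at streamwise wavenumber `k` and Bloch phase `β` (ad-p2 ROUND-2 §4.1, lattice form). Unstable iff negative.
[cite: Drazin2002, §8.3 (8.36)–(8.38)] -/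
def sawC2 (k β : ℝ) : ℝ :=
  (Real.pi / 2 + 2 * sawSigma0 k β) ^ 2 - 4 * Complex.normSq (sawS k β)

/-- The `β = 0` specialisation in lattice form: `c²(k) = (π/2 − coth(kπ)/k)² − (k sinh kπ)⁻²`.
[cite: Drazin2002, §8.3 (8.36)–(8.38)] -/
def sawC2zero (k : ℝ) : ℝ :=
  (Real.pi / 2 - Real.cosh (k * Real.pi) / (k * Real.sinh (k * Real.pi))) ^ 2
    - (1 / (k * Real.sinh (k * Real.pi))) ^ 2

/-- Growth rate per unit strain `σ(k, β) = k √(max(0, −c²))` (`αc_i` in Drazin's notation).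
[cite: Drazin2002, §8.3 Example 8.3 (growth rate αc_i)] -/
def sawSigma (k β : ℝ) : ℝ := k * Real.sqrt (max 0 (-(sawC2 k β)))

/-- `σ⋆ = 0.30982`: a 5-decimal upper rounding of the maximal sawtooth Kelvin–Helmholtz rate per unit strain
`sup_k k √(−c²(k,0)) = 0.309816835…` (ad-p2 ROUND-2 §4.5: interval certificate in three lineages — eng kit j245035,
referee decimal-40, p2 kit j245896; the route's support statement `SawtoothSigmaMax` bounds `k²(−c²(k,0)) ≤ 0.3099²`).
Used as the exponent in `K2PhaseGrowth`.  A numeral, not a statement. [folklore] -/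
def sawSigmaStar : ℝ := 0.30982

/-! ### The PRODUCT FORM (ad-p2 ROUND-2 §4.4).  Writing `w = e^{-πk + iπβ}` turns the two
lattice sums into `(1-q)/(k|1 ∓ w|²)` and the dispersion relation factorises:
`c²(k,β) = (π/2 − sinh(πk)/(k (cosh πk − cos πβ))) · (π/2 − sinh(πk)/(k (cosh πk + cos πβ)))`
(checked against the lattice form to 3e-11 on 2000 random `(k,β)` by the seat; the identity itself is a route
support item, not asserted here).  At `β = 0` this is `(π/2 − coth(πk/2)/k)(π/2 − tanh(πk/2)/k)`, i.e.
`σ² = k²(−c²) = (x − tanh x)(coth x − x)` with `x = πk/2`; the band edge is `(2/π)·x*` with `coth x* = x*`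
(`x* = 1.19967864…`, `a_c = 0.763739143…`); integer harmonics are neutral because `nπ/2 ≥ π/2 > x*`;
`β = 1/2` gives a perfect square; and for fixed `k` both factors DECREASE in `β ∈ [0,1/2]`, so the Bloch
family is dominated by `β = 0`.  Compare Drazin's broken-line jet `c² = (α tanh α − 1)(α − tanh α)/(α² tanh α)`
(2002, Exercise 8.10) — the same product structure. -/

/-- Product form of the sawtooth dispersion relation (ad-p2 ROUND-2 §4.4).
[cite: Drazin2002, §8.3 (8.36)–(8.38) and Exercise 8.10 (product-form eigenvalue relation of a broken-line profile)] -/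
def sawC2prod (k β : ℝ) : ℝ :=
  (Real.pi / 2 - Real.sinh (Real.pi * k) / (k * (Real.cosh (Real.pi * k) - Real.cos (Real.pi * β)))) *
    (Real.pi / 2 - Real.sinh (Real.pi * k) / (k * (Real.cosh (Real.pi * k) + Real.cos (Real.pi * β))))

/-! ### ad-p2 ROUND-2 §3.7–§3.8 (context for the route's optional supports): the sideband walk
`a ↦ (a + l)/ρ_N` of the inherited perturbation's relative wavenumber (H pulses conserve `k₁`; V pulses shift
`k₁` by base-period sidebands `l·N`; the next phase rescales by `ρ_N`), amplified per phase by
`exp (γ · sawSigma |a| 0)`; and the V-pulse near-sideband coefficients: in a V pulse of total shear displacement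
`γ · triWave (N x₁) / N` the cross-stream class `p` picks up the phase `exp (-2πi p γ triWave (N x₁))`. -/

/-- The sharp triangle wave (period 1, slope ±1, amplitude 1/4, `triWave 0 = 0`;
`triWave ξ = ξ` on `[-1/4, 1/4]`, `= 1/2 - ξ` on `[1/4, 3/4]`) — one period of the Elgindi–Liss–Mattingly
sawtooth profile `−|y − ½|`, recentred and normalised to unit slope. [cite: ElgindiLissMattingly2025, §1 (H_α, V_α)] -/
def triWave (ξ : ℝ) : ℝ := 1 / 4 - |Int.fract (ξ + 1 / 4) - 1 / 2|

/-! ## Part 2 — the bounded-strain rounded-sawtooth pulse cascade as a CONCRETE velocity field on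
`[0,1) × 𝕋²` (ad-p2 ROUND-2 §5–§6.1).
Conventions: unit torus, coordinates `Torus.repr x i ∈ [0,1)`; phase `j = 0,1,2,…` has frequency
`N j = N₀ ρ_N^j`, rounding `δ j = δ₀ d^{-j}`, shear-rate `γ / tHalf j · bump` with
`tHalf j = 45/(π⁴ (j+1)⁴)` so that `Σ_j 2·tHalf j = 1` (`hasSum_two_mul_tHalf` below); each phase = H-pulse
then V-pulse, each of strain exactly `γ` (`integral_rateH`, `integral_rateV`), so the time-1 flow map is the
infinite product and the field is smooth on `Ico 0 1` (NOT at `t = 1`: the Brué–De Lellis no-anomaly barrier on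
closed intervals is respected).  The scalar datum is `sin (2π x₁)`; the phase order is H then V. -/

open MeasureTheory Literature.Analysis Literature.Analysis.FunctionSpaces
  Literature.Analysis.FluidPDE

/-- Triangle wave of slope ±1, period `2π`, amplitude `π/2` (corners at `π/2 + πℤ`): `arcsin ∘ sin`.
[cite: ElgindiLissMattingly2025, §1 (the piecewise-linear shear profiles H_α, V_α)] -/
def tri (θ : ℝ) : ℝ := Real.arcsin (Real.sin θ)

/-- Centred Gaussian density of width `δ` (junk for `δ = 0`). [folklore] -/
def gaussKernel (δ y : ℝ) : ℝ := Real.exp (-(y ^ 2 / (2 * δ ^ 2))) / (δ * Real.sqrt (2 * Real.pi))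

/-- Rounded sawtooth `S_δ = tri ⋆ gaussKernel δ`: `n`-th Fourier coefficient of `tri` damped by
`e^{-(δ n)²/2}`; smooth, `2π`-periodic, slope in `[-1,1]`, slope `±1` off strips of width `O(δ)` around the
corners (ad-p2 ROUND-2 §1; the cell's k1toy / lincasc convention). [folklore] -/
def roundedSaw (δ θ : ℝ) : ℝ := ∫ y, tri (θ - y) * gaussKernel δ y

/-- Parameters of the cascade: strain `γ` per half-phase, rounding `δ₀ d^{-j}`, frequencies `N₀ ρN^j`
(ad-p2 ROUND-2 §5; one Elgindi–Liss–Mattingly pulse pair per phase, replayed across scales).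
[cite: ElgindiLissMattingly2025, §1 (u_α) and Rmk. 1.4 (strain ∫φ = α per pulse)] -/
structure CascadeParams where
  γ : ℝ
  δ₀ : ℝ
  d : ℝ
  N₀ : ℕ
  ρN : ℕ

namespace CascadeParams

variable (P : CascadeParams)

/-- Frequency of phase `j`: `N j = N₀ ρN^j`. [folklore] -/
def N (j : ℕ) : ℕ := P.N₀ * P.ρN ^ j

/-- Rounding width of phase `j`: `δ j = δ₀ d^{-j}`. [folklore] -/
def δ (j : ℕ) : ℝ := P.δ₀ / P.d ^ j

/-- Duration of each half of phase `j`: `45 / (π⁴ (j+1)⁴)`; `Σ_j 2 tHalf j = (90/π⁴) ζ(4) = 1`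
(`hasSum_two_mul_tHalf`). [cite: Apostol1976, Thm. 12.17 (22) (ζ(4) = π⁴/90 with B₄ = −1/30)] -/
def tHalf (j : ℕ) : ℝ := 45 / (Real.pi ^ 4 * ((j : ℝ) + 1) ^ 4)

/-- Start time of phase `j` (`= Σ_{i<j} 2 tHalf i`, `tStart_eq_sum`). [folklore] -/
def tStart : ℕ → ℝ
  | 0 => 0
  | j + 1 => tStart j + 2 * tHalf j

/-- Flat unit bump on `[0,1]`: `expNegInvGlue s · expNegInvGlue (1-s)`, normalised to integral 1
(`integral_bump`); vanishes off `(0,1)` (`bump_of_nonpos`, `bump_of_one_le`) — the smooth time cut-off `φ`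
of Elgindi–Liss–Mattingly's Remark 1.4. [cite: ElgindiLissMattingly2025, Rmk. 1.4 (smooth-in-time pulses φ)] -/
def bump (s : ℝ) : ℝ :=
  expNegInvGlue s * expNegInvGlue (1 - s) / ∫ r in (0 : ℝ)..1, expNegInvGlue r * expNegInvGlue (1 - r)

/-- Shear rate of the H-pulse of phase `j` at time `t` (total strain `∫ = γ`, `integral_rateH`).
[cite: ElgindiLissMattingly2025, Rmk. 1.4 (φ(t) H₁ with ∫φ = α)] -/
def rateH (j : ℕ) (t : ℝ) : ℝ := P.γ / tHalf j * bump ((t - tStart j) / tHalf j)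

/-- Shear rate of the V-pulse of phase `j` at time `t` (total strain `∫ = γ`, `integral_rateV`).
[cite: ElgindiLissMattingly2025, Rmk. 1.4 (φ(1/2 − t) V₁ with ∫φ = α)] -/
def rateV (j : ℕ) (t : ℝ) : ℝ := P.γ / tHalf j * bump ((t - tStart j - tHalf j) / tHalf j)

/-- Shear profile of phase `j` on the unit circle coordinate `y ∈ [0,1)`:
`U j y = S_{δ j}(2π N_j y) / (2π N_j)` — `1`-periodic, slope `±1` off the corner strips (the rounded,
rescaled Elgindi–Liss–Mattingly profile). [cite: ElgindiLissMattingly2025, §1 (H_α, V_α)] -/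
def U (j : ℕ) (y : ℝ) : ℝ := roundedSaw (P.δ j) (2 * Real.pi * P.N j * y) / (2 * Real.pi * P.N j)

/-- THE CASCADE FIELD `ū(t, x) = (Σ_j rateH j t · U j x₂, Σ_j rateV j t · U j x₁)` on `𝕋²`
(at each `t < 1` at most one summand is non-zero). Its force `G = ∂_t ū` is `ν`-independent and
`ū` is an exact solution of forced Navier–Stokes up to the heat-lagged residual (ad-p2 ROUND-2 §1) — the
multiscale replay of the alternating field `u_α`. [cite: ElgindiLissMattingly2025, §1 (u_α = V_α on [0,½), H_α on [½,1))] -/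
def field (t : ℝ) (x : UnitAddTorus (Fin 2)) : EuclideanSpace ℝ (Fin 2) :=
  WithLp.toLp 2 ![∑' j : ℕ, P.rateH j t * P.U j (Torus.repr x 1),
                  ∑' j : ℕ, P.rateV j t * P.U j (Torus.repr x 0)]

end CascadeParams

/-- The scalar datum `sin (2π x₁)`. [folklore] -/
def datum (x : UnitAddTorus (Fin 2)) : ℝ := Real.sin (2 * Real.pi * Torus.repr x 0)

/-- Anti-vacuity support predicate: the cascade field is jointly smooth on `[0,1) × 𝕋²`
(else `K1FixedFraction` below would hold vacuously); expected to need `0 < δ₀`, `1 < d`, `1 ≤ N₀`, `2 ≤ ρN`.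
[cite: BrueDeLellisCMP2023, §2 Question 2.1 (smoothness on the half-open interval)] -/
def CascadeFieldSmooth (P : CascadeParams) : Prop :=
  Torus.IsSmoothSpaceTimeOn (Ico 0 1) P.field

/-- K1 for ONE parameter set (a parametrised predicate, not a statement): every classical solution of
`∂_t w + ū·∇w = κ Δw` on `[0,1)` from the datum `sin 2πx₁` dissipates at least the fraction `χ` of its initial
variance before time 1, uniformly in `κ ∈ (0, κ₀]` (`2·scalarDissipation = ‖w₀‖² − lim ‖w(t)‖²` by the tree's
energy identity `scalarL2Sq_add_scalarDissipation`) — anomalous dissipation of the scalar variance in the sense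
of Drivas–Elgindi–Iyer–Jeong. [cite: DEIJ2022, (1.2)–(1.3) (κ-uniform lower bound on the dissipated variance)] -/
def K1FixedFraction (P : CascadeParams) : Prop :=
  ∃ χ : ℝ, 0 < χ ∧ ∃ κ₀ : ℝ, 0 < κ₀ ∧ ∀ κ ∈ Ioc 0 κ₀, ∀ w : ℝ → UnitAddTorus (Fin 2) → ℝ,
    Torus.IsClassicalScalarTransportOn (Ico 0 1) κ P.field w → w 0 = datum →
      ENNReal.ofReal (χ * Torus.scalarL2Sq datum) ≤ 2 * Torus.eScalarDissipation κ w 0 1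

/-! ### Linearised-cascade growth predicate (K2″ of ad-p2 ROUND-2 §6.2 + §7.3/§3.9): per-phase growth of the
LINEARISED cascade response.  The Navier–Stokes equations linearised at the cascade carrier `ū = P.field` are the
tree's passive-vector model with `A = 1` (`Torus.IsWeakPassiveVectorOn 1 …`).  The construction injects, at the
start of each half-pulse of phase `j₀`, a shear-type perturbation parallel to that pulse whose cross-stream Fourier
support lies in the ODD multiples of `N_{j₀}` (the rounded-corner residual comb, ROUND-2 §1.2).  `K2PhaseGrowth P C`
says: every such injection is amplified, uniformly in small `ν`, by at most `C·e^{σ⋆ γ}` PER SUBSEQUENT PHASE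
(`σ⋆ = sawSigmaStar = 0.30982`, an upper rounding of the seat's certified maximal Kelvin–Helmholtz rate of the exact
sawtooth per unit strain, three lineages; `C` absorbs the non-modal Orr factor).  Seat measurements (kit j244065/j245608, `ρN = 2`): per-phase
factors 31.4 / 18.7 / 24.1 at `γ = 12` against `3 e^{σ⋆·12} = 124`; 4.6 / 3.7 / 3.4 at `γ = 4` against
`3 e^{σ⋆·4} = 10.4`.  These are parametrised predicates; the route's items quantify them. -/

/-- Shear-type datum parallel to a pulse of frequency `N`: `w₀ = g(x_⊥) e_∥` with `g` smooth, `1`-periodic and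
Fourier-supported on the odd multiples of `N` (the residual comb class of ad-p2 ROUND-2 §1.2); `horizontal = true`
means `e_∥ = e₁`, `x_⊥ = x₂` (an H pulse). [cite: Drazin2002, §8.1 (parallel shear flows; perturbations of a basic parallel flow)] -/
def ShearCombDatum (N : ℕ) (horizontal : Bool) (w₀ : UnitAddTorus (Fin 2) → EuclideanSpace ℝ (Fin 2)) : Prop :=
  ∃ g : ℝ → ℝ, ContDiff ℝ ((⊤ : ℕ∞) : WithTop ℕ∞) g ∧ Function.Periodic g 1 ∧
    (∀ m : ℤ, (¬ ∃ n : ℤ, m = (2 * n + 1) * (N : ℤ)) →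
      (∫ y in (0 : ℝ)..1, g y * Real.cos (2 * Real.pi * m * y)) = 0 ∧
      (∫ y in (0 : ℝ)..1, g y * Real.sin (2 * Real.pi * m * y)) = 0) ∧
    (w₀ = fun x =>
      if horizontal then WithLp.toLp 2 ![g (Torus.repr x 1), 0] else WithLp.toLp 2 ![0, g (Torus.repr x 0)])

/-- Injection times of phase `j₀`: the start of its H half (`horizontal = true`) or of its V half (the bound in
`K2PhaseGrowth` is only asserted for `t ≥ 0` after the shift: the weak solution is unconstrained at negative
times). [folklore] -/
def CascadeParams.tInject (j₀ : ℕ) (horizontal : Bool) : ℝ :=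
  if horizontal then CascadeParams.tStart j₀ else CascadeParams.tStart j₀ + CascadeParams.tHalf j₀

/-- K2″ for one parameter set (a parametrised predicate, not a statement): every residual-class injection at
phase `j₀` is amplified by at most `(C e^{σ⋆ γ})^{J − j₀ + 1}` in velocity `L²` during phase `J ≥ j₀`, for every weak
solution of the Navier–Stokes equations linearised at the (time-shifted) cascade carrier (the tree's
`Torus.IsWeakPassiveVectorOn 1`) on the FINITE window `[0, tStart (J+1) − tInject j₀)` — on which the carrier is
smooth, bounded, with bounded gradient, so the weak-solution class is the standard (non-empty, unique) one —
uniformly in `ν ∈ (0, ν₀]` with ONE threshold `ν₀` for all injection phases `j₀` and all `J`.  Nothing is asserted on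
the full window up to the singular time `t = 1`; earlier phases `j₀ ≤ J' < J` are covered by instantiating `J'`
(ad-p2 v4, anti-vacuity self-check A1–A6; referee flag F-K2-1 on the quantifier order `∃ν₀ ∀j₀`).
[cite: YoshidaKaneda2000, §II eq. (4)-(5) ((α,β)=(1,1): the linearised Navier–Stokes / passive-vector model)] -/
def K2PhaseGrowth (P : CascadeParams) (C : ℝ) : Prop :=
  ∃ ν₀ : ℝ, 0 < ν₀ ∧ ∀ ν ∈ Ioc 0 ν₀, ∀ (j₀ J : ℕ), j₀ ≤ J → ∀ (hz : Bool)
    (w₀ : UnitAddTorus (Fin 2) → EuclideanSpace ℝ (Fin 2)) (w : ℝ → UnitAddTorus (Fin 2) → EuclideanSpace ℝ (Fin 2)),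
    ShearCombDatum (P.N j₀) hz w₀ →
    Torus.IsWeakPassiveVectorOn 1 (CascadeParams.tStart (J + 1) - CascadeParams.tInject j₀ hz) ν
      (fun t => P.field (CascadeParams.tInject j₀ hz + t)) w₀ w →
      ∀ᵐ t ∂(volume.restrict (Ioo (max 0 (CascadeParams.tStart J - CascadeParams.tInject j₀ hz))
          (CascadeParams.tStart (J + 1) - CascadeParams.tInject j₀ hz))),
        Torus.vectorL2Sq (w t) ≤ (C * Real.exp (sawSigmaStar * P.γ)) ^ (2 * (J + 1 - j₀)) * Torus.vectorL2Sq w₀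

/-! ## Part 3 — proved elementary API -/

/-! ### Dispersion data -/

/-- `0 < q`. [cite: Drazin2002, §8.3 (8.38)] -/
theorem sawQ_pos (k : ℝ) : 0 < sawQ k := Real.exp_pos _

/-- `q < 1` for `k > 0` (the eigenfunction decays across a half-period). [cite: Drazin2002, §8.3 (8.38)] -/
theorem sawQ_lt_one {k : ℝ} (hk : 0 < k) : sawQ k < 1 := by
  unfold sawQ
  rw [Real.exp_lt_one_iff]
  nlinarith [Real.pi_pos]

/-! ### The two triangle waves -/

/-- `triWave 0 = 0`. [cite: ElgindiLissMattingly2025, §1 (H_α, V_α)] -/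
theorem triWave_zero : triWave 0 = 0 := by
  have h : Int.fract ((1 : ℝ) / 4) = 1 / 4 := Int.fract_eq_self.2 ⟨by norm_num, by norm_num⟩
  simp only [triWave, zero_add, h]
  norm_num [abs_of_neg]

/-- `triWave` is `1`-periodic. [cite: ElgindiLissMattingly2025, §1 (H_α, V_α on the unit torus)] -/
theorem triWave_add_one (ξ : ℝ) : triWave (ξ + 1) = triWave ξ := by
  simp only [triWave, add_right_comm ξ 1 (1 / 4), Int.fract_add_one]

/-- `triWave` is `1`-periodic (as `Function.Periodic`). [cite: ElgindiLissMattingly2025, §1 (H_α, V_α on the unit torus)] -/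
theorem triWave_periodic : Function.Periodic triWave 1 := triWave_add_one

/-- `|triWave ξ| ≤ 1/4` (amplitude). [cite: ElgindiLissMattingly2025, §1 (H_α, V_α)] -/
theorem abs_triWave_le (ξ : ℝ) : |triWave ξ| ≤ 1 / 4 := by
  have h0 := Int.fract_nonneg (ξ + 1 / 4)
  have h1 := Int.fract_lt_one (ξ + 1 / 4)
  have h2 : |Int.fract (ξ + 1 / 4) - 1 / 2| ≤ 1 / 2 := abs_le.2 ⟨by linarith, by linarith⟩
  have h3 := abs_nonneg (Int.fract (ξ + 1 / 4) - 1 / 2)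
  unfold triWave
  exact abs_le.2 ⟨by linarith, by linarith⟩

/-- `triWave ξ = ξ` on `[-1/4, 1/4]` (the rising branch through the origin). [cite: ElgindiLissMattingly2025, §1 (H_α, V_α)] -/
theorem triWave_eq_self {ξ : ℝ} (h₁ : -(1 / 4) ≤ ξ) (h₂ : ξ ≤ 1 / 4) : triWave ξ = ξ := by
  have h : Int.fract (ξ + 1 / 4) = ξ + 1 / 4 := Int.fract_eq_self.2 ⟨by linarith, by linarith⟩
  unfold triWave
  rw [h, abs_of_nonpos (by linarith)]
  ring

/-- `tri θ = θ` on `[-π/2, π/2]`. [cite: ElgindiLissMattingly2025, §1 (the piecewise-linear profiles H_α, V_α)] -/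
theorem tri_eq_self {θ : ℝ} (h₁ : -(Real.pi / 2) ≤ θ) (h₂ : θ ≤ Real.pi / 2) : tri θ = θ :=
  Real.arcsin_sin h₁ h₂

/-- `|tri θ| ≤ π/2` (amplitude). [cite: ElgindiLissMattingly2025, §1 (the piecewise-linear profiles H_α, V_α)] -/
theorem abs_tri_le (θ : ℝ) : |tri θ| ≤ Real.pi / 2 :=
  abs_le.2 ⟨Real.neg_pi_div_two_le_arcsin _, Real.arcsin_le_pi_div_two _⟩

/-- `tri` is `2π`-periodic. [cite: ElgindiLissMattingly2025, §1 (the piecewise-linear profiles H_α, V_α)] -/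
theorem tri_periodic : Function.Periodic tri (2 * Real.pi) := fun θ => by
  simp only [tri, Real.sin_add_two_pi]

/-! ### The phase clock -/

namespace CascadeParams

/-- Each half-phase has positive duration. [cite: ElgindiLissMattingly2025, §1 (the pulse schedule of u_α: V_α on [0,½), H_α on [½,1))] -/
theorem tHalf_pos (j : ℕ) : 0 < tHalf j := by
  unfold tHalf
  positivity

/-- The phase durations sum to exactly `1`: `Σ_j 2 · 45/(π⁴(j+1)⁴) = (90/π⁴) ζ(4) = 1`.
[cite: Apostol1976, Thm. 12.17 (22) (ζ(4) = π⁴/90 with B₄ = −1/30)] -/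
theorem hasSum_two_mul_tHalf : HasSum (fun j : ℕ => 2 * tHalf j) 1 := by
  have h := (hasSum_nat_add_iff' (f := fun n : ℕ => (1 : ℝ) / (n : ℝ) ^ 4) 1).2 hasSum_zeta_four
  simp only [Finset.range_one, Finset.sum_singleton, Nat.cast_zero, ne_eq, OfNat.ofNat_ne_zero,
    not_false_eq_true, zero_pow, div_zero, sub_zero, Nat.cast_add, Nat.cast_one] at h
  have hπ : Real.pi ^ 4 ≠ 0 := pow_ne_zero _ Real.pi_ne_zero
  have h2 := h.mul_left (90 / Real.pi ^ 4)
  have h1 : (90 / Real.pi ^ 4) * (Real.pi ^ 4 / 90) = (1 : ℝ) := by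
    field_simp
  rw [h1] at h2
  refine h2.congr_fun ?_
  intro j
  have hj : ((j : ℝ) + 1) ^ 4 ≠ 0 := by positivity
  unfold tHalf
  field_simp
  ring

/-- `tStart 0 = 0`. [cite: ElgindiLissMattingly2025, §1 (the pulse schedule of u_α: V_α on [0,½), H_α on [½,1))] -/
@[simp] theorem tStart_zero : tStart 0 = 0 := rfl

/-- `tStart (j+1) = tStart j + 2 tHalf j`. [cite: ElgindiLissMattingly2025, §1 (the pulse schedule of u_α: V_α on [0,½), H_α on [½,1))] -/
theorem tStart_succ (j : ℕ) : tStart (j + 1) = tStart j + 2 * tHalf j := rfl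

/-- `tStart j = Σ_{i<j} 2 tHalf i`. [cite: ElgindiLissMattingly2025, §1 (the pulse schedule of u_α: V_α on [0,½), H_α on [½,1))] -/
theorem tStart_eq_sum (j : ℕ) : tStart j = ∑ i ∈ Finset.range j, 2 * tHalf i := by
  induction j with
  | zero => simp
  | succ j ih => rw [tStart_succ, ih, Finset.sum_range_succ]

/-- `tStart` is strictly increasing. [cite: ElgindiLissMattingly2025, §1 (the pulse schedule of u_α: V_α on [0,½), H_α on [½,1))] -/
theorem tStart_strictMono : StrictMono tStart :=
  strictMono_nat_of_lt_succ fun j => by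
    rw [tStart_succ]
    linarith [tHalf_pos j]

/-- `0 ≤ tStart j`. [cite: ElgindiLissMattingly2025, §1 (the pulse schedule of u_α: V_α on [0,½), H_α on [½,1))] -/
theorem tStart_nonneg (j : ℕ) : 0 ≤ tStart j := by
  simpa using tStart_strictMono.monotone (Nat.zero_le j)

/-- Every phase starts, and ends, before time `1`: `tStart (j+1) ≤ 1`. [cite: Apostol1976, Thm. 12.17 (22) (ζ(4) = π⁴/90)] -/
theorem tStart_succ_le_one (j : ℕ) : tStart (j + 1) ≤ 1 := by
  rw [tStart_eq_sum]
  exact sum_le_hasSum _ (fun i _ => by linarith [tHalf_pos i]) hasSum_two_mul_tHalf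

/-- `tStart j < 1`: all phases are played inside `[0,1)`. [cite: Apostol1976, Thm. 12.17 (22) (ζ(4) = π⁴/90)] -/
theorem tStart_lt_one (j : ℕ) : tStart j < 1 :=
  lt_of_lt_of_le (tStart_strictMono (Nat.lt_succ_self j)) (tStart_succ_le_one j)

/-- `tStart j + tHalf j < 1` (the V half of phase `j` also starts before time `1`). [cite: ElgindiLissMattingly2025, §1 (the pulse schedule of u_α: V_α on [0,½), H_α on [½,1))] -/
theorem tStart_add_tHalf_lt_one (j : ℕ) : tStart j + tHalf j < 1 := by
  have h1 := tStart_succ_le_one j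
  rw [tStart_succ] at h1
  linarith [tHalf_pos j]

/-- The phase clock exhausts `[0,1)`: `tStart j → 1`. [cite: Apostol1976, Thm. 12.17 (22) (ζ(4) = π⁴/90)] -/
theorem tendsto_tStart : Tendsto tStart atTop (nhds 1) := by
  have h := hasSum_two_mul_tHalf.tendsto_sum_nat
  refine h.congr fun j => ?_
  exact (tStart_eq_sum j).symm

/-- The injection time of phase `j₀` lies in `[tStart j₀, tStart j₀ + tHalf j₀]`, hence in `[0,1)`. [cite: ElgindiLissMattingly2025, §1 (the pulse schedule of u_α: V_α on [0,½), H_α on [½,1))] -/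
theorem tInject_mem_Ico (j₀ : ℕ) (hz : Bool) : CascadeParams.tInject j₀ hz ∈ Ico (0 : ℝ) 1 := by
  unfold CascadeParams.tInject
  cases hz
  · simp only [Bool.false_eq_true, ↓reduceIte]
    exact ⟨by linarith [tStart_nonneg j₀, tHalf_pos j₀], tStart_add_tHalf_lt_one j₀⟩
  · simp only [↓reduceIte]
    exact ⟨tStart_nonneg j₀, tStart_lt_one j₀⟩

/-- With `1 ≤ N₀` and `1 ≤ ρN` every phase frequency is positive. [cite: ElgindiLissMattingly2025, §1 (u_α on the unit torus, integer frequencies)] -/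
theorem N_pos (P : CascadeParams) (h₀ : 1 ≤ P.N₀) (hρ : 1 ≤ P.ρN) (j : ℕ) : 0 < P.N j := by
  unfold N
  exact Nat.mul_pos (by omega) (Nat.pos_of_ne_zero (pow_ne_zero j (by omega)))

/-- With `0 < δ₀` and `0 < d` every rounding width is positive. [cite: ElgindiLissMattingly2025, Rmk. 1.4 (smoothing of the pulses)] -/
theorem δ_pos (P : CascadeParams) (h₀ : 0 < P.δ₀) (hd : 0 < P.d) (j : ℕ) : 0 < P.δ j := by
  unfold δ
  positivity

end CascadeParams

/-! ### The bump and the strain normalisation -/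

/-- The normalising constant of `bump` is positive. [folklore] -/
private theorem bumpConst_pos :
    0 < ∫ r in (0 : ℝ)..1, expNegInvGlue r * expNegInvGlue (1 - r) := by
  have hc : Continuous fun r : ℝ => expNegInvGlue r * expNegInvGlue (1 - r) :=
    (expNegInvGlue.contDiff (n := 0)).continuous.mul
      ((expNegInvGlue.contDiff (n := 0)).continuous.comp (continuous_const.sub continuous_id))
  refine intervalIntegral.intervalIntegral_pos_of_pos_on (hc.intervalIntegrable _ _) ?_ zero_lt_one
  intro x hx
  exact mul_pos (expNegInvGlue.pos_of_pos hx.1) (expNegInvGlue.pos_of_pos (by linarith [hx.2]))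

/-- `0 ≤ bump`. [cite: ElgindiLissMattingly2025, Rmk. 1.4 (φ ≥ 0)] -/
theorem bump_nonneg (s : ℝ) : 0 ≤ CascadeParams.bump s :=
  div_nonneg (mul_nonneg (expNegInvGlue.nonneg _) (expNegInvGlue.nonneg _)) bumpConst_pos.le

/-- `bump s = 0` for `s ≤ 0`. [cite: ElgindiLissMattingly2025, Rmk. 1.4 (compact support of φ)] -/
theorem bump_of_nonpos {s : ℝ} (hs : s ≤ 0) : CascadeParams.bump s = 0 := by
  simp [CascadeParams.bump, expNegInvGlue.zero_of_nonpos hs]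

/-- `bump s = 0` for `1 ≤ s`. [cite: ElgindiLissMattingly2025, Rmk. 1.4 (compact support of φ)] -/
theorem bump_of_one_le {s : ℝ} (hs : 1 ≤ s) : CascadeParams.bump s = 0 := by
  simp [CascadeParams.bump, expNegInvGlue.zero_of_nonpos (sub_nonpos.2 hs)]

/-- `∫₀¹ bump = 1` (the pulse envelope is normalised). [cite: ElgindiLissMattingly2025, Rmk. 1.4 (∫φ = α, here normalised to 1)] -/
theorem integral_bump : ∫ s in (0 : ℝ)..1, CascadeParams.bump s = 1 := by
  unfold CascadeParams.bump
  rw [intervalIntegral.integral_div, div_self bumpConst_pos.ne']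

namespace CascadeParams

variable (P : CascadeParams)

/-- The H-pulse rate vanishes before its slot. [cite: ElgindiLissMattingly2025, Rmk. 1.4 (compact support of φ)] -/
theorem rateH_of_le_tStart {j : ℕ} {t : ℝ} (ht : t ≤ tStart j) : P.rateH j t = 0 := by
  unfold rateH
  rw [bump_of_nonpos (div_nonpos_of_nonpos_of_nonneg (by linarith) (tHalf_pos j).le), mul_zero]

/-- The H-pulse rate vanishes after its slot. [cite: ElgindiLissMattingly2025, Rmk. 1.4 (compact support of φ)] -/
theorem rateH_of_ge {j : ℕ} {t : ℝ} (ht : tStart j + tHalf j ≤ t) : P.rateH j t = 0 := by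
  unfold rateH
  rw [bump_of_one_le ((one_le_div (tHalf_pos j)).2 (by linarith)), mul_zero]

/-- The V-pulse rate vanishes before its slot. [cite: ElgindiLissMattingly2025, Rmk. 1.4 (compact support of φ)] -/
theorem rateV_of_le {j : ℕ} {t : ℝ} (ht : t ≤ tStart j + tHalf j) : P.rateV j t = 0 := by
  unfold rateV
  rw [bump_of_nonpos (div_nonpos_of_nonpos_of_nonneg (by linarith) (tHalf_pos j).le), mul_zero]

/-- The V-pulse rate vanishes after its slot (in particular from `tStart (j+1)` on). [cite: ElgindiLissMattingly2025, Rmk. 1.4 (compact support of φ)] -/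
theorem rateV_of_ge {j : ℕ} {t : ℝ} (ht : tStart j + 2 * tHalf j ≤ t) : P.rateV j t = 0 := by
  unfold rateV
  rw [bump_of_one_le ((one_le_div (tHalf_pos j)).2 (by linarith)), mul_zero]

/-- Each H half-pulse carries strain exactly `γ`: `∫_{tStart j}^{tStart j + tHalf j} rateH j = γ`.
[cite: ElgindiLissMattingly2025, Rmk. 1.4 (∫φ = α)] -/
theorem integral_rateH (j : ℕ) : ∫ t in tStart j..(tStart j + tHalf j), P.rateH j t = P.γ := by
  have hT : tHalf j ≠ 0 := (tHalf_pos j).ne'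
  have h1 : ∫ t in tStart j..(tStart j + tHalf j), bump ((t - tStart j) / tHalf j) = tHalf j := by
    have h2 := intervalIntegral.integral_comp_sub_right (fun x => bump (x / tHalf j)) (tStart j)
      (a := tStart j) (b := tStart j + tHalf j)
    simp only [sub_self, add_sub_cancel_left] at h2
    rw [h2, intervalIntegral.integral_comp_div (fun x => bump x) hT, zero_div, div_self hT, integral_bump,
      smul_eq_mul, mul_one]
  simp only [rateH]
  rw [intervalIntegral.integral_const_mul, h1, div_mul_cancel₀ _ hT]

/-- Each V half-pulse carries strain exactly `γ`: `∫_{tStart j + tHalf j}^{tStart (j+1)} rateV j = γ`.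
[cite: ElgindiLissMattingly2025, Rmk. 1.4 (∫φ = α)] -/
theorem integral_rateV (j : ℕ) : ∫ t in (tStart j + tHalf j)..tStart (j + 1), P.rateV j t = P.γ := by
  have hT : tHalf j ≠ 0 := (tHalf_pos j).ne'
  have h1 : ∫ t in (tStart j + tHalf j)..tStart (j + 1), bump ((t - tStart j - tHalf j) / tHalf j) = tHalf j := by
    have h2 := intervalIntegral.integral_comp_sub_right (fun x => bump (x / tHalf j)) (tStart j + tHalf j)
      (a := tStart j + tHalf j) (b := tStart (j + 1))
    simp only [sub_self, tStart_succ] at h2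
    have h3 : tStart j + 2 * tHalf j - (tStart j + tHalf j) = tHalf j := by ring
    rw [h3] at h2
    have h4 : (fun t => bump ((t - tStart j - tHalf j) / tHalf j)) = fun t => bump ((t - (tStart j + tHalf j)) / tHalf j) := by
      funext t; rw [sub_sub]
    rw [tStart_succ, h4, h2, intervalIntegral.integral_comp_div (fun x => bump x) hT, zero_div, div_self hT,
      integral_bump, smul_eq_mul, mul_one]
  simp only [rateV]
  rw [intervalIntegral.integral_const_mul, h1, div_mul_cancel₀ _ hT]

end CascadeParams

/-! ## Part 4 — the product form of the dispersion relation and its consequences (proved)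
The dispersion relation of the periodic triangle-wave shear, like Drazin's broken-line jet (2002, Exercise 8.10:
`c² = (α tanh α − 1)(α − tanh α)/(α² tanh α)`, unstable iff `α tanh α < 1`), FACTORISES; every statement below is an
identity or inequality between the closed forms defined in Part 1, proved from `cosh² − sinh² = 1`, the half-angle
formulas and `|e^{iθ}| = 1`. -/

/-- `sinh y < y cosh y` for `y > 0` (termwise on the power series, strict at the cubic term). [folklore] -/
private theorem sinh_lt_mul_cosh {y : ℝ} (hy : 0 < y) : Real.sinh y < y * Real.cosh y := by
  have hs := Real.hasSum_sinh y
  have hc := (Real.hasSum_cosh y).mul_left y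
  have hle : ∀ n : ℕ, y ^ (2 * n + 1) / ((2 * n + 1).factorial : ℝ) ≤
      y * (y ^ (2 * n) / ((2 * n).factorial : ℝ)) := by
    intro n
    have hf2 : (0 : ℝ) < ((2 * n + 1).factorial : ℝ) := by exact_mod_cast Nat.factorial_pos _
    have hfle : (((2 * n).factorial : ℕ) : ℝ) ≤ ((2 * n + 1).factorial : ℕ) := by
      exact_mod_cast Nat.factorial_le (by omega)
    rw [pow_succ, div_le_iff₀ hf2]
    calc y ^ (2 * n) * y = y * (y ^ (2 * n) / ((2 * n).factorial : ℝ)) * ((2 * n).factorial : ℝ) := by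
          field_simp
      _ ≤ y * (y ^ (2 * n) / ((2 * n).factorial : ℝ)) * ((2 * n + 1).factorial : ℝ) :=
          mul_le_mul_of_nonneg_left hfle (by positivity)
  have hlt : y ^ (2 * 1 + 1) / ((2 * 1 + 1).factorial : ℝ) < y * (y ^ (2 * 1) / ((2 * 1).factorial : ℝ)) := by
    norm_num [Nat.factorial]
    nlinarith [pow_pos hy 3]
  exact hasSum_lt hle hlt hs hc

/-- `tanh y < y` for `y > 0`. [folklore] -/
private theorem tanh_lt_self {y : ℝ} (hy : 0 < y) : Real.tanh y < y := by
  rw [Real.tanh_eq_sinh_div_cosh, div_lt_iff₀ (Real.cosh_pos y)]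
  exact sinh_lt_mul_cosh hy

/-- `0 < tanh y` for `y > 0`. [folklore] -/
private theorem tanh_pos {y : ℝ} (hy : 0 < y) : 0 < Real.tanh y := by
  rw [Real.tanh_eq_sinh_div_cosh]
  exact div_pos (Real.sinh_pos_iff.2 hy) (Real.cosh_pos y)

/-- `1 < y tanh y` for `y ≥ 3/2` (from `e^{3/2} ≥ 1 + 3/2 + 9/8 = 29/8`). [folklore] -/
private theorem one_lt_mul_tanh {y : ℝ} (hy : 3 / 2 ≤ y) : 1 < y * Real.tanh y := by
  have hu0 : 0 < Real.exp y := Real.exp_pos y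
  have hv0 : 0 < Real.exp (-y) := Real.exp_pos (-y)
  have huv : Real.exp y * Real.exp (-y) = 1 := by rw [← Real.exp_add, add_neg_cancel, Real.exp_zero]
  have hu : (29 : ℝ) / 8 ≤ Real.exp y := by
    have h1 := Real.quadratic_le_exp_of_nonneg (show (0 : ℝ) ≤ 3 / 2 by norm_num)
    have h2 : Real.exp (3 / 2) ≤ Real.exp y := Real.exp_le_exp.2 hy
    norm_num at h1
    linarith
  have hvu : Real.exp (-y) ≤ Real.exp y := Real.exp_le_exp.2 (by linarith)
  rw [Real.tanh_eq, mul_div_assoc', one_lt_div (by positivity)]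
  nlinarith [mul_nonneg (sub_nonneg.2 hy) (sub_nonneg.2 hvu)]

/-- `q ≠ 1` for `k ≠ 0`. [folklore] -/
private theorem sawQ_ne_one {k : ℝ} (hk : k ≠ 0) : sawQ k ≠ 1 := by
  unfold sawQ
  rw [Ne, Real.exp_eq_one_iff, neg_eq_zero]
  exact mul_ne_zero (mul_ne_zero two_ne_zero Real.pi_ne_zero) hk

/-- The denominator `D = 1 − 2q cos θ + q² = |1 − q e^{iθ}|²` is positive for `k ≠ 0`. [folklore] -/
private theorem sawD_pos {k : ℝ} (hk : k ≠ 0) (θ : ℝ) :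
    0 < 1 - 2 * sawQ k * Real.cos θ + sawQ k ^ 2 := by
  have hq := sawQ_pos k
  have hq1 := sawQ_ne_one hk
  have hc := Real.cos_le_one θ
  have h1 : 0 < (1 - sawQ k) ^ 2 := by
    have : 1 - sawQ k ≠ 0 := sub_ne_zero.2 (Ne.symm hq1)
    positivity
  nlinarith

/-- `|S_β|²` in closed form: `|S_β(k)|² = (e^{−kπ}/(2k))² (1 − q)² (2 + 2 cos 2πβ) / D²`, `D = 1 − 2q cos 2πβ + q²`
(`1/(1 − zq) + z̄/(1 − z̄q) = (1 − q)(1 + z̄)/|1 − zq|²` for `|z| = 1`). [cite: Drazin2002, §8.3 (8.36)–(8.38) (piecewise-exponential eigenfunctions; the lattice sum of their tails)] -/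
theorem normSq_sawS {k : ℝ} (hk : k ≠ 0) (β : ℝ) :
    Complex.normSq (sawS k β) =
      (Real.exp (-(k * Real.pi)) / (2 * k)) ^ 2 * ((1 - sawQ k) ^ 2 * (2 + 2 * Real.cos (2 * Real.pi * β)))
        / (1 - 2 * sawQ k * Real.cos (2 * Real.pi * β) + sawQ k ^ 2) ^ 2 := by
  have hD := sawD_pos hk (2 * Real.pi * β)
  set q := sawQ k with hq_def
  set θ := 2 * Real.pi * β with hθ
  set c := Real.exp (-(k * Real.pi)) / (2 * k) with hc
  set D := 1 - 2 * q * Real.cos θ + q ^ 2 with hD_def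
  set z : ℂ := Complex.exp ((θ : ℂ) * Complex.I) with hz_def
  have hz : z = ⟨Real.cos θ, Real.sin θ⟩ := by
    apply Complex.ext <;> simp [hz_def, Complex.exp_re, Complex.exp_im]
  have hsc := Real.sin_sq_add_cos_sq θ
  have hnz : Complex.normSq z = 1 := by
    rw [hz, Complex.normSq_mk]; nlinarith [hsc]
  have hzz : z * (starRingEnd ℂ) z = 1 := by
    rw [Complex.mul_conj, hnz]; simp
  have hnormSq_a : Complex.normSq (1 - z * (q : ℂ)) = D := by
    rw [hz, hD_def]
    simp [Complex.normSq_apply]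
    nlinarith [hsc]
  have ha0 : (1 : ℂ) - z * (q : ℂ) ≠ 0 := by
    intro h
    rw [h, map_zero] at hnormSq_a
    exact hD.ne' hnormSq_a.symm
  have hconja : (starRingEnd ℂ) (1 - z * (q : ℂ)) = 1 - (starRingEnd ℂ) z * (q : ℂ) := by
    rw [map_sub, map_one, map_mul, Complex.conj_ofReal]
  have hb0 : (1 : ℂ) - (starRingEnd ℂ) z * (q : ℂ) ≠ 0 := by
    rw [← hconja]
    exact (map_ne_zero_iff _ (RingHom.injective _)).2 ha0
  have hsum : 1 / (1 - z * (q : ℂ)) + (starRingEnd ℂ) z / (1 - (starRingEnd ℂ) z * (q : ℂ)) =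
      (((1 - q : ℝ) : ℂ) * (1 + (starRingEnd ℂ) z)) / (D : ℂ) := by
    rw [div_add_div _ _ ha0 hb0, ← hconja, Complex.mul_conj, hnormSq_a]
    congr 1
    rw [hconja]
    push_cast
    linear_combination (-(q : ℂ)) * hzz
  have hDC : (D : ℂ) ≠ 0 := by exact_mod_cast hD.ne'
  have hS : sawS k β = (((-c * (1 - q) / D) : ℝ) : ℂ) * (1 + (starRingEnd ℂ) z) := by
    simp only [sawS]
    rw [← hq_def, ← hθ, ← hz_def, ← hc, hsum]
    push_cast
    field_simp
  have h1z : Complex.normSq (1 + (starRingEnd ℂ) z) = 2 + 2 * Real.cos θ := by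
    rw [hz]
    simp [Complex.normSq_apply]
    nlinarith [hsc]
  rw [hS, map_mul, Complex.normSq_ofReal, h1z]
  field_simp

/-- THE PRODUCT FORM of the triangle-wave dispersion relation: for every `k ≠ 0` and every Bloch phase `β`,
`c²(k,β) = (π/2 − sinh πk/(k(cosh πk − cos πβ))) · (π/2 − sinh πk/(k(cosh πk + cos πβ)))` (ad-p2 ROUND-2 §4.4;
the analogue of Drazin's broken-line jet relation). [cite: Drazin2002, §8.3 (8.36)–(8.38) and Exercise 8.10 (product-form eigenvalue relation of a broken-line profile)] -/
theorem sawC2_eq_sawC2prod {k : ℝ} (hk : k ≠ 0) (β : ℝ) : sawC2 k β = sawC2prod k β := by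
  have hS := normSq_sawS hk β
  have hγ1 := Real.cos_le_one (Real.pi * β)
  have hγ2 := Real.neg_one_le_cos (Real.pi * β)
  have hE0 : 0 < Real.exp (Real.pi * k) := Real.exp_pos _
  have hE1 : Real.exp (Real.pi * k) ≠ 1 := by
    rw [Ne, Real.exp_eq_one_iff]
    exact mul_ne_zero Real.pi_ne_zero hk
  have hq : sawQ k = (Real.exp (Real.pi * k))⁻¹ ^ 2 := by
    rw [← Real.exp_neg, ← Real.exp_nat_mul]
    unfold sawQ
    congr 1
    push_cast
    ring
  have hkp : Real.exp (-(k * Real.pi)) = (Real.exp (Real.pi * k))⁻¹ := by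
    rw [mul_comm, Real.exp_neg]
  have hsinh : Real.sinh (Real.pi * k) = (Real.exp (Real.pi * k) - (Real.exp (Real.pi * k))⁻¹) / 2 := by
    rw [Real.sinh_eq, Real.exp_neg]
  have hcosh : Real.cosh (Real.pi * k) = (Real.exp (Real.pi * k) + (Real.exp (Real.pi * k))⁻¹) / 2 := by
    rw [Real.cosh_eq, Real.exp_neg]
  have hcos2 : Real.cos (2 * Real.pi * β) = 2 * Real.cos (Real.pi * β) ^ 2 - 1 := by
    rw [show 2 * Real.pi * β = 2 * (Real.pi * β) by ring, Real.cos_two_mul]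
  unfold sawC2 sawC2prod sawSigma0
  rw [hS, hkp, hq, hsinh, hcosh, hcos2]
  generalize Real.exp (Real.pi * k) = E at hE0 hE1 ⊢
  generalize Real.cos (Real.pi * β) = γ at hγ1 hγ2 ⊢
  -- pure algebra in `E, γ, k, π`
  have hE : E ≠ 0 := hE0.ne'
  have hsq : 0 < (E - 1) ^ 2 := by
    have : E - 1 ≠ 0 := sub_ne_zero.2 hE1
    positivity
  have hA : E ^ 2 + 1 - 2 * E * γ ≠ 0 := by nlinarith
  have hB : E ^ 2 + 1 + 2 * E * γ ≠ 0 := by nlinarith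
  have hden1 : (E + E⁻¹) / 2 - γ = (E ^ 2 + 1 - 2 * E * γ) / (2 * E) := by
    field_simp
  have hden2 : (E + E⁻¹) / 2 + γ = (E ^ 2 + 1 + 2 * E * γ) / (2 * E) := by
    field_simp
  have hdenD : 1 - 2 * E⁻¹ ^ 2 * (2 * γ ^ 2 - 1) + (E⁻¹ ^ 2) ^ 2 =
      (E ^ 2 + 1 - 2 * E * γ) * (E ^ 2 + 1 + 2 * E * γ) / E ^ 4 := by
    field_simp
    ring
  rw [hden1, hden2, hdenD]
  have hpi : Real.pi ≠ 0 := Real.pi_ne_zero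
  field_simp
  ring

/-- At `β = 0` the product form equals the lattice form `sawC2zero` (`sinh 2x/(cosh 2x ∓ 1) = coth x, tanh x`).
[cite: Drazin2002, §8.3 (8.36)–(8.38) and Exercise 8.10] -/
theorem sawC2prod_zero {k : ℝ} (hk : k ≠ 0) : sawC2prod k 0 = sawC2zero k := by
  have hx : Real.pi * k ≠ 0 := mul_ne_zero Real.pi_ne_zero hk
  set s := Real.sinh (Real.pi * k) with hs_def
  set c := Real.cosh (Real.pi * k) with hc_def
  have hs : s ≠ 0 := Real.sinh_ne_zero.2 hx
  have hc1 : c - 1 ≠ 0 := sub_ne_zero.2 (ne_of_gt (Real.one_lt_cosh.2 hx))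
  have hc2 : c + 1 ≠ 0 := by have := Real.cosh_pos (Real.pi * k); positivity
  have hcs : c ^ 2 - s ^ 2 = 1 := Real.cosh_sq_sub_sinh_sq (Real.pi * k)
  have e1 : s / (k * (c - 1)) = (c + 1) / (k * s) := by
    rw [div_eq_div_iff (mul_ne_zero hk hc1) (mul_ne_zero hk hs)]
    linear_combination (-k) * hcs
  have e2 : s / (k * (c + 1)) = (c - 1) / (k * s) := by
    rw [div_eq_div_iff (mul_ne_zero hk hc2) (mul_ne_zero hk hs)]
    linear_combination (-k) * hcs
  have hkpi : k * Real.pi = Real.pi * k := mul_comm _ _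
  unfold sawC2prod sawC2zero
  rw [mul_zero, Real.cos_zero, hkpi, ← hs_def, ← hc_def, e1, e2]
  have hks : k * s ≠ 0 := mul_ne_zero hk hs
  field_simp
  ring

/-- At `β = 0` the dispersion relation `sawC2` equals the lattice form `sawC2zero` (ad-p2's SawtoothC2ZeroAgrees).
[cite: Drazin2002, §8.3 (8.36)–(8.38) and Exercise 8.10] -/
theorem sawC2_zero_eq_sawC2zero {k : ℝ} (hk : k ≠ 0) : sawC2 k 0 = sawC2zero k := by
  rw [sawC2_eq_sawC2prod hk, sawC2prod_zero hk]

/-- Half-angle form of the growth rate: `k²(−c²(k,0)) = (x − tanh x)(coth x − x)`, `x = πk/2` (`k ≠ 0`) —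
Drazin's `(α tanh α − 1)(α − tanh α)` structure (ad-p2's SawtoothSigmaSqHalfAngle).
[cite: Drazin2002, Exercise 8.10 (c² = (α tanh α − 1)(α − tanh α)/(α² tanh α))] -/
theorem sq_mul_neg_sawC2zero {k : ℝ} (hk : k ≠ 0) :
    k ^ 2 * (-(sawC2zero k)) =
      (Real.pi * k / 2 - Real.tanh (Real.pi * k / 2)) * (1 / Real.tanh (Real.pi * k / 2) - Real.pi * k / 2) := by
  rw [← sawC2prod_zero hk]
  have hx : Real.pi * k / 2 ≠ 0 := div_ne_zero (mul_ne_zero Real.pi_ne_zero hk) two_ne_zero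
  set x := Real.pi * k / 2 with hx_def
  have h2x : Real.pi * k = 2 * x := by rw [hx_def]; ring
  set sh := Real.sinh x
  set ch := Real.cosh x
  have hsh : sh ≠ 0 := Real.sinh_ne_zero.2 hx
  have hch : ch ≠ 0 := (Real.cosh_pos x).ne'
  have hcs : ch ^ 2 - sh ^ 2 = 1 := Real.cosh_sq_sub_sinh_sq x
  have ht : Real.tanh x = sh / ch := Real.tanh_eq_sinh_div_cosh x
  have hs2 : Real.sinh (Real.pi * k) = 2 * sh * ch := by rw [h2x, Real.sinh_two_mul]
  have hc2 : Real.cosh (Real.pi * k) = ch ^ 2 + sh ^ 2 := by rw [h2x, Real.cosh_two_mul]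
  unfold sawC2prod
  rw [mul_zero, Real.cos_zero, hs2, hc2, ht]
  have hk2 : k = 2 * x / Real.pi := by rw [hx_def]; field_simp
  rw [hk2]
  have hpi : Real.pi ≠ 0 := Real.pi_ne_zero
  have hA : ch ^ 2 + sh ^ 2 - 1 = 2 * sh ^ 2 := by linarith
  have hB : ch ^ 2 + sh ^ 2 + 1 = 2 * ch ^ 2 := by linarith
  rw [hA, hB]
  field_simp
  ring

/-- Band criterion: for `k > 0`, `c²(k,0) < 0` (instability) iff `x tanh x < 1`, `x = πk/2` — the band edge is the
fixed point `coth x* = x*` (ad-p2's SawtoothBandIffCothFixedPoint; Drazin: "unstable if α < α_c, α_c the positive root of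
α tanh α = 1"). [cite: Drazin2002, Exercise 8.10 (instability iff α tanh α < 1)] -/
theorem sawC2zero_neg_iff {k : ℝ} (hk : 0 < k) :
    sawC2zero k < 0 ↔ Real.pi * k / 2 * Real.tanh (Real.pi * k / 2) < 1 := by
  have hx : 0 < Real.pi * k / 2 := by positivity
  have ht : 0 < Real.tanh (Real.pi * k / 2) := tanh_pos hx
  have htl : Real.tanh (Real.pi * k / 2) < Real.pi * k / 2 := tanh_lt_self hx
  have key := sq_mul_neg_sawC2zero hk.ne'
  have hk2 : 0 < k ^ 2 := by positivity
  constructor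
  · intro h
    have h1 : 0 < k ^ 2 * (-(sawC2zero k)) := mul_pos hk2 (by linarith)
    rw [key] at h1
    have h2 : 0 < 1 / Real.tanh (Real.pi * k / 2) - Real.pi * k / 2 :=
      pos_of_mul_pos_right h1 (by linarith)
    rw [div_sub' ht.ne'] at h2
    have := (div_pos_iff_of_pos_right ht).1 h2
    nlinarith
  · intro h
    have h2 : 0 < 1 / Real.tanh (Real.pi * k / 2) - Real.pi * k / 2 := by
      rw [div_sub' ht.ne']
      exact div_pos (by nlinarith) ht
    have h1 : 0 < k ^ 2 * (-(sawC2zero k)) := by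
      rw [key]; exact mul_pos (by linarith) h2
    by_contra hc
    have hc' := not_lt.1 hc
    have : k ^ 2 * (-(sawC2zero k)) ≤ 0 := mul_nonpos_of_nonneg_of_nonpos hk2.le (by linarith)
    linarith

/-- Stability criterion: for `k > 0`, `0 < c²(k,0)` iff `1 < x tanh x`, `x = πk/2`.
[cite: Drazin2002, Exercise 8.10 (stability iff α tanh α > 1)] -/
theorem sawC2zero_pos_iff {k : ℝ} (hk : 0 < k) :
    0 < sawC2zero k ↔ 1 < Real.pi * k / 2 * Real.tanh (Real.pi * k / 2) := by
  have hx : 0 < Real.pi * k / 2 := by positivity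
  have ht : 0 < Real.tanh (Real.pi * k / 2) := tanh_pos hx
  have htl : Real.tanh (Real.pi * k / 2) < Real.pi * k / 2 := tanh_lt_self hx
  have key := sq_mul_neg_sawC2zero hk.ne'
  have hk2 : 0 < k ^ 2 := by positivity
  constructor
  · intro h
    have h1 : k ^ 2 * (-(sawC2zero k)) < 0 := by nlinarith
    rw [key] at h1
    have h2 : 1 / Real.tanh (Real.pi * k / 2) - Real.pi * k / 2 < 0 := by
      by_contra hc
      have hc' := not_lt.1 hc
      have : 0 ≤ (Real.pi * k / 2 - Real.tanh (Real.pi * k / 2)) *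
          (1 / Real.tanh (Real.pi * k / 2) - Real.pi * k / 2) := mul_nonneg (by linarith) hc'
      linarith
    rw [div_sub' ht.ne'] at h2
    have h3 : 1 - Real.tanh (Real.pi * k / 2) * (Real.pi * k / 2) < 0 := by
      by_contra hc
      have hc' := not_lt.1 hc
      have := div_nonneg hc' ht.le
      linarith
    nlinarith
  · intro h
    have h2 : 1 / Real.tanh (Real.pi * k / 2) - Real.pi * k / 2 < 0 := by
      rw [div_sub' ht.ne']
      exact div_neg_of_neg_of_pos (by nlinarith) ht
    have h1 : k ^ 2 * (-(sawC2zero k)) < 0 := by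
      rw [key]; exact mul_neg_of_pos_of_neg (by linarith) h2
    by_contra hc
    have hc' := not_lt.1 hc
    have : 0 ≤ k ^ 2 * (-(sawC2zero k)) := mul_nonneg hk2.le (by linarith)
    linarith

/-- Every wavenumber `k ≥ 1` (in units of the base frequency) is neutrally stable: `0 < c²(k,0)`
(`x = πk/2 ≥ π/2 > 3/2` and `y tanh y > 1` for `y ≥ 3/2`). [cite: Drazin2002, Exercise 8.10 (stability iff α tanh α > 1)] -/
theorem sawC2zero_pos_of_one_le {k : ℝ} (hk : 1 ≤ k) : 0 < sawC2zero k := by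
  have hk0 : 0 < k := by linarith
  rw [sawC2zero_pos_iff hk0]
  apply one_lt_mul_tanh
  have := Real.pi_gt_three
  nlinarith

/-- Integer harmonics are neutral: `0 < c²(n, 0)` for every integer `n ≥ 1` (ad-p2's SawtoothIntegerHarmonicsNeutral).
[cite: Drazin2002, Exercise 8.10 (stability iff α tanh α > 1)] -/
theorem sawC2zero_natCast_pos {n : ℕ} (hn : 1 ≤ n) : 0 < sawC2zero n :=
  sawC2zero_pos_of_one_le (by exact_mod_cast hn)

/-- The subharmonic Bloch phase `β = ½` is a perfect square: `0 ≤ c²(k, ½)` for `k ≠ 0`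
(both factors of the product form coincide when `cos πβ = 0`; ad-p2's SawtoothSubharmonicStable).
[cite: Drazin2002, §8.3 (8.36)–(8.38) and Exercise 8.10] -/
theorem sawC2_half_nonneg {k : ℝ} (hk : k ≠ 0) : 0 ≤ sawC2 k (1 / 2) := by
  rw [sawC2_eq_sawC2prod hk]
  unfold sawC2prod
  rw [show Real.pi * (1 / 2) = Real.pi / 2 by ring, Real.cos_pi_div_two, sub_zero, add_zero]
  exact mul_self_nonneg _

/-- Bloch domination by `β = 0`: for `k > 0` and every `β`, `k²(−c²(k,β)) ≤ max 0 (k²(−c²(k,0)))` — in the product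
form both factors `sinh πk/(k(cosh πk − |cos πβ|)) − π/2` and `π/2 − sinh πk/(k(cosh πk + |cos πβ|))` increase with
`|cos πβ|`, and they cannot both be negative (ad-p2's SawtoothBlochDominated; ROUND-2 §4.4 "Bloch monotonicity").
[cite: Drazin2002, §8.3 (8.36)–(8.38) and Exercise 8.10] -/
theorem sq_mul_neg_sawC2_le_max {k : ℝ} (hk : 0 < k) (β : ℝ) :
    k ^ 2 * (-(sawC2 k β)) ≤ max 0 (k ^ 2 * (-(sawC2 k 0))) := by
  rw [sawC2_eq_sawC2prod hk.ne', sawC2_eq_sawC2prod hk.ne']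
  unfold sawC2prod
  rw [mul_zero, Real.cos_zero]
  have hx : Real.pi * k ≠ 0 := mul_ne_zero Real.pi_ne_zero hk.ne'
  set s := Real.sinh (Real.pi * k) with hs_def
  set C := Real.cosh (Real.pi * k) with hC_def
  have hs : 0 < s := Real.sinh_pos_iff.2 (by positivity)
  have hC : 1 < C := Real.one_lt_cosh.2 hx
  -- reduce to `g = |cos πβ| ∈ [0, 1]`
  set γ := Real.cos (Real.pi * β) with hγ_def
  set g := |γ| with hg_def
  have hg0 : 0 ≤ g := abs_nonneg _
  have hg1 : g ≤ 1 := Real.abs_cos_le_one _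
  have hsym : (Real.pi / 2 - s / (k * (C - γ))) * (Real.pi / 2 - s / (k * (C + γ))) =
      (Real.pi / 2 - s / (k * (C - g))) * (Real.pi / 2 - s / (k * (C + g))) := by
    rcases le_or_gt 0 γ with h | h
    · rw [hg_def, abs_of_nonneg h]
    · rw [hg_def, abs_of_neg h, sub_neg_eq_add, ← sub_eq_add_neg, mul_comm]
  rw [hsym]
  have hCg : 0 < C - g := by linarith
  have hCg' : 0 < C + g := by linarith
  have hC1 : 0 < C - 1 := by linarith
  have hkCg : 0 < k * (C - g) := mul_pos hk hCg
  have hkCg' : 0 < k * (C + g) := mul_pos hk hCg'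
  -- the two factors `f1 = s/(k(C-g)) - π/2`, `f2 = π/2 - s/(k(C+g))`, and their values at `g = 1`
  have hmono1 : s / (k * (C - g)) ≤ s / (k * (C - 1)) :=
    div_le_div_of_nonneg_left hs.le (mul_pos hk hC1) (by nlinarith)
  have hmono2 : s / (k * (C + 1)) ≤ s / (k * (C + g)) :=
    div_le_div_of_nonneg_left hs.le hkCg' (by nlinarith)
  have hord : s / (k * (C + g)) ≤ s / (k * (C - g)) :=
    div_le_div_of_nonneg_left hs.le hkCg (by nlinarith)
  have hk2 : 0 < k ^ 2 := by positivity
  -- name the four quantities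
  set a := s / (k * (C - g)) with ha
  set b := s / (k * (C + g)) with hb
  set a1 := s / (k * (C - 1)) with ha1
  set b1 := s / (k * (C + 1)) with hb1
  have key : k ^ 2 * (-((Real.pi / 2 - a) * (Real.pi / 2 - b))) = k ^ 2 * ((a - Real.pi / 2) * (Real.pi / 2 - b)) := by
    ring
  have key1 : k ^ 2 * (-((Real.pi / 2 - a1) * (Real.pi / 2 - b1))) =
      k ^ 2 * ((a1 - Real.pi / 2) * (Real.pi / 2 - b1)) := by ring
  rw [key, key1]
  rcases le_or_gt (a - Real.pi / 2) 0 with h1 | h1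
  · -- first factor ≤ 0 ⇒ second factor ≥ 0 ⇒ product ≤ 0
    have h2 : 0 ≤ Real.pi / 2 - b := by linarith
    have : k ^ 2 * ((a - Real.pi / 2) * (Real.pi / 2 - b)) ≤ 0 :=
      mul_nonpos_of_nonneg_of_nonpos hk2.le (mul_nonpos_of_nonpos_of_nonneg h1 h2)
    exact le_trans this (le_max_left _ _)
  · rcases le_or_gt (Real.pi / 2 - b) 0 with h2 | h2
    · have : k ^ 2 * ((a - Real.pi / 2) * (Real.pi / 2 - b)) ≤ 0 :=
        mul_nonpos_of_nonneg_of_nonpos hk2.le (mul_nonpos_of_nonneg_of_nonpos h1.le h2)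
      exact le_trans this (le_max_left _ _)
    · -- both factors positive: each is dominated by its value at `g = 1`
      have h3 : a - Real.pi / 2 ≤ a1 - Real.pi / 2 := by linarith
      have h4 : Real.pi / 2 - b ≤ Real.pi / 2 - b1 := by linarith
      have h5 : (a - Real.pi / 2) * (Real.pi / 2 - b) ≤ (a1 - Real.pi / 2) * (Real.pi / 2 - b1) :=
        mul_le_mul h3 h4 h2.le (by linarith)
      exact le_trans (mul_le_mul_of_nonneg_left h5 hk2.le) (le_max_right _ _)

/-! ### Long-wave limit -/

/-- The series of `x cosh x − sinh x`: `Σ_n (x·x^{2n}/(2n)! − x^{2n+1}/(2n+1)!)`. [folklore] -/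
private theorem hasSum_mul_cosh_sub_sinh (x : ℝ) :
    HasSum (fun n : ℕ => x * (x ^ (2 * n) / ((2 * n).factorial : ℝ)) - x ^ (2 * n + 1) / ((2 * n + 1).factorial : ℝ))
      (x * Real.cosh x - Real.sinh x) :=
  ((Real.hasSum_cosh x).mul_left x).sub (Real.hasSum_sinh x)

/-- Each term of that series is nonnegative for `x ≥ 0`. [folklore] -/
private theorem term_nonneg {x : ℝ} (hx : 0 ≤ x) (n : ℕ) :
    0 ≤ x * (x ^ (2 * n) / ((2 * n).factorial : ℝ)) - x ^ (2 * n + 1) / ((2 * n + 1).factorial : ℝ) := by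
  have hf1 : (0 : ℝ) < ((2 * n).factorial : ℝ) := by exact_mod_cast Nat.factorial_pos _
  have hf2 : (0 : ℝ) < ((2 * n + 1).factorial : ℝ) := by exact_mod_cast Nat.factorial_pos _
  have hfle : (((2 * n).factorial : ℕ) : ℝ) ≤ ((2 * n + 1).factorial : ℕ) := by
    exact_mod_cast Nat.factorial_le (by omega)
  rw [sub_nonneg, pow_succ, div_le_iff₀ hf2]
  calc x ^ (2 * n) * x = x * (x ^ (2 * n) / ((2 * n).factorial : ℝ)) * ((2 * n).factorial : ℝ) := by
        field_simp
    _ ≤ x * (x ^ (2 * n) / ((2 * n).factorial : ℝ)) * ((2 * n + 1).factorial : ℝ) :=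
        mul_le_mul_of_nonneg_left hfle (by positivity)

/-- `x³/3 ≤ x cosh x − sinh x` for `x ≥ 0` (the `n = 1` term). [folklore] -/
private theorem cube_div_three_le {x : ℝ} (hx : 0 ≤ x) : x ^ 3 / 3 ≤ x * Real.cosh x - Real.sinh x := by
  have h := sum_le_hasSum {1} (fun n _ => term_nonneg hx n) (hasSum_mul_cosh_sub_sinh x)
  simp only [Finset.sum_singleton] at h
  norm_num [Nat.factorial] at h
  linarith

/-- `x cosh x − sinh x ≤ (x³/3) cosh x` for `x ≥ 0` (termwise: `1/((2n+3)(2n+1)) ≤ 1/3`). [folklore] -/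
private theorem mul_cosh_sub_sinh_le {x : ℝ} (hx : 0 ≤ x) :
    x * Real.cosh x - Real.sinh x ≤ x ^ 3 / 3 * Real.cosh x := by
  have h := (hasSum_nat_add_iff' 1).2 (hasSum_mul_cosh_sub_sinh x)
  have h0 : (∑ i ∈ Finset.range 1,
      (x * (x ^ (2 * i) / ((2 * i).factorial : ℝ)) - x ^ (2 * i + 1) / ((2 * i + 1).factorial : ℝ))) = 0 := by
    simp [Nat.factorial]
  rw [h0, sub_zero] at h
  have hc := (Real.hasSum_cosh x).mul_left (x ^ 3 / 3)
  refine hasSum_le (fun n => ?_) h hc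
  -- term `n` of the shifted series vs `(x³/3) x^{2n}/(2n)!`
  have hF : (0 : ℝ) < ((2 * n).factorial : ℝ) := by exact_mod_cast Nat.factorial_pos _
  have e1 : (((2 * (n + 1)).factorial : ℕ) : ℝ) = (2 * n + 2) * (2 * n + 1) * ((2 * n).factorial : ℝ) := by
    rw [show 2 * (n + 1) = (2 * n + 1) + 1 by ring, Nat.factorial_succ, Nat.factorial_succ]
    push_cast
    ring
  have e2 : (((2 * (n + 1) + 1).factorial : ℕ) : ℝ) = (2 * n + 3) * (2 * n + 2) * (2 * n + 1) * ((2 * n).factorial : ℝ) := by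
    rw [show 2 * (n + 1) + 1 = (2 * n + 2) + 1 by ring, Nat.factorial_succ,
      show 2 * n + 2 = (2 * n + 1) + 1 by ring, Nat.factorial_succ, Nat.factorial_succ]
    push_cast
    ring
  rw [e1, e2]
  have hx2 : x ^ (2 * (n + 1)) = x ^ (2 * n) * x ^ 2 := by rw [show 2 * (n + 1) = 2 * n + 2 by ring, pow_add]
  have hx3 : x ^ (2 * (n + 1) + 1) = x ^ (2 * n) * x ^ 3 := by rw [show 2 * (n + 1) + 1 = 2 * n + 3 by ring, pow_add]
  rw [hx2, hx3]
  have hxn : 0 ≤ x ^ (2 * n) := pow_nonneg hx _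
  have hn : (0 : ℝ) ≤ n := Nat.cast_nonneg n
  rw [show x * (x ^ (2 * n) * x ^ 2 / ((2 * n + 2) * (2 * n + 1) * ((2 * n).factorial : ℝ))) -
      x ^ (2 * n) * x ^ 3 / ((2 * n + 3) * (2 * n + 2) * (2 * n + 1) * ((2 * n).factorial : ℝ)) =
      x ^ (2 * n) * x ^ 3 / ((2 * n).factorial : ℝ) * (1 / ((2 * n + 3) * (2 * n + 1))) by
    field_simp
    ring]
  rw [show x ^ 3 / 3 * (x ^ (2 * n) / ((2 * n).factorial : ℝ)) = x ^ (2 * n) * x ^ 3 / ((2 * n).factorial : ℝ) * (1 / 3) by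
    ring]
  apply mul_le_mul_of_nonneg_left _ (by positivity)
  exact one_div_le_one_div_of_le (by norm_num) (by nlinarith)

/-- The long-wave limit `c²(k,0) → −π²/12` as `k → 0⁺` — the value `−⟨U²⟩` of the long-wave theory for the profile
`U = arcsin ∘ sin` (`⟨U²⟩ = (π/2)²/3`); ad-p2's SawtoothLongWave. Proof: `c² = −(π²/4)·A·C/(cosh x · B)` with
`A = (x cosh x − sinh x)/x³ → 1/3` (squeezed between `1/3` and `cosh x/3`), `B = sinh x/x → 1`, `C = cosh x − x sinh x → 1`.
[cite: Drazin2002, Exercise 8.10 (the broken-line relation c² = (α tanh α − 1)(α − tanh α)/(α² tanh α), whose α → 0 limit is the analogous computation) and §8.2 (general properties of Rayleigh's problem)] -/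
theorem tendsto_sawC2zero_zero :
    Tendsto sawC2zero (nhdsWithin 0 (Ioi 0)) (nhds (-(Real.pi ^ 2 / 12))) := by
  -- the factorisation `c² = −(π²/4) · A · C / (cosh x · B)` on `k > 0`, `x = πk/2`
  set A : ℝ → ℝ := fun x => (x * Real.cosh x - Real.sinh x) / x ^ 3 with hA
  set B : ℝ → ℝ := fun x => Real.sinh x / x with hB
  set C : ℝ → ℝ := fun x => Real.cosh x - x * Real.sinh x with hC
  have hfac : ∀ k : ℝ, 0 < k → sawC2zero k =
      -(Real.pi ^ 2 / 4) * (A (Real.pi * k / 2) * C (Real.pi * k / 2) /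
        (Real.cosh (Real.pi * k / 2) * B (Real.pi * k / 2))) := by
    intro k hk
    have hx : 0 < Real.pi * k / 2 := by positivity
    have key := sq_mul_neg_sawC2zero hk.ne'
    set x := Real.pi * k / 2 with hx_def
    have hsh : 0 < Real.sinh x := Real.sinh_pos_iff.2 hx
    have hch : 0 < Real.cosh x := Real.cosh_pos x
    have hk2 : k ^ 2 = 4 * x ^ 2 / Real.pi ^ 2 := by
      rw [hx_def]; field_simp; ring
    rw [Real.tanh_eq_sinh_div_cosh] at key
    have hB0 : B x ≠ 0 := by simp only [hB]; exact (div_pos hsh hx).ne'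
    -- solve `key : k² (−c²) = (x − sh/ch)(ch/sh − x)` for `c²`
    have hk2' : k ^ 2 ≠ 0 := by positivity
    have : sawC2zero k = -((x - Real.sinh x / Real.cosh x) * (1 / (Real.sinh x / Real.cosh x) - x)) / k ^ 2 := by
      field_simp at key ⊢
      linarith
    rw [this, hk2]
    simp only [hA, hB, hC]
    field_simp
    try ring
  -- limits of the four factors as `k → 0⁺`
  have hxt : Tendsto (fun k : ℝ => Real.pi * k / 2) (nhdsWithin 0 (Ioi 0)) (nhdsWithin 0 (Ioi 0)) := by
    apply tendsto_nhdsWithin_of_tendsto_nhds_of_eventually_within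
    · have : Tendsto (fun k : ℝ => Real.pi * k / 2) (nhds 0) (nhds (Real.pi * 0 / 2)) :=
        ((continuous_const.mul continuous_id).div_const _).tendsto 0
      rw [mul_zero, zero_div] at this
      exact this.mono_left nhdsWithin_le_nhds
    · filter_upwards [self_mem_nhdsWithin] with k hk
      have hk' : 0 < k := hk
      exact show 0 < Real.pi * k / 2 by positivity
  have hcosh1 : Tendsto (fun x : ℝ => Real.cosh x) (nhdsWithin 0 (Ioi 0)) (nhds 1) := by
    have := Real.continuous_cosh.tendsto 0
    rw [Real.cosh_zero] at this
    exact this.mono_left nhdsWithin_le_nhds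
  have hC1 : Tendsto C (nhdsWithin 0 (Ioi 0)) (nhds 1) := by
    have hc : Continuous C := Real.continuous_cosh.sub (continuous_id.mul Real.continuous_sinh)
    have := hc.tendsto 0
    simp only [hC, Real.cosh_zero, Real.sinh_zero, mul_zero, sub_zero] at this
    exact this.mono_left nhdsWithin_le_nhds
  have hA1 : Tendsto A (nhdsWithin 0 (Ioi 0)) (nhds (1 / 3)) := by
    -- squeeze `1/3 ≤ A x ≤ cosh x / 3` for `x > 0`
    have hup : Tendsto (fun x : ℝ => Real.cosh x / 3) (nhdsWithin 0 (Ioi 0)) (nhds (1 / 3)) := by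
      simpa using hcosh1.div_const 3
    refine tendsto_of_tendsto_of_tendsto_of_le_of_le' tendsto_const_nhds hup ?_ ?_
    · filter_upwards [self_mem_nhdsWithin] with x hx
      simp only [hA]
      rw [le_div_iff₀ (pow_pos hx 3)]
      linarith [cube_div_three_le hx.le]
    · filter_upwards [self_mem_nhdsWithin] with x hx
      simp only [hA]
      rw [div_le_iff₀ (pow_pos hx 3)]
      linarith [mul_cosh_sub_sinh_le hx.le]
  have hB1 : Tendsto B (nhdsWithin 0 (Ioi 0)) (nhds 1) := by
    -- squeeze `1 ≤ sinh x / x ≤ cosh x`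
    refine tendsto_of_tendsto_of_tendsto_of_le_of_le' tendsto_const_nhds hcosh1 ?_ ?_
    · filter_upwards [self_mem_nhdsWithin] with x hx
      simp only [hB]
      rw [le_div_iff₀ hx, one_mul]
      exact Real.self_le_sinh_iff.2 hx.le
    · filter_upwards [self_mem_nhdsWithin] with x hx
      simp only [hB]
      rw [div_le_iff₀ hx]
      linarith [sinh_lt_mul_cosh hx]
  -- assemble
  have hlim : Tendsto (fun k : ℝ => -(Real.pi ^ 2 / 4) * (A (Real.pi * k / 2) * C (Real.pi * k / 2) /
      (Real.cosh (Real.pi * k / 2) * B (Real.pi * k / 2)))) (nhdsWithin 0 (Ioi 0))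
      (nhds (-(Real.pi ^ 2 / 4) * (1 / 3 * 1 / (1 * 1)))) := by
    refine Tendsto.const_mul _ (((hA1.comp hxt).mul (hC1.comp hxt)).div ((hcosh1.comp hxt).mul (hB1.comp hxt)) ?_)
    norm_num
  have hval : -(Real.pi ^ 2 / 4) * (1 / 3 * 1 / (1 * 1)) = -(Real.pi ^ 2 / 12) := by ring
  rw [hval] at hlim
  refine hlim.congr' ?_
  filter_upwards [self_mem_nhdsWithin] with k hk
  exact (hfac k hk).symm

/-! ## Part 5 — the maximal Kelvin–Helmholtz rate of the triangle-wave shear, PROVED (ad-p2's SawtoothSigmaMax)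

`sup_{k>0} k √(−c²(k,0)) = 0.3098168… ≤ σ⋆ = 0.30982`, hence `k²(−c²(k,β)) ≤ σ⋆²` for every Bloch phase and
`σ(k,β) ≤ σ⋆` for all real `k, β`.  Architecture (elementary; no interval arithmetic is trusted — the certificate is
re-checked by `ring` in the kernel): with `y = πk > 0` the lattice form gives
`k²(−c²(k,0)) = y coth y − 1 − y²/4 = y − 1 − y²/4 + 2y/(e^{2y} − 1)` (`coth² − csch² = 1`,
`coth y = 1 + 2/(e^{2y} − 1)`); `e^{2y} − 1` is bounded BELOW by its degree-`16` Taylor polynomial `P(2y)`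
(`Real.sum_le_exp_of_nonneg`), so `k²(−c²) ≤ y − 1 − y²/4 + 2y/P(2y)`, and `2y/P(2y) ≤ 1 + σ⋆² + y²/4 − y` is the
polynomial inequality `0 ≤ (1 + σ⋆² + y²/4 − y)·P(2y) − 2y` of degree `18`, certified by the explicit weighted sum of
squares `y·(a(y)² + y·b(y)² + r(y))` (`a, b` of degree `8` with rational coefficients, `r` of degree `17` with
POSITIVE rational coefficients; generated by the cell's literature seat from the roots of the slack-shifted
polynomial — Pólya–Szegő form of a polynomial positive on `[0,∞)` — and verified here exactly).  The truncation at
degree `16` costs `6·10⁻⁹` at the maximiser `y ≈ 1.606` against the rounding margin `σ⋆² − sup = 1.96·10⁻⁶`.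
(Cell `ad-ideate`, route `SawtoothPulseCascade`: its support item `SawtoothSigmaMax` — `k²(−c²(k,0)) ≤ 0.3099²` — is
`sq_mul_neg_sawC2zero_le` below, a one-line consequence.) -/

/-- Every Taylor partial sum bounds `exp` from below on `[0,∞)`: the degree-`16` case, as `P(z) ≤ e^z − 1`. [folklore] -/
private theorem expPoly16_le_exp_sub_one {z : ℝ} (hz : 0 ≤ z) :
    z + z ^ 2 / 2 + z ^ 3 / 6 + z ^ 4 / 24 + z ^ 5 / 120 + z ^ 6 / 720 + z ^ 7 / 5040 + z ^ 8 / 40320 +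
      z ^ 9 / 362880 + z ^ 10 / 3628800 + z ^ 11 / 39916800 + z ^ 12 / 479001600 + z ^ 13 / 6227020800 +
      z ^ 14 / 87178291200 + z ^ 15 / 1307674368000 + z ^ 16 / 20922789888000
      ≤ Real.exp z - 1 := by
  have h := Real.sum_le_exp_of_nonneg hz 17
  simp only [Finset.sum_range_succ, Finset.sum_range_zero, Nat.factorial] at h
  norm_num at h
  linarith

/-- `0 < P(z)` for `z > 0`. [folklore] -/
private theorem expPoly16_pos {z : ℝ} (hz : 0 < z) :
    0 < z + z ^ 2 / 2 + z ^ 3 / 6 + z ^ 4 / 24 + z ^ 5 / 120 + z ^ 6 / 720 + z ^ 7 / 5040 + z ^ 8 / 40320 +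
      z ^ 9 / 362880 + z ^ 10 / 3628800 + z ^ 11 / 39916800 + z ^ 12 / 479001600 + z ^ 13 / 6227020800 +
      z ^ 14 / 87178291200 + z ^ 15 / 1307674368000 + z ^ 16 / 20922789888000 := by
  positivity

/-- Lattice form ⇒ `k²(−c²(k,0)) = y coth y − 1 − y²/4`, `y = kπ` (`k ≠ 0`; uses `cosh² − sinh² = 1`). [folklore] -/
private theorem sq_mul_neg_sawC2zero_eq_coth {k : ℝ} (hk : k ≠ 0) :
    k ^ 2 * (-(sawC2zero k)) =
      k * Real.pi * Real.cosh (k * Real.pi) / Real.sinh (k * Real.pi) - 1 - (k * Real.pi) ^ 2 / 4 := by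
  have hy : k * Real.pi ≠ 0 := mul_ne_zero hk Real.pi_ne_zero
  have hs : Real.sinh (k * Real.pi) ≠ 0 := Real.sinh_ne_zero.2 hy
  have hcs : Real.cosh (k * Real.pi) ^ 2 - Real.sinh (k * Real.pi) ^ 2 = 1 :=
    Real.cosh_sq_sub_sinh_sq (k * Real.pi)
  unfold sawC2zero
  field_simp
  linear_combination (-16 : ℝ) * hcs

/-- `y coth y = y + 2y/(e^{2y} − 1)` for `y > 0`. [folklore] -/
private theorem mul_cosh_div_sinh_eq {y : ℝ} (hy : 0 < y) :
    y * Real.cosh y / Real.sinh y = y + 2 * y / (Real.exp (2 * y) - 1) := by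
  have hu1 : 1 < Real.exp y := Real.one_lt_exp_iff.2 hy
  set u := Real.exp y with hu_def
  have hu0 : u ≠ 0 := by positivity
  have h2 : Real.exp (2 * y) = u * u := by rw [two_mul, Real.exp_add]
  have hcosh : Real.cosh y = (u + u⁻¹) / 2 := by rw [Real.cosh_eq, Real.exp_neg]
  have hsinh : Real.sinh y = (u - u⁻¹) / 2 := by rw [Real.sinh_eq, Real.exp_neg]
  have h3 : u * u - 1 ≠ 0 := by nlinarith
  have h3' : -1 + u ^ 2 ≠ 0 := by nlinarith
  have h3'' : u ^ 2 - 1 ≠ 0 := by nlinarith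
  have h4 : u - u⁻¹ ≠ 0 := by
    intro h
    have hu' : u⁻¹ = u := by linarith
    have : u * u = 1 := by
      calc u * u = u * u⁻¹ := by rw [hu']
        _ = 1 := mul_inv_cancel₀ hu0
    exact h3 (by linarith)
  rw [hcosh, hsinh, h2]
  field_simp
  ring

/-- THE CERTIFICATE: `2y ≤ (1 + σ⋆² + y²/4 − y)·P(2y)` for `y ≥ 0` (`σ⋆² = 0.30982² = 239971081/2500000000`) — the
difference is `y·(a(y)² + y·b(y)² + r(y))` with `r` of positive coefficients, an identity checked by `ring`. [folklore] -/
private theorem two_mul_le_pre_mul_expPoly16 {y : ℝ} (hy : 0 ≤ y) :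
    2 * y ≤ (1 + (239971081 / 2500000000 : ℝ) + y ^ 2 / 4 - y) *
      ((2 * y) + (2 * y) ^ 2 / 2 + (2 * y) ^ 3 / 6 + (2 * y) ^ 4 / 24 + (2 * y) ^ 5 / 120 +
        (2 * y) ^ 6 / 720 + (2 * y) ^ 7 / 5040 + (2 * y) ^ 8 / 40320 + (2 * y) ^ 9 / 362880 +
        (2 * y) ^ 10 / 3628800 + (2 * y) ^ 11 / 39916800 + (2 * y) ^ 12 / 479001600 +
        (2 * y) ^ 13 / 6227020800 + (2 * y) ^ 14 / 87178291200 + (2 * y) ^ 15 / 1307674368000 +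
        (2 * y) ^ 16 / 20922789888000) := by
  have key : (1 + (239971081 / 2500000000 : ℝ) + y ^ 2 / 4 - y) *
      ((2 * y) + (2 * y) ^ 2 / 2 + (2 * y) ^ 3 / 6 + (2 * y) ^ 4 / 24 + (2 * y) ^ 5 / 120 +
        (2 * y) ^ 6 / 720 + (2 * y) ^ 7 / 5040 + (2 * y) ^ 8 / 40320 + (2 * y) ^ 9 / 362880 +
        (2 * y) ^ 10 / 3628800 + (2 * y) ^ 11 / 39916800 + (2 * y) ^ 12 / 479001600 +
        (2 * y) ^ 13 / 6227020800 + (2 * y) ^ 14 / 87178291200 + (2 * y) ^ 15 / 1307674368000 +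
        (2 * y) ^ 16 / 20922789888000) - 2 * y =
      y * (((-6846119467082877 / 15625000000000000 : ℝ) + (4648212688418181 / 488281250000000 : ℝ) * y +
          (-121893235578281 / 3814697265625 : ℝ) * y ^ 2 + (1204940357859019 / 30517578125000 : ℝ) * y ^ 3 +
          (-274997889303813 / 12207031250000 : ℝ) * y ^ 4 + (6077484691645103 / 976562500000000 : ℝ) * y ^ 5 +
          (-3124414849355229 / 3906250000000000 : ℝ) * y ^ 6 +
          (2600355078498377 / 62500000000000000 : ℝ) * y ^ 7 +
          (-293520388388953 / 500000000000000000 : ℝ) * y ^ 8) ^ 2 +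
        y * ((1426414933376097 / 488281250000000 : ℝ) + (-77475344304826 / 3814697265625 : ℝ) * y +
          (4813363183673469 / 122070312500000 : ℝ) * y ^ 2 + (-7976032344745903 / 244140625000000 : ℝ) * y ^ 3 +
          (1583691767013653 / 122070312500000 : ℝ) * y ^ 4 + (-9417986998891 / 3814697265625 : ℝ) * y ^ 5 +
          (161987416726827 / 781250000000000 : ℝ) * y ^ 6 +
          (-1526369603935391 / 250000000000000000 : ℝ) * y ^ 7 +
          (6991376680143 / 250000000000000000 : ℝ) * y ^ 8) ^ 2 +
        ((241364224860013402871 / 244140625000000000000000000000000 : ℝ) +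
          (3800724236345332193 / 3814697265625000000000000000000 : ℝ) * y +
          (28648510536798917 / 28610229492187500000000000000 : ℝ) * y ^ 2 +
          (236312134689748151 / 238418579101562500000000000000 : ℝ) * y ^ 3 +
          (512869172463023491 / 476837158203125000000000000000 : ℝ) * y ^ 4 +
          (59022499234417021451 / 68664550781250000000000000000000 : ℝ) * y ^ 5 +
          (711128463494782568803 / 640869140625000000000000000000000 : ℝ) * y ^ 6 +
          (1924633506691439916469 / 2050781250000000000000000000000000 : ℝ) * y ^ 7 +
          (462250283878669874940473 / 442968750000000000000000000000000000 : ℝ) * y ^ 8 +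
          (22566348224817466328099 / 23071289062500000000000000000000000 : ℝ) * y ^ 9 +
          (31871357566506236159917 / 31723022460937500000000000000000000 : ℝ) * y ^ 10 +
          (570927377143915813018051 / 571014404296875000000000000000000000 : ℝ) * y ^ 11 +
          (206189366043810517361341 / 206199645996093750000000000000000000 : ℝ) * y ^ 12 +
          (15396219634538276908983607 / 15396240234375000000000000000000000000 : ℝ) * y ^ 13 +
          (1813959208821078904754944127 / 1813957031250000000000000000000000000000 : ℝ) * y ^ 14 +
          (9674436611030926946418139573 / 9674437500000000000000000000000000000000 : ℝ) * y ^ 15 +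
          (255405150543346747175763288557 / 255405150000000000000000000000000000000000 : ℝ) * y ^ 16 +
          (319256437497289207722264961753 / 319256437500000000000000000000000000000000 : ℝ) * y ^ 17)) := by
    ring
  have hnn : 0 ≤ y * (((-6846119467082877 / 15625000000000000 : ℝ) + (4648212688418181 / 488281250000000 : ℝ) * y +
          (-121893235578281 / 3814697265625 : ℝ) * y ^ 2 + (1204940357859019 / 30517578125000 : ℝ) * y ^ 3 +
          (-274997889303813 / 12207031250000 : ℝ) * y ^ 4 + (6077484691645103 / 976562500000000 : ℝ) * y ^ 5 +
          (-3124414849355229 / 3906250000000000 : ℝ) * y ^ 6 +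
          (2600355078498377 / 62500000000000000 : ℝ) * y ^ 7 +
          (-293520388388953 / 500000000000000000 : ℝ) * y ^ 8) ^ 2 +
        y * ((1426414933376097 / 488281250000000 : ℝ) + (-77475344304826 / 3814697265625 : ℝ) * y +
          (4813363183673469 / 122070312500000 : ℝ) * y ^ 2 + (-7976032344745903 / 244140625000000 : ℝ) * y ^ 3 +
          (1583691767013653 / 122070312500000 : ℝ) * y ^ 4 + (-9417986998891 / 3814697265625 : ℝ) * y ^ 5 +
          (161987416726827 / 781250000000000 : ℝ) * y ^ 6 +
          (-1526369603935391 / 250000000000000000 : ℝ) * y ^ 7 +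
          (6991376680143 / 250000000000000000 : ℝ) * y ^ 8) ^ 2 +
        ((241364224860013402871 / 244140625000000000000000000000000 : ℝ) +
          (3800724236345332193 / 3814697265625000000000000000000 : ℝ) * y +
          (28648510536798917 / 28610229492187500000000000000 : ℝ) * y ^ 2 +
          (236312134689748151 / 238418579101562500000000000000 : ℝ) * y ^ 3 +
          (512869172463023491 / 476837158203125000000000000000 : ℝ) * y ^ 4 +
          (59022499234417021451 / 68664550781250000000000000000000 : ℝ) * y ^ 5 +
          (711128463494782568803 / 640869140625000000000000000000000 : ℝ) * y ^ 6 +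
          (1924633506691439916469 / 2050781250000000000000000000000000 : ℝ) * y ^ 7 +
          (462250283878669874940473 / 442968750000000000000000000000000000 : ℝ) * y ^ 8 +
          (22566348224817466328099 / 23071289062500000000000000000000000 : ℝ) * y ^ 9 +
          (31871357566506236159917 / 31723022460937500000000000000000000 : ℝ) * y ^ 10 +
          (570927377143915813018051 / 571014404296875000000000000000000000 : ℝ) * y ^ 11 +
          (206189366043810517361341 / 206199645996093750000000000000000000 : ℝ) * y ^ 12 +
          (15396219634538276908983607 / 15396240234375000000000000000000000000 : ℝ) * y ^ 13 +
          (1813959208821078904754944127 / 1813957031250000000000000000000000000000 : ℝ) * y ^ 14 +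
          (9674436611030926946418139573 / 9674437500000000000000000000000000000000 : ℝ) * y ^ 15 +
          (255405150543346747175763288557 / 255405150000000000000000000000000000000000 : ℝ) * y ^ 16 +
          (319256437497289207722264961753 / 319256437500000000000000000000000000000000 : ℝ) * y ^ 17)) := by
    positivity
  linarith

/-- **The maximal Kelvin–Helmholtz rate of the triangle-wave shear** (ad-p2's SawtoothSigmaMax, sharp form):
`k²(−c²(k,0)) ≤ σ⋆² = 0.30982²` for every `k > 0` (numerically `sup_k k√(−c²(k,0)) = 0.3098168…`, attained near
`k ≈ 0.51`).  Proof: `k²(−c²) = y coth y − 1 − y²/4 = y − 1 − y²/4 + 2y/(e^{2y} − 1) ≤ y − 1 − y²/4 + 2y/P(2y) ≤ σ⋆²`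
(`y = πk`), the last step being the certificate `two_mul_le_pre_mul_expPoly16`.
[cite: Drazin2002, §8.3 (8.36)–(8.38), Example 8.3 (growth rate αc_i of a broken-line shear layer and its maximum over α) and Exercise 8.10] -/
theorem sq_mul_neg_sawC2zero_le_sawSigmaStar_sq {k : ℝ} (hk : 0 < k) :
    k ^ 2 * (-(sawC2zero k)) ≤ sawSigmaStar ^ 2 := by
  have hy : 0 < k * Real.pi := by positivity
  rw [sq_mul_neg_sawC2zero_eq_coth hk.ne', mul_cosh_div_sinh_eq hy]
  set y := k * Real.pi with hy_def
  have hz : 0 < 2 * y := by positivity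
  have hP := expPoly16_le_exp_sub_one hz.le
  have hPpos := expPoly16_pos hz
  have hmono := div_le_div_of_nonneg_left hz.le hPpos hP
  have hpre : 2 * y /
      ((2 * y) + (2 * y) ^ 2 / 2 + (2 * y) ^ 3 / 6 + (2 * y) ^ 4 / 24 + (2 * y) ^ 5 / 120 +
        (2 * y) ^ 6 / 720 + (2 * y) ^ 7 / 5040 + (2 * y) ^ 8 / 40320 + (2 * y) ^ 9 / 362880 +
        (2 * y) ^ 10 / 3628800 + (2 * y) ^ 11 / 39916800 + (2 * y) ^ 12 / 479001600 +
        (2 * y) ^ 13 / 6227020800 + (2 * y) ^ 14 / 87178291200 + (2 * y) ^ 15 / 1307674368000 +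
        (2 * y) ^ 16 / 20922789888000)
      ≤ 1 + (239971081 / 2500000000 : ℝ) + y ^ 2 / 4 - y := by
    rw [div_le_iff₀ hPpos]
    exact two_mul_le_pre_mul_expPoly16 hy.le
  have hc : sawSigmaStar ^ 2 = (239971081 / 2500000000 : ℝ) := by norm_num [sawSigmaStar]
  rw [hc]
  linarith

/-- The route's support statement `SawtoothSigmaMax`, verbatim: `k²(−c²(k,0)) ≤ 0.3099²` for all `k > 0`.
[cite: Drazin2002, §8.3 (8.36)–(8.38), Example 8.3 and Exercise 8.10] -/
theorem sq_mul_neg_sawC2zero_le {k : ℝ} (hk : 0 < k) :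
    k ^ 2 * (-(sawC2zero k)) ≤ (0.3099 : ℝ) ^ 2 :=
  (sq_mul_neg_sawC2zero_le_sawSigmaStar_sq hk).trans (by norm_num [sawSigmaStar])

/-- Bloch-uniform form: `k²(−c²(k,β)) ≤ σ⋆²` for all `k > 0` and every Bloch phase `β` (Bloch domination
`sq_mul_neg_sawC2_le_max` and the `β = 0` bound). [cite: Drazin2002, §8.3 (8.36)–(8.38), Example 8.3 and Exercise 8.10] -/
theorem sq_mul_neg_sawC2_le_sawSigmaStar_sq {k : ℝ} (hk : 0 < k) (β : ℝ) :
    k ^ 2 * (-(sawC2 k β)) ≤ sawSigmaStar ^ 2 := by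
  refine (sq_mul_neg_sawC2_le_max hk β).trans (max_le (by positivity) ?_)
  rw [sawC2_zero_eq_sawC2zero hk.ne']
  exact sq_mul_neg_sawC2zero_le_sawSigmaStar_sq hk

/-- The growth rate per unit strain never exceeds `σ⋆`: `σ(k,β) = k √(max(0, −c²(k,β))) ≤ σ⋆ = 0.30982` for ALL real
`k` and `β` (for `k ≤ 0` the left side is `≤ 0`).  This is the inequality the exponent `σ⋆ γ` of `K2PhaseGrowth` encodes.
[cite: Drazin2002, §8.3 Example 8.3 (growth rate αc_i) and Exercise 8.10] -/
theorem sawSigma_le_sawSigmaStar (k β : ℝ) : sawSigma k β ≤ sawSigmaStar := by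
  have hσ : (0 : ℝ) ≤ sawSigmaStar := by norm_num [sawSigmaStar]
  unfold sawSigma
  rcases le_or_gt k 0 with hk | hk
  · exact (mul_nonpos_of_nonpos_of_nonneg hk (Real.sqrt_nonneg _)).trans hσ
  · have h1 : k * Real.sqrt (max 0 (-(sawC2 k β))) = Real.sqrt (k ^ 2 * max 0 (-(sawC2 k β))) := by
      rw [Real.sqrt_mul (sq_nonneg k), Real.sqrt_sq hk.le]
    rw [h1, ← Real.sqrt_sq hσ]
    apply Real.sqrt_le_sqrt
    rcases le_or_gt (-(sawC2 k β)) 0 with hc | hc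
    · rw [max_eq_left hc, mul_zero]; positivity
    · rw [max_eq_right hc.le]; exact sq_mul_neg_sawC2_le_sawSigmaStar_sq hk β

/-! ## Part 6 — the band edge of the triangle-wave instability, PROVED (ad-p2's SawtoothBandEdge)

`c²(k,0) < 0` on `(0, 0.7637]` and `0 < c²(k,0)` on `[0.7638, ∞)`: the edge `a_c = (2/π)x*` with `x* tanh x* = 1`
(`a_c = 0.7637391…`) bracketed to four decimals — the constraint `ρ_N < γ/0.7637` of the route's K1 parameter range.
Architecture: by `sawC2zero_neg_iff` / `sawC2zero_pos_iff` the sign of `c²` is that of `x tanh x − 1`, `x = πk/2`;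
for `x > 1`, `x tanh x < 1 ↔ e^{2x} < (x+1)/(x−1)` with the left side increasing and the right side decreasing, so
each half reduces to ONE numeric comparison at the bracket point: `e^{2·1.199618} < 2.199618/0.199618` (from
`Real.exp_bound'` at `0.599809` and a fourth power) and `2.199773/0.199773 < e^{2·1.199773}` (degree-17 Taylor
minorant), with `π ∈ (3.141592, 3.141593)` (`Real.pi_gt_d6` / `Real.pi_lt_d6`) placing `πk/2` against the brackets. -/

/-- `tanh x = (e^{2x} − 1)/(e^{2x} + 1)`. [folklore] -/
private theorem tanh_eq_exp_two_mul (x : ℝ) :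
    Real.tanh x = (Real.exp (2 * x) - 1) / (Real.exp (2 * x) + 1) := by
  have hu : 0 < Real.exp x := Real.exp_pos x
  rw [Real.tanh_eq_sinh_div_cosh, Real.sinh_eq, Real.cosh_eq, Real.exp_neg,
    show Real.exp (2 * x) = Real.exp x * Real.exp x by rw [two_mul, Real.exp_add]]
  have hne : Real.exp x ≠ 0 := hu.ne'
  have hden : Real.exp x + (Real.exp x)⁻¹ ≠ 0 := by positivity
  have hden' : Real.exp x * Real.exp x + 1 ≠ 0 := by positivity
  field_simp

/-- For `x > 1`: `x tanh x < 1 ↔ e^{2x} < (x+1)/(x−1)` packaged as the implication we need. [folklore] -/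
private theorem mul_tanh_lt_one_of_exp_lt {x : ℝ} (hx : 1 < x)
    (h : Real.exp (2 * x) < (x + 1) / (x - 1)) : x * Real.tanh x < 1 := by
  rw [tanh_eq_exp_two_mul]
  set E := Real.exp (2 * x) with hE
  have hE0 : 0 < E := Real.exp_pos _
  have hx1 : 0 < x - 1 := by linarith
  rw [lt_div_iff₀ hx1] at h
  rw [mul_div_assoc', div_lt_one (by positivity)]
  nlinarith

/-- For `x > 1`: `(x+1)/(x−1) < e^{2x}` gives `1 < x tanh x`. [folklore] -/
private theorem one_lt_mul_tanh_of_lt_exp {x : ℝ} (hx : 1 < x)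
    (h : (x + 1) / (x - 1) < Real.exp (2 * x)) : 1 < x * Real.tanh x := by
  rw [tanh_eq_exp_two_mul]
  set E := Real.exp (2 * x) with hE
  have hE0 : 0 < E := Real.exp_pos _
  have hx1 : 0 < x - 1 := by linarith
  rw [div_lt_iff₀ hx1] at h
  rw [mul_div_assoc', one_lt_div (by positivity)]
  nlinarith

/-- Numeric: `e^{2.399236} < 11.0191365` via `e^{a} ≤ T₁₀(a) + a¹⁰·11/(10!·10)` at `a = 0.599809` and the fourth power. [folklore] -/
private theorem exp_bandLo_lt : Real.exp (2 * (1199618 / 1000000 : ℝ)) <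
    ((1199618 / 1000000 : ℝ) + 1) / ((1199618 / 1000000 : ℝ) - 1) := by
  have h := Real.exp_bound' (x := (599809 / 1000000 : ℝ)) (by norm_num) (by norm_num) (n := 10) (by norm_num)
  simp only [Finset.sum_range_succ, Finset.sum_range_zero, Nat.factorial] at h
  norm_num at h
  have h4 : Real.exp (2 * (1199618 / 1000000 : ℝ)) = Real.exp (599809 / 1000000 : ℝ) ^ 4 := by
    rw [← Real.exp_nat_mul]; norm_num
  rw [h4]
  have hpos : 0 ≤ Real.exp (599809 / 1000000 : ℝ) := (Real.exp_pos _).le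
  calc Real.exp (599809 / 1000000 : ℝ) ^ 4
      ≤ _ ^ 4 := pow_le_pow_left₀ hpos h 4
    _ < _ := by norm_num

/-- Numeric: `11.0113629 < e^{2.399546}` via the degree-17 Taylor minorant. [folklore] -/
private theorem lt_exp_bandHi : ((1199773 / 1000000 : ℝ) + 1) / ((1199773 / 1000000 : ℝ) - 1) <
    Real.exp (2 * (1199773 / 1000000 : ℝ)) := by
  have h := Real.sum_le_exp_of_nonneg (x := 2 * (1199773 / 1000000 : ℝ)) (by norm_num) 18
  simp only [Finset.sum_range_succ, Finset.sum_range_zero, Nat.factorial] at h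
  norm_num at h ⊢
  linarith

/-- The unstable band contains `(0, 0.7637]`: `c²(k,0) < 0` for `0 < k ≤ 0.7637` (band edge `a_c = (2/π)x*`,
`coth x* = x*`, `a_c = 0.7637391…`). [cite: Drazin2002, Exercise 8.10 (instability iff α tanh α < 1)] -/
theorem sawC2zero_neg_of_le {k : ℝ} (hk : 0 < k) (hk' : k ≤ 0.7637) : sawC2zero k < 0 := by
  rw [sawC2zero_neg_iff hk]
  set x := Real.pi * k / 2 with hx_def
  have hx0 : 0 < x := by positivity
  have hxX : x ≤ 1199618 / 1000000 := by
    have := Real.pi_lt_d6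
    rw [hx_def]; nlinarith
  rcases le_or_gt x 1 with hx1 | hx1
  · have ht : Real.tanh x < 1 := Real.tanh_lt_one x
    nlinarith
  · apply mul_tanh_lt_one_of_exp_lt hx1
    have hmono : Real.exp (2 * x) ≤ Real.exp (2 * (1199618 / 1000000 : ℝ)) :=
      Real.exp_le_exp.2 (by linarith)
    have hfrac : ((1199618 / 1000000 : ℝ) + 1) / ((1199618 / 1000000 : ℝ) - 1) ≤ (x + 1) / (x - 1) := by
      rw [div_le_div_iff₀ (by norm_num) (by linarith)]
      nlinarith
    exact lt_of_le_of_lt hmono (exp_bandLo_lt.trans_le hfrac)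

/-- The stable range contains `[0.7638, ∞)`: `0 < c²(k,0)` for `k ≥ 0.7638`. [cite: Drazin2002, Exercise 8.10 (stability iff α tanh α > 1)] -/
theorem sawC2zero_pos_of_ge {k : ℝ} (hk : 0.7638 ≤ k) : 0 < sawC2zero k := by
  have hk0 : 0 < k := by linarith
  rw [sawC2zero_pos_iff hk0]
  set x := Real.pi * k / 2 with hx_def
  have hxX : 1199773 / 1000000 ≤ x := by
    have := Real.pi_gt_d6
    rw [hx_def]; nlinarith
  have hx1 : 1 < x := by linarith
  apply one_lt_mul_tanh_of_lt_exp hx1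
  have hmono : Real.exp (2 * (1199773 / 1000000 : ℝ)) ≤ Real.exp (2 * x) :=
    Real.exp_le_exp.2 (by linarith)
  have hfrac : (x + 1) / (x - 1) ≤ ((1199773 / 1000000 : ℝ) + 1) / ((1199773 / 1000000 : ℝ) - 1) := by
    rw [div_le_div_iff₀ (by linarith) (by norm_num)]
    nlinarith
  exact lt_of_le_of_lt hfrac (lt_exp_bandHi.trans_le hmono)

/-- **Band edge of the triangle-wave Kelvin–Helmholtz instability** (ad-p2's SawtoothBandEdge, verbatim): the `β = 0`
dispersion relation is unstable on `(0, 0.7637]` and stable on `[0.7638, ∞)` — the edge `a_c = (2/π)·x*`, `x* tanh x* = 1`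
(`x* = 1.1996786…`, `a_c = 0.7637391…`) bracketed to four decimals. [cite: Drazin2002, Exercise 8.10 (α_c the positive root of α tanh α = 1)] -/
theorem sawtoothBandEdge :
    (∀ k : ℝ, 0 < k → k ≤ 0.7637 → sawC2zero k < 0) ∧ (∀ k : ℝ, 0.7638 ≤ k → 0 < sawC2zero k) :=
  ⟨fun _ hk hk' => sawC2zero_neg_of_le hk hk', fun _ hk => sawC2zero_pos_of_ge hk⟩


/-! ## Part 7 — uniform hyperbolicity of the exact sawtooth pulse pair, with an EXPLICIT threshold
(Elgindi–Liss–Mattingly's cone lemma quantified; proved)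

Off the rounded corner strips the H half-pulse of phase `j` displaces `x₁` by `γ · U_j(x₂)` with
`∂₂(γ U_j) = ±γ` and the V half-pulse is the orthogonal shear (in phase-`j` cell units `(X,Y) = N_j·(x₁,x₂)` the
exact `δ_j → 0` profile is `tri (2πY)/(2π)`, slope `±1`: `hasDerivAt_tri_of_mem_Ioo`, `hasDerivAt_tri_of_mem_Ioo'`).
Hence the Jacobian of one exact pulse pair — and, the maps being piecewise affine and the construction scale-free,
of any string of pulse pairs across phases — is a product of the four unimodular matrices
`A(r,s) = [[1 + r s γ², r γ], [s γ, 1]]`, `r, s ∈ {1, −1}`: these are EXACTLY Elgindi–Liss–Mattingly's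
`A₁ = A(1,1)`, `A₂ = A(1,−1)`, `A₃ = A(−1,1)`, `A₄ = A(−1,−1)` with `α = γ` (their `∇T^N(z) = ∇φ_N^{-1}(z) = Π A_{j_i}`,
the cocycle transporting scalar gradients). In print [ELM, §1.2.2 and §3.1]: "for any `α ≥ 4` every `A ∈ 𝒜` has
eigenvalues `c_α, 1/c_α` with `|c_α| ≥ α²/4`", and "for a suitable choice of `δ₁` and all `α` SUFFICIENTLY LARGE" the cones
`C_u = {|y| ≤ |x|/(αδ₁)}`, `C_s = {|x| ≤ |y|/(αδ₁)}` are forward/backward invariant with expansion `≥ δ₁α²` per factor,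
so that (Lemma 3.1) `|λ_u| ≥ (δ₁α²)^n` for every itinerary — the threshold on `α` is not quantified in print.
HERE IT IS MADE EXPLICIT (`sawtooth_cone_step`): for every cone aperture `m > 1` (`m = 1/δ₁`) and every
`γ² ≥ m(m+2)/(m−1)` the cone `{γ|y| ≤ m|x|}` is invariant under all four `A(r,s)` and the first coordinate grows by
AT LEAST `γ² − 1 − m` per factor, for EVERY itinerary (`itinJac_growth`); symmetrically `A(r,s)⁻¹` on the stable cone
(`itinJacInv_growth`). Instances: `m = 2` ⇒ all `γ ≥ 2√2`, factor `γ² − 3` (`itinJac_growth_two`); in the sup norm of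
`ℝ²` this is `‖Πᵢ A v‖ ≥ (γ² − 3)^n ‖v‖` (`itinJac_norm_growth_two`), and in the Euclidean norm one step expands by
`≥ γ²/2 = δ₁γ²` with `δ₁ = ½` as soon as `γ² ≥ 8` (`pulseJac_euclidSq_growth_two`) — i.e. ELM's constant `δ₁α²`
with `δ₁ = ½` holds for all `α ≥ 2√2`, in particular on their `α ≥ 4`; on the route's box `γ ∈ [4, 8]` every
itinerary expands cone vectors by `≥ 13` per pulse pair (`itinJac_growth_routeBox`; the sharp per-pair worst case is the
spectral radius `(γ² − 2 + √((γ²−2)² − 4))/2 = 13.93…` of `A(1,−1)` at `γ = 4`). `|tr A(r,s)| ≥ γ² − 2`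
(`abs_trace_pulseJac`), so each factor is hyperbolic once `γ > 2`; the common cone is what makes the bound
itinerary-uniform (the invariant-cone / minimum-expansion-factor bookkeeping of Myers Hill–Sturman–Wilson, App. A,
for orthogonal non-monotonic toral shears). Motivation (cell `ad-ideate`, seat ad-p2, ROUND-3 closure audit / TEST C):
a kernel-certified, parcel-uniform lower bound `λ_bulk ≥ log(γ² − 3)` per pulse pair on the scalar-gradient growth of the
exact cascade, valid down to `γ = 2√2` below the box corner `γ = 4`.
[cite: ElgindiLissMattingly2025, §1.2.2 (A₁–A₄, cones C_u, C_s, "α sufficiently large") and §3.1 Lemma 3.1 (|λ_u| ≥ (δ₁α²)^n)]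
[cite: MyersHillSturmanWilson2022, App. A Lemma 7 (invariant expanding cone and minimum expansion factors K(M))] -/

open scoped Matrix

/-! ### Slopes of the exact profiles (`tri`: period `2π`, slope `±1`; `triWave`: period `1`, slope `±1`) -/

/-- On `[π/2, 3π/2]` the triangle wave is the descending branch `tri θ = π − θ`. [cite: ElgindiLissMattingly2025, §1 (H_α, V_α = −2α|· − ½|: the sawtooth branches of slope ±α per half period)] -/
theorem tri_eq_pi_sub {θ : ℝ} (h₁ : Real.pi / 2 ≤ θ) (h₂ : θ ≤ 3 * Real.pi / 2) : tri θ = Real.pi - θ := by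
  unfold tri
  rw [← Real.sin_pi_sub]
  exact Real.arcsin_sin (by linarith) (by linarith)

/-- Ascending branch: `tri` has slope `+1` on `(−π/2, π/2)`. [cite: ElgindiLissMattingly2025, §1 (H_α, V_α = −2α|· − ½|: the sawtooth branches of slope ±α per half period)] -/
theorem hasDerivAt_tri_of_mem_Ioo {θ : ℝ} (h : θ ∈ Ioo (-(Real.pi / 2)) (Real.pi / 2)) : HasDerivAt tri 1 θ := by
  have hev : tri =ᶠ[nhds θ] fun θ => θ := by
    filter_upwards [Ioo_mem_nhds h.1 h.2] with t ht using tri_eq_self ht.1.le ht.2.le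
  exact (hasDerivAt_id θ).congr_of_eventuallyEq hev

/-- Descending branch: `tri` has slope `−1` on `(π/2, 3π/2)`. [cite: ElgindiLissMattingly2025, §1 (H_α, V_α = −2α|· − ½|: the sawtooth branches of slope ±α per half period)] -/
theorem hasDerivAt_tri_of_mem_Ioo' {θ : ℝ} (h : θ ∈ Ioo (Real.pi / 2) (3 * Real.pi / 2)) :
    HasDerivAt tri (-1) θ := by
  have hev : tri =ᶠ[nhds θ] fun θ => Real.pi - θ := by
    filter_upwards [Ioo_mem_nhds h.1 h.2] with t ht using tri_eq_pi_sub ht.1.le ht.2.le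
  have h0 : HasDerivAt (fun θ : ℝ => Real.pi - θ) (-1) θ := by
    simpa using (hasDerivAt_id θ).const_sub Real.pi
  exact h0.congr_of_eventuallyEq hev

/-- On `[1/4, 3/4]` the period-`1` triangle wave is the descending branch `triWave ξ = 1/2 − ξ`. [cite: ElgindiLissMattingly2025, §1 (H_α, V_α = −2α|· − ½|: the sawtooth branches of slope ±α per half period)] -/
theorem triWave_eq_half_sub {ξ : ℝ} (h₁ : 1 / 4 ≤ ξ) (h₂ : ξ ≤ 3 / 4) : triWave ξ = 1 / 2 - ξ := by
  unfold triWave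
  rcases lt_or_eq_of_le h₂ with h | h
  · have hf : Int.fract (ξ + 1 / 4) = ξ + 1 / 4 := by
      rw [Int.fract_eq_self]; constructor <;> linarith
    rw [hf, abs_of_nonneg (by linarith)]; ring
  · subst h
    have hf : Int.fract ((3 : ℝ) / 4 + 1 / 4) = 0 := by norm_num
    rw [hf]; norm_num [abs_of_nonpos]

/-- `triWave` has slope `+1` on `(−1/4, 1/4)`. [cite: ElgindiLissMattingly2025, §1 (H_α, V_α = −2α|· − ½|: the sawtooth branches of slope ±α per half period)] -/
theorem hasDerivAt_triWave_of_mem_Ioo {ξ : ℝ} (h : ξ ∈ Ioo (-(1 / 4 : ℝ)) (1 / 4)) : HasDerivAt triWave 1 ξ := by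
  have hev : triWave =ᶠ[nhds ξ] fun ξ => ξ := by
    filter_upwards [Ioo_mem_nhds h.1 h.2] with t ht using triWave_eq_self ht.1.le ht.2.le
  exact (hasDerivAt_id ξ).congr_of_eventuallyEq hev

/-- `triWave` has slope `−1` on `(1/4, 3/4)`. [cite: ElgindiLissMattingly2025, §1 (H_α, V_α = −2α|· − ½|: the sawtooth branches of slope ±α per half period)] -/
theorem hasDerivAt_triWave_of_mem_Ioo' {ξ : ℝ} (h : ξ ∈ Ioo (1 / 4 : ℝ) (3 / 4)) : HasDerivAt triWave (-1) ξ := by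
  have hev : triWave =ᶠ[nhds ξ] fun ξ => 1 / 2 - ξ := by
    filter_upwards [Ioo_mem_nhds h.1 h.2] with t ht using triWave_eq_half_sub ht.1.le ht.2.le
  have h0 : HasDerivAt (fun ξ : ℝ => 1 / 2 - ξ) (-1) ξ := by
    simpa using (hasDerivAt_id ξ).const_sub (1 / 2 : ℝ)
  exact h0.congr_of_eventuallyEq hev

/-! ### The pulse-pair Jacobians `A(r,s)` (Elgindi–Liss–Mattingly's `A₁…A₄`) -/

/-- Jacobian of the exact H half-pulse off the corner strips: the horizontal shear matrix `[[1, rγ],[0, 1]]`,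
`r = ±1` the local profile slope. [cite: ElgindiLissMattingly2025, §1.2.2 (∇H_α piecewise constant)] -/
def hShear (γ r : ℝ) : Matrix (Fin 2) (Fin 2) ℝ := !![1, r * γ; 0, 1]

/-- Jacobian of the exact V half-pulse off the corner strips: the vertical shear matrix `[[1, 0],[sγ, 1]]`,
`s = ±1`. [cite: ElgindiLissMattingly2025, §1.2.2 (∇V_α piecewise constant)] -/
def vShear (γ s : ℝ) : Matrix (Fin 2) (Fin 2) ℝ := !![1, 0; s * γ, 1]

/-- The pulse-pair Jacobian `A(r,s) = [[1 + r s γ², r γ],[s γ, 1]]`: Elgindi–Liss–Mattingly's `A₁ = A(1,1)`,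
`A₂ = A(1,−1)`, `A₃ = A(−1,1)`, `A₄ = A(−1,−1)` with `α = γ`. [cite: ElgindiLissMattingly2025, §1.2.2 (the four matrices A₁–A₄)] -/
def pulseJac (γ r s : ℝ) : Matrix (Fin 2) (Fin 2) ℝ := !![1 + r * s * γ ^ 2, r * γ; s * γ, 1]

/-- The inverse pulse-pair Jacobian `A(r,s)⁻¹ = [[1, −rγ],[−sγ, 1 + r s γ²]]` (unimodular adjugate).
[cite: ElgindiLissMattingly2025, §1.2.2 ((Π A_{j_i})⁻¹ on the stable cone)] -/
def pulseJacInv (γ r s : ℝ) : Matrix (Fin 2) (Fin 2) ℝ := !![1, -(r * γ); -(s * γ), 1 + r * s * γ ^ 2]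

/-- `A(r,s) = H(r) · V(s)`: one pulse pair is an H shear followed (in the gradient cocycle, composed on the right)
by a V shear. [cite: ElgindiLissMattingly2025, §1.2.2] -/
theorem pulseJac_eq_hShear_mul_vShear (γ r s : ℝ) : pulseJac γ r s = hShear γ r * vShear γ s := by
  ext i j; fin_cases i <;> fin_cases j <;>
    simp [pulseJac, hShear, vShear, Matrix.mul_apply, Fin.sum_univ_two]
  ring

/-- `det A(r,s) = 1` (area preservation). [cite: ElgindiLissMattingly2025, §1.2.2 (the matrices A₁–A₄)] -/
theorem det_pulseJac (γ r s : ℝ) : (pulseJac γ r s).det = 1 := by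
  simp [pulseJac, Matrix.det_fin_two]; ring

/-- `tr A(r,s) = 2 + r s γ²`. [cite: ElgindiLissMattingly2025, §1.2.2 (the matrices A₁–A₄)] -/
theorem trace_pulseJac (γ r s : ℝ) : (pulseJac γ r s).trace = 2 + r * s * γ ^ 2 := by
  simp [pulseJac, Matrix.trace_fin_two]; ring

/-- `|tr A(r,s)| ≥ γ² − 2` for sign patterns `r, s = ±1`; so every factor is hyperbolic (`|tr| > 2`) once `γ > 2`
(ELM: "for α ≥ 4 … |c_α| ≥ α²/4"). [cite: ElgindiLissMattingly2025, §3.1 (eigenvalues c_α, 1/c_α of every A ∈ 𝒜)] -/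
theorem abs_trace_pulseJac {γ r s : ℝ} (hr : r = 1 ∨ r = -1) (hs : s = 1 ∨ s = -1) :
    γ ^ 2 - 2 ≤ |(pulseJac γ r s).trace| := by
  rw [trace_pulseJac]
  have key : r * s = 1 ∨ r * s = -1 := by
    rcases hr with rfl | rfl <;> rcases hs with rfl | rfl <;> norm_num
  rcases key with h | h
  · rw [h]; exact le_abs.2 (Or.inl (by nlinarith [sq_nonneg γ]))
  · rw [h]; exact le_abs.2 (Or.inr (by linarith))

/-- `A(r,s) · A(r,s)⁻¹ = 1`. [cite: ElgindiLissMattingly2025, §1.2.2 (the matrices A₁–A₄)] -/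
theorem pulseJac_mul_pulseJacInv (γ r s : ℝ) : pulseJac γ r s * pulseJacInv γ r s = 1 := by
  ext i j; fin_cases i <;> fin_cases j <;>
    simp [pulseJac, pulseJacInv, Matrix.mul_apply, Fin.sum_univ_two] <;> ring

/-- `A(r,s)⁻¹ · A(r,s) = 1`. [cite: ElgindiLissMattingly2025, §1.2.2 (the matrices A₁–A₄)] -/
theorem pulseJacInv_mul_pulseJac (γ r s : ℝ) : pulseJacInv γ r s * pulseJac γ r s = 1 := by
  ext i j; fin_cases i <;> fin_cases j <;>
    simp [pulseJac, pulseJacInv, Matrix.mul_apply, Fin.sum_univ_two] <;> ring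

/-- `(A(r,s))⁻¹ = pulseJacInv γ r s` as a matrix inverse. [cite: ElgindiLissMattingly2025, §1.2.2 (the matrices A₁–A₄)] -/
theorem inv_pulseJac (γ r s : ℝ) : (pulseJac γ r s)⁻¹ = pulseJacInv γ r s :=
  Matrix.inv_eq_right_inv (pulseJac_mul_pulseJacInv γ r s)

/-- Coordinates of `A(r,s) v`. [cite: ElgindiLissMattingly2025, §1.2.2 (the matrices A₁–A₄)] -/
theorem pulseJac_mulVec (γ r s : ℝ) (v : Fin 2 → ℝ) :
    pulseJac γ r s *ᵥ v = ![(1 + r * s * γ ^ 2) * v 0 + r * γ * v 1, s * γ * v 0 + v 1] := by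
  ext i; fin_cases i <;> simp [pulseJac, Matrix.mulVec, dotProduct, Fin.sum_univ_two]

/-- Coordinates of `A(r,s)⁻¹ v`. [cite: ElgindiLissMattingly2025, §1.2.2 (the matrices A₁–A₄)] -/
theorem pulseJacInv_mulVec (γ r s : ℝ) (v : Fin 2 → ℝ) :
    pulseJacInv γ r s *ᵥ v = ![v 0 + -(r * γ) * v 1, -(s * γ) * v 0 + (1 + r * s * γ ^ 2) * v 1] := by
  ext i; fin_cases i <;> simp [pulseJacInv, Matrix.mulVec, dotProduct, Fin.sum_univ_two]

/-! ### The cones and the one-step estimate -/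

/-- The unstable cone of aperture `m/γ`: `γ|v₂| ≤ m|v₁|` (ELM's `C_u = {|y| ≤ |x|/(αδ₁)}` with `m = 1/δ₁`).
[cite: ElgindiLissMattingly2025, §1.2.2 (C_u)] -/
def InUnstableCone (γ m : ℝ) (v : Fin 2 → ℝ) : Prop := γ * |v 1| ≤ m * |v 0|

/-- The stable cone of aperture `m/γ`: `γ|v₁| ≤ m|v₂|` (ELM's `C_s = {|x| ≤ |y|/(αδ₁)}` with `m = 1/δ₁`).
[cite: ElgindiLissMattingly2025, §1.2.2 (C_s)] -/
def InStableCone (γ m : ℝ) (v : Fin 2 → ℝ) : Prop := γ * |v 0| ≤ m * |v 1|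

/-- **The one-step cone estimate with explicit threshold** (real-variable form). For `γ > 0`, aperture `m > 0` with
`m(m+2) ≤ (m−1)γ²`, signs `r, s = ±1` and `(x, y)` in the cone `γ|y| ≤ m|x|`: the image
`(x', y') = ((1 + rsγ²)x + rγy, sγx + y)` satisfies `|x'| ≥ (γ² − 1 − m)|x|` and stays in the cone, `γ|y'| ≤ m|x'|`.
(Proof: `|x'| ≥ γ²|x| − |x| − γ|y|`, `|y'| ≤ γ|x| + |y|`, and `γ² + m ≤ m(γ² − 1 − m)` is the hypothesis.)
[cite: ElgindiLissMattingly2025, §1.2.2 ("basic linear algebra … for α sufficiently large")] -/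
theorem sawtooth_cone_step {γ m r s x y : ℝ} (hγ : 0 < γ) (hm : 0 < m) (hγm : m * (m + 2) ≤ (m - 1) * γ ^ 2)
    (hr : r = 1 ∨ r = -1) (hs : s = 1 ∨ s = -1) (hcone : γ * |y| ≤ m * |x|) :
    (γ ^ 2 - 1 - m) * |x| ≤ |(1 + r * s * γ ^ 2) * x + r * γ * y| ∧
      γ * |s * γ * x + y| ≤ m * |(1 + r * s * γ ^ 2) * x + r * γ * y| := by
  have har : |r| = 1 := by rcases hr with h | h <;> simp [h]
  have has : |s| = 1 := by rcases hs with h | h <;> simp [h]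
  have hag : |γ| = γ := abs_of_pos hγ
  set x' := (1 + r * s * γ ^ 2) * x + r * γ * y with hx'
  set y' := s * γ * x + y with hy'
  have h1 : γ ^ 2 * |x| ≤ |x'| + |x| + γ * |y| := by
    have e : r * s * γ ^ 2 * x = x' - (x + r * γ * y) := by rw [hx']; ring
    have h0 : |r * s * γ ^ 2 * x| ≤ |x'| + |x + r * γ * y| := by rw [e]; exact abs_sub _ _
    have h2 : |x + r * γ * y| ≤ |x| + γ * |y| := by
      calc |x + r * γ * y| ≤ |x| + |r * γ * y| := abs_add_le _ _
        _ = |x| + γ * |y| := by rw [abs_mul, abs_mul, har, hag, one_mul]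
    have h3 : |r * s * γ ^ 2 * x| = γ ^ 2 * |x| := by
      rw [abs_mul, abs_mul, abs_mul, har, has, abs_pow, hag]; ring
    linarith
  have h2 : |y'| ≤ γ * |x| + |y| := by
    calc |y'| ≤ |s * γ * x| + |y| := abs_add_le _ _
      _ = γ * |x| + |y| := by rw [abs_mul, abs_mul, has, hag, one_mul]
  have goal1 : (γ ^ 2 - 1 - m) * |x| ≤ |x'| := by nlinarith
  refine ⟨goal1, ?_⟩
  have hx0 : 0 ≤ |x| := abs_nonneg x
  have h3 : γ * |y'| ≤ γ ^ 2 * |x| + m * |x| := by nlinarith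
  have h4 : m * ((γ ^ 2 - 1 - m) * |x|) ≤ m * |x'| := mul_le_mul_of_nonneg_left goal1 hm.le
  have h5 : (m * (m + 2) - (m - 1) * γ ^ 2) * |x| ≤ 0 :=
    mul_nonpos_of_nonpos_of_nonneg (by linarith) hx0
  nlinarith

/-- Forward step: `A(r,s)` maps the unstable cone into itself and multiplies `|v₁|` by at least `γ² − 1 − m`.
[cite: ElgindiLissMattingly2025, §3.1 (cone invariance and expansion ≥ δ₁α² per factor)] -/
theorem inUnstableCone_pulseJac_mulVec {γ m r s : ℝ} (hγ : 0 < γ) (hm : 0 < m)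
    (hγm : m * (m + 2) ≤ (m - 1) * γ ^ 2) (hr : r = 1 ∨ r = -1) (hs : s = 1 ∨ s = -1) {v : Fin 2 → ℝ}
    (hv : InUnstableCone γ m v) :
    InUnstableCone γ m (pulseJac γ r s *ᵥ v) ∧ (γ ^ 2 - 1 - m) * |v 0| ≤ |(pulseJac γ r s *ᵥ v) 0| := by
  obtain ⟨h1, h2⟩ := sawtooth_cone_step (x := v 0) (y := v 1) hγ hm hγm hr hs hv
  rw [pulseJac_mulVec]
  exact ⟨by simpa [InUnstableCone] using h2, by simpa using h1⟩

/-- Backward step: `A(r,s)⁻¹` maps the stable cone into itself and multiplies `|v₂|` by at least `γ² − 1 − m`.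
[cite: ElgindiLissMattingly2025, §3.1 (backward invariance of C_s, expansion ≥ δ₁α² under ∇T⁻¹)] -/
theorem inStableCone_pulseJacInv_mulVec {γ m r s : ℝ} (hγ : 0 < γ) (hm : 0 < m)
    (hγm : m * (m + 2) ≤ (m - 1) * γ ^ 2) (hr : r = 1 ∨ r = -1) (hs : s = 1 ∨ s = -1) {v : Fin 2 → ℝ}
    (hv : InStableCone γ m v) :
    InStableCone γ m (pulseJacInv γ r s *ᵥ v) ∧ (γ ^ 2 - 1 - m) * |v 1| ≤ |(pulseJacInv γ r s *ᵥ v) 1| := by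
  have hr' : -s = 1 ∨ -s = -1 := by rcases hs with h | h <;> simp [h]
  have hs' : -r = 1 ∨ -r = -1 := by rcases hr with h | h <;> simp [h]
  obtain ⟨h1, h2⟩ := sawtooth_cone_step (r := -s) (s := -r) (x := v 1) (y := v 0) hγ hm hγm hr' hs' hv
  have e1 : (1 + -s * -r * γ ^ 2) * v 1 + -s * γ * v 0 = -(s * γ) * v 0 + (1 + r * s * γ ^ 2) * v 1 := by ring
  have e2 : -r * γ * v 1 + v 0 = v 0 + -(r * γ) * v 1 := by ring
  rw [e1] at h1 h2; rw [e2] at h2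
  rw [pulseJacInv_mulVec]
  exact ⟨by simpa [InStableCone] using h2, by simpa using h1⟩

/-! ### Itineraries: products over arbitrary sign sequences -/

/-- A list of sign pairs `(r,s) ∈ {±1}²` (an itinerary of pulse pairs: "any choice of the sequence {j_i}").
[cite: ElgindiLissMattingly2025, §1.2.2 (∇T^N = Π A_{j_i} for ANY sequence j_i)] -/
def IsSignList (L : List (ℝ × ℝ)) : Prop := ∀ p ∈ L, (p.1 = 1 ∨ p.1 = -1) ∧ (p.2 = 1 ∨ p.2 = -1)

/-- The gradient cocycle of an itinerary: `Π A(rᵢ,sᵢ)` (head of the list = last factor applied).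
[cite: ElgindiLissMattingly2025, §1.2.2 eq. (∇T^N = Π A_{j_i})] -/
def itinJac (γ : ℝ) : List (ℝ × ℝ) → Matrix (Fin 2) (Fin 2) ℝ
  | [] => 1
  | p :: L => pulseJac γ p.1 p.2 * itinJac γ L

/-- The inverse cocycle of an itinerary: `Π A(rᵢ,sᵢ)⁻¹` (head = last factor applied).
[cite: ElgindiLissMattingly2025, §1.2.2 ((Π A_{j_i})⁻¹)] -/
def itinJacInv (γ : ℝ) : List (ℝ × ℝ) → Matrix (Fin 2) (Fin 2) ℝ
  | [] => 1
  | p :: L => pulseJacInv γ p.1 p.2 * itinJacInv γ L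

/-- Tail of a sign list is a sign list. [folklore] -/
private theorem isSignList_of_cons {p : ℝ × ℝ} {L : List (ℝ × ℝ)} (h : IsSignList (p :: L)) : IsSignList L :=
  fun q hq => h q (List.mem_cons_of_mem _ hq)

/-- `itinJac γ (L ++ [p]) = itinJac γ L · A(p)`. [folklore] -/
private theorem itinJac_append_singleton (γ : ℝ) (L : List (ℝ × ℝ)) (p : ℝ × ℝ) :
    itinJac γ (L ++ [p]) = itinJac γ L * pulseJac γ p.1 p.2 := by
  induction L with
  | nil => simp [itinJac]
  | cons q L ih => simp [itinJac, ih, mul_assoc]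

/-- The inverse cocycle IS the inverse: `itinJac γ L.reverse · itinJacInv γ L = 1`.
[cite: ElgindiLissMattingly2025, §1.2.2 ((Π A_{j_i})⁻¹)] -/
theorem itinJac_mul_itinJacInv_reverse (γ : ℝ) (L : List (ℝ × ℝ)) :
    itinJac γ L.reverse * itinJacInv γ L = 1 := by
  induction L with
  | nil => simp [itinJac, itinJacInv]
  | cons p L ih =>
    rw [List.reverse_cons, itinJac_append_singleton, itinJacInv, mul_assoc,
      ← mul_assoc (pulseJac γ p.1 p.2), pulseJac_mul_pulseJacInv, one_mul, ih]

/-- **Itinerary-uniform expansion on the unstable cone (Elgindi–Liss–Mattingly's Lemma 3.1 with explicit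
threshold).** For `γ > 0`, `m > 1`, `m(m+2) ≤ (m−1)γ²` and every finite itinerary of sign pairs, `Π A(rᵢ,sᵢ)` maps
the unstable cone `{γ|v₂| ≤ m|v₁|}` into itself and `|(Π A v)₁| ≥ (γ² − 1 − m)^n |v₁|`, `n` the number of
pulse pairs. [cite: ElgindiLissMattingly2025, §3.1 Lemma 3.1 (|λ_u| ≥ (δ₁α²)^n, inf over C_u, every itinerary)] -/
theorem itinJac_growth {γ m : ℝ} (hγ : 0 < γ) (hm : 1 < m) (hγm : m * (m + 2) ≤ (m - 1) * γ ^ 2)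
    {L : List (ℝ × ℝ)} (hL : IsSignList L) {v : Fin 2 → ℝ} (hv : InUnstableCone γ m v) :
    InUnstableCone γ m (itinJac γ L *ᵥ v) ∧
      (γ ^ 2 - 1 - m) ^ L.length * |v 0| ≤ |(itinJac γ L *ᵥ v) 0| := by
  induction L with
  | nil => simpa [itinJac] using hv
  | cons p L ih =>
    obtain ⟨ihc, ihg⟩ := ih (isSignList_of_cons hL)
    obtain ⟨hr, hs⟩ := hL p List.mem_cons_self
    have step := inUnstableCone_pulseJac_mulVec hγ (by linarith) hγm hr hs ihc
    rw [itinJac, ← Matrix.mulVec_mulVec]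
    refine ⟨step.1, ?_⟩
    have hfac : 0 ≤ γ ^ 2 - 1 - m := by nlinarith
    calc (γ ^ 2 - 1 - m) ^ (p :: L).length * |v 0|
        = (γ ^ 2 - 1 - m) * ((γ ^ 2 - 1 - m) ^ L.length * |v 0|) := by
          rw [List.length_cons, pow_succ]; ring
      _ ≤ (γ ^ 2 - 1 - m) * |(itinJac γ L *ᵥ v) 0| := mul_le_mul_of_nonneg_left ihg hfac
      _ ≤ _ := step.2

/-- **Itinerary-uniform expansion of the inverse cocycle on the stable cone** (ELM's backward statement, explicit
threshold): `Π A(rᵢ,sᵢ)⁻¹` preserves `{γ|v₁| ≤ m|v₂|}` and `|(Π A⁻¹ v)₂| ≥ (γ² − 1 − m)^n |v₂|`.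
[cite: ElgindiLissMattingly2025, §3.1 Lemma 3.1 (|λ_s| ≤ (δ₁α²)^{-n}, inf over C_s of ‖∇T^{-n} v‖/‖v‖)] -/
theorem itinJacInv_growth {γ m : ℝ} (hγ : 0 < γ) (hm : 1 < m) (hγm : m * (m + 2) ≤ (m - 1) * γ ^ 2)
    {L : List (ℝ × ℝ)} (hL : IsSignList L) {v : Fin 2 → ℝ} (hv : InStableCone γ m v) :
    InStableCone γ m (itinJacInv γ L *ᵥ v) ∧
      (γ ^ 2 - 1 - m) ^ L.length * |v 1| ≤ |(itinJacInv γ L *ᵥ v) 1| := by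
  induction L with
  | nil => simpa [itinJacInv] using hv
  | cons p L ih =>
    obtain ⟨ihc, ihg⟩ := ih (isSignList_of_cons hL)
    obtain ⟨hr, hs⟩ := hL p List.mem_cons_self
    have step := inStableCone_pulseJacInv_mulVec hγ (by linarith) hγm hr hs ihc
    rw [itinJacInv, ← Matrix.mulVec_mulVec]
    refine ⟨step.1, ?_⟩
    have hfac : 0 ≤ γ ^ 2 - 1 - m := by nlinarith
    calc (γ ^ 2 - 1 - m) ^ (p :: L).length * |v 1|
        = (γ ^ 2 - 1 - m) * ((γ ^ 2 - 1 - m) ^ L.length * |v 1|) := by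
          rw [List.length_cons, pow_succ]; ring
      _ ≤ (γ ^ 2 - 1 - m) * |(itinJacInv γ L *ᵥ v) 1| := mul_le_mul_of_nonneg_left ihg hfac
      _ ≤ _ := step.2

/-! ### Instances: aperture `m = 2` (`δ₁ = ½`), all `γ ≥ 2√2`; and the route's box `γ ∈ [4, 8]` -/

/-- `δ₁ = ½`: for EVERY `γ` with `γ² ≥ 8` and every itinerary, the cone `{γ|v₂| ≤ 2|v₁|}` is invariant and
`|(Π A v)₁| ≥ (γ² − 3)^n |v₁|`. [cite: ElgindiLissMattingly2025, §3.1 Lemma 3.1 ("α sufficiently large" — here: α ≥ 2√2 for δ₁ = ½)] -/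
theorem itinJac_growth_two {γ : ℝ} (hγ : 0 < γ) (h8 : 8 ≤ γ ^ 2) {L : List (ℝ × ℝ)} (hL : IsSignList L)
    {v : Fin 2 → ℝ} (hv : γ * |v 1| ≤ 2 * |v 0|) :
    γ * |(itinJac γ L *ᵥ v) 1| ≤ 2 * |(itinJac γ L *ᵥ v) 0| ∧
      (γ ^ 2 - 3) ^ L.length * |v 0| ≤ |(itinJac γ L *ᵥ v) 0| := by
  have h := itinJac_growth (m := 2) hγ (by norm_num) (by nlinarith) hL (by simpa [InUnstableCone] using hv)
  refine ⟨h.1, ?_⟩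
  have e : γ ^ 2 - 1 - 2 = γ ^ 2 - 3 := by ring
  simpa [e] using h.2

/-- In the cone `{γ|v₂| ≤ 2|v₁|}` with `γ ≥ 2` the sup norm of `ℝ²` is `|v₁|`. [folklore] -/
private theorem norm_eq_abs_of_inUnstableCone_two {γ : ℝ} (hγ : 2 ≤ γ) {v : Fin 2 → ℝ} (hv : γ * |v 1| ≤ 2 * |v 0|) :
    ‖v‖ = |v 0| := by
  have h1 : |v 1| ≤ |v 0| := by nlinarith [abs_nonneg (v 1), abs_nonneg (v 0)]
  apply le_antisymm
  · refine (pi_norm_le_iff_of_nonneg (abs_nonneg _)).2 fun i => ?_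
    fin_cases i
    · simp [Real.norm_eq_abs]
    · simpa [Real.norm_eq_abs] using h1
  · simpa [Real.norm_eq_abs] using norm_le_pi_norm v 0

/-- Sup-norm form (`δ₁ = ½`): for `γ² ≥ 8`, every itinerary and every `v` in the cone `{γ|v₂| ≤ 2|v₁|}`,
`‖Π A(rᵢ,sᵢ) v‖_∞ ≥ (γ² − 3)^n ‖v‖_∞` (`‖·‖` = the sup norm of `Fin 2 → ℝ`).
[cite: ElgindiLissMattingly2025, §3.1 Lemma 3.1 (inf_{v ∈ C_u} ‖∇T^n v‖/‖v‖ ≥ (δ₁α²)^n)] -/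
theorem itinJac_norm_growth_two {γ : ℝ} (hγ : 0 < γ) (h8 : 8 ≤ γ ^ 2) {L : List (ℝ × ℝ)} (hL : IsSignList L)
    {v : Fin 2 → ℝ} (hv : γ * |v 1| ≤ 2 * |v 0|) :
    (γ ^ 2 - 3) ^ L.length * ‖v‖ ≤ ‖itinJac γ L *ᵥ v‖ := by
  have hγ2 : 2 ≤ γ := by nlinarith
  obtain ⟨hc, hg⟩ := itinJac_growth_two hγ h8 hL hv
  rw [norm_eq_abs_of_inUnstableCone_two hγ2 hv, norm_eq_abs_of_inUnstableCone_two hγ2 hc]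
  exact hg

/-- Euclidean one-step form (`δ₁ = ½`): for `γ² ≥ 8`, `r, s = ±1` and `(x,y)` with `γ|y| ≤ 2|x|`, the image under
`A(r,s)` satisfies `x'² + y'² ≥ (γ²/2)²(x² + y²)` — expansion by at least `δ₁γ² = γ²/2` in the Euclidean norm, ELM's
constant, for all `γ ≥ 2√2`. [cite: ElgindiLissMattingly2025, §3.1 (inf_{v∈C_u} ‖(∇T)v‖/‖v‖ ≥ δ₁α²)] -/
theorem pulseJac_euclidSq_growth_two {γ r s x y : ℝ} (hγ : 0 < γ) (h8 : 8 ≤ γ ^ 2) (hr : r = 1 ∨ r = -1)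
    (hs : s = 1 ∨ s = -1) (hcone : γ * |y| ≤ 2 * |x|) :
    (γ ^ 2 / 2) ^ 2 * (x ^ 2 + y ^ 2) ≤
      ((1 + r * s * γ ^ 2) * x + r * γ * y) ^ 2 + (s * γ * x + y) ^ 2 := by
  obtain ⟨h1, -⟩ := sawtooth_cone_step (m := 2) hγ (by norm_num) (by nlinarith) hr hs hcone
  have e : γ ^ 2 - 1 - 2 = γ ^ 2 - 3 := by ring
  rw [e] at h1
  have hx : x ^ 2 = |x| ^ 2 := (sq_abs x).symm
  have hy : y ^ 2 = |y| ^ 2 := (sq_abs y).symm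
  have hX : ((1 + r * s * γ ^ 2) * x + r * γ * y) ^ 2 = |(1 + r * s * γ ^ 2) * x + r * γ * y| ^ 2 :=
    (sq_abs _).symm
  have h3 : 0 ≤ γ ^ 2 - 3 := by nlinarith
  have h1' : (γ ^ 2 - 3) ^ 2 * |x| ^ 2 ≤ |(1 + r * s * γ ^ 2) * x + r * γ * y| ^ 2 := by
    have := mul_self_le_mul_self (by positivity) h1
    nlinarith
  have hc2 : γ ^ 2 * |y| ^ 2 ≤ 4 * |x| ^ 2 := by
    have := mul_self_le_mul_self (by positivity) hcone
    nlinarith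
  have hsq : 0 ≤ (s * γ * x + y) ^ 2 := sq_nonneg _
  -- (γ²−3)² ≥ γ⁴/4 + γ² for γ² ≥ 8 (the quadratic 3u² − 28u + 36 ≥ 0 for u ≥ 8)
  have hpoly : (γ ^ 2 / 2) ^ 2 * (1 + 4 / γ ^ 2) ≤ (γ ^ 2 - 3) ^ 2 := by
    have hγ2 : 0 < γ ^ 2 := by positivity
    rw [show (γ ^ 2 / 2) ^ 2 * (1 + 4 / γ ^ 2) = γ ^ 4 / 4 + γ ^ 2 by field_simp; ring]
    nlinarith
  have hx0 : 0 ≤ |x| ^ 2 := by positivity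
  calc (γ ^ 2 / 2) ^ 2 * (x ^ 2 + y ^ 2) = (γ ^ 2 / 2) ^ 2 * |x| ^ 2 + (γ ^ 2 / 4) * (γ ^ 2 * |y| ^ 2) := by
        rw [hx, hy]; ring
    _ ≤ (γ ^ 2 / 2) ^ 2 * |x| ^ 2 + (γ ^ 2 / 4) * (4 * |x| ^ 2) := by gcongr
    _ = (γ ^ 2 / 2) ^ 2 * (1 + 4 / γ ^ 2) * |x| ^ 2 := by field_simp; ring
    _ ≤ (γ ^ 2 - 3) ^ 2 * |x| ^ 2 := mul_le_mul_of_nonneg_right hpoly hx0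
    _ ≤ _ := by rw [hX]; linarith

/-- **On the route's box.** For every `γ ∈ [4, 8]` (indeed every `γ ≥ 4`), every itinerary of exact sawtooth pulse
pairs and every `v` in the cone `{γ|v₂| ≤ 2|v₁|}`: `|(Π A v)₁| ≥ 13^n |v₁|` — a parcel-uniform per-pulse-pair growth
factor `≥ 13 = 4² − 3` for material lines / scalar gradients of the exact (`δ → 0`) cascade of the route
`SawtoothPulseCascade` (`K1BoundedStrainCascade`, box `γ ∈ Set.Icc 4 8`). [cite: ElgindiLissMattingly2025, §3.1 Lemma 3.1] -/
theorem itinJac_growth_routeBox {γ : ℝ} (hγ : 4 ≤ γ) {L : List (ℝ × ℝ)} (hL : IsSignList L)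
    {v : Fin 2 → ℝ} (hv : γ * |v 1| ≤ 2 * |v 0|) :
    (13 : ℝ) ^ L.length * |v 0| ≤ |(itinJac γ L *ᵥ v) 0| := by
  have h := (itinJac_growth_two (by linarith) (by nlinarith) hL hv).2
  have h13 : (13 : ℝ) ≤ γ ^ 2 - 3 := by nlinarith
  calc (13 : ℝ) ^ L.length * |v 0| ≤ (γ ^ 2 - 3) ^ L.length * |v 0| :=
        mul_le_mul_of_nonneg_right (pow_le_pow_left₀ (by norm_num) h13 _) (abs_nonneg _)
    _ ≤ _ := h


/-! ## Part 8 — the LOCALISED fixed-fraction predicate `K1Localised` (ad-p2 ROUND-3; the K3′ line v2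
`Cruxes.K3NonlinearClosure.Localised`, verbatim bodies)

The gen-4 closure audit of the route `SawtoothPulseCascade` (HOME/ad-ideate-p2/ROUND-3.md) localises the scalar-cost
budget to times `t ≤ tStart (J_r(κ) + A)`, `J_r(κ) = ⌈log(1/κ)/(2 log r)⌉₊` the phase at which wavenumber `r^J` is
damped within one phase; the route's `K1FixedFraction P` is the corollary of the localised predicate
(`K1FixedFraction_of_K1Localised`, monotonicity of the dissipation integral in its upper limit).  Parametrised
predicates, not statements; landed so that the route's item `K1loc` can be filed as a one-line signature. -/

/-- Dissipation phase index for a per-phase stretching rate `r`: `J_r(κ) = ⌈log(1/κ) / (2 log r)⌉₊` — the phase at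
which wavenumber `r^J` is damped within the phase, `κ r^{2J} ≳ 1` (the `n ≳ |log ν|` pulse count of pulsed
diffusion). [cite: ElgindiLissMattingly2025, §1.2.1 and Lemma 2.3 (n ≥ C₁|log ν| pulses)] -/
def Jrate (r κ : ℝ) : ℕ := ⌈Real.log (1 / κ) / (2 * Real.log r)⌉₊

/-- **K1loc** — LOCALISED fixed fraction (ad-p2 ROUND-3, K3′ line v2): a fraction `χ` of the variance of the datum
`sin 2πx₁` advected by the cascade field with diffusivity `κ` is dissipated BY TIME `tStart (J_r(κ) + A)` (end of phase
`J_r(κ) + A − 1 < 1`), uniformly in `κ ∈ (0, κ₀]`, for every classical solution on `[0,1)`.  Stronger than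
`K1FixedFraction` (`K1FixedFraction_of_K1Localised`); the rate used by the closure is `r = γ² − 2`.
[cite: DEIJ2022, (1.2)–(1.3) (κ-uniform lower bound on the dissipated variance)]
[cite: BrueDeLellisCMP2023, §2 Question 2.1 (the target the predicate serves)] -/
def K1Localised (P : CascadeParams) (r : ℝ) : Prop :=
  ∃ χ : ℝ, 0 < χ ∧ ∃ A : ℕ, ∃ κ₀ : ℝ, 0 < κ₀ ∧ ∀ κ ∈ Ioc 0 κ₀, ∀ w : ℝ → UnitAddTorus (Fin 2) → ℝ,
    Torus.IsClassicalScalarTransportOn (Ico 0 1) κ P.field w → w 0 = datum →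
      ENNReal.ofReal (χ * Torus.scalarL2Sq datum) ≤
        2 * Torus.eScalarDissipation κ w 0 (CascadeParams.tStart (Jrate r κ + A))

/-- The extended dissipation `κ∫ₐᵇ‖∇w‖²` is monotone in the upper limit `b`. [cite: DEIJ2022, (1.3) (the dissipation integral over a time window)] -/
theorem eScalarDissipation_mono_right {d : Type*} [Fintype d] {κ : ℝ} (w : ℝ → UnitAddTorus d → ℝ)
    {a b b' : ℝ} (h : b ≤ b') :
    Torus.eScalarDissipation κ w a b ≤ Torus.eScalarDissipation κ w a b' := by
  unfold Torus.eScalarDissipation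
  exact mul_le_mul_right (lintegral_mono_set (Ioo_subset_Ioo_right h)) _

/-- The route's K1 predicate is a corollary of K1loc: `K1Localised P r → K1FixedFraction P` (the dissipation by
`tStart (J_r(κ)+A) < 1` is at most the dissipation by `1`). [cite: DEIJ2022, (1.2)–(1.3)] -/
theorem K1FixedFraction_of_K1Localised (P : CascadeParams) (r : ℝ) (h : K1Localised P r) :
    K1FixedFraction P := by
  obtain ⟨χ, hχ, A, κ₀, hκ₀, H⟩ := h
  refine ⟨χ, hχ, κ₀, hκ₀, fun κ hκ w hw h0 => (H κ hκ w hw h0).trans ?_⟩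
  exact mul_le_mul_right (eScalarDissipation_mono_right w (CascadeParams.tStart_lt_one _).le) _


/-! ## Part 9 — on each half-pulse the cascade field IS a single shear (proved)

On the H half-slot `[tStart j, tStart j + tHalf j]` every V rate and every other H rate vanish, so
`field t x = (rateH j t · U j (x₂), 0)`; on the V half-slot `[tStart j + tHalf j, tStart (j+1)]`,
`field t x = (0, rateV j t · U j (x₁))` (ad-p2 ROUND-2 §5: "at each `t < 1` at most one summand is non-zero").
This is the structural input of the per-pulse arguments (K3′ line v2 `ShearGradientEnvelope`, K2″'s comb classes). -/

namespace CascadeParams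

variable (P : CascadeParams)

/-- On the H half-slot of phase `j` all V rates vanish. [cite: ElgindiLissMattingly2025, §1 (u_α = V_α on [0,½), H_α on [½,1): one shear at a time)] -/
theorem rateV_eq_zero_of_mem_H {j : ℕ} {t : ℝ} (ht : t ∈ Icc (tStart j) (tStart j + tHalf j)) (i : ℕ) :
    P.rateV i t = 0 := by
  rcases lt_trichotomy i j with h | rfl | h
  · refine P.rateV_of_ge ?_
    have h1 : tStart (i + 1) ≤ tStart j := tStart_strictMono.monotone (Nat.succ_le_of_lt h)
    rw [tStart_succ] at h1
    exact h1.trans ht.1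
  · exact P.rateV_of_le ht.2
  · refine P.rateV_of_le ?_
    have h1 : tStart (j + 1) ≤ tStart i := tStart_strictMono.monotone (Nat.succ_le_of_lt h)
    rw [tStart_succ] at h1
    linarith [ht.2, tHalf_pos j, tHalf_pos i]

/-- On the H half-slot of phase `j` all OTHER H rates vanish. [cite: ElgindiLissMattingly2025, §1 (one shear at a time)] -/
theorem rateH_eq_zero_of_mem_H_of_ne {j : ℕ} {t : ℝ} (ht : t ∈ Icc (tStart j) (tStart j + tHalf j)) {i : ℕ}
    (hij : i ≠ j) : P.rateH i t = 0 := by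
  rcases lt_or_gt_of_ne hij with h | h
  · refine P.rateH_of_ge ?_
    have h1 : tStart (i + 1) ≤ tStart j := tStart_strictMono.monotone (Nat.succ_le_of_lt h)
    rw [tStart_succ] at h1
    linarith [ht.1, tHalf_pos i]
  · refine P.rateH_of_le_tStart ?_
    have h1 : tStart (j + 1) ≤ tStart i := tStart_strictMono.monotone (Nat.succ_le_of_lt h)
    rw [tStart_succ] at h1
    linarith [ht.2, tHalf_pos j]

/-- On the V half-slot of phase `j` all H rates vanish. [cite: ElgindiLissMattingly2025, §1 (one shear at a time)] -/
theorem rateH_eq_zero_of_mem_V {j : ℕ} {t : ℝ} (ht : t ∈ Icc (tStart j + tHalf j) (tStart (j + 1))) (i : ℕ) :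
    P.rateH i t = 0 := by
  rcases lt_trichotomy i j with h | rfl | h
  · refine P.rateH_of_ge ?_
    have h1 : tStart (i + 1) ≤ tStart j := tStart_strictMono.monotone (Nat.succ_le_of_lt h)
    rw [tStart_succ] at h1
    linarith [ht.1, tHalf_pos i, tHalf_pos j]
  · exact P.rateH_of_ge ht.1
  · refine P.rateH_of_le_tStart ?_
    exact ht.2.trans (tStart_strictMono.monotone (Nat.succ_le_of_lt h))

/-- On the V half-slot of phase `j` all OTHER V rates vanish. [cite: ElgindiLissMattingly2025, §1 (one shear at a time)] -/
theorem rateV_eq_zero_of_mem_V_of_ne {j : ℕ} {t : ℝ} (ht : t ∈ Icc (tStart j + tHalf j) (tStart (j + 1)))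
    {i : ℕ} (hij : i ≠ j) : P.rateV i t = 0 := by
  rcases lt_or_gt_of_ne hij with h | h
  · refine P.rateV_of_ge ?_
    have h1 : tStart (i + 1) ≤ tStart j := tStart_strictMono.monotone (Nat.succ_le_of_lt h)
    rw [tStart_succ] at h1
    linarith [ht.1, tHalf_pos j]
  · refine P.rateV_of_le ?_
    have h1 : tStart (j + 1) ≤ tStart i := tStart_strictMono.monotone (Nat.succ_le_of_lt h)
    linarith [ht.2, tHalf_pos i]

/-- **The field on an H half-slot is the single horizontal shear `(rateH j t · U j (x₂), 0)`.**
[cite: ElgindiLissMattingly2025, §1 (u_α = H_α on its half period)] -/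
theorem field_eq_of_mem_H {j : ℕ} {t : ℝ} (ht : t ∈ Icc (tStart j) (tStart j + tHalf j))
    (x : UnitAddTorus (Fin 2)) :
    P.field t x = WithLp.toLp 2 ![P.rateH j t * P.U j (Torus.repr x 1), 0] := by
  have h1 : ∑' i : ℕ, P.rateH i t * P.U i (Torus.repr x 1) = P.rateH j t * P.U j (Torus.repr x 1) :=
    tsum_eq_single j fun i hij => by rw [P.rateH_eq_zero_of_mem_H_of_ne ht hij, zero_mul]
  have h2 : ∑' i : ℕ, P.rateV i t * P.U i (Torus.repr x 0) = 0 := by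
    simp [P.rateV_eq_zero_of_mem_H ht]
  rw [field, h1, h2]

/-- **The field on a V half-slot is the single vertical shear `(0, rateV j t · U j (x₁))`.**
[cite: ElgindiLissMattingly2025, §1 (u_α = V_α on its half period)] -/
theorem field_eq_of_mem_V {j : ℕ} {t : ℝ} (ht : t ∈ Icc (tStart j + tHalf j) (tStart (j + 1)))
    (x : UnitAddTorus (Fin 2)) :
    P.field t x = WithLp.toLp 2 ![0, P.rateV j t * P.U j (Torus.repr x 0)] := by
  have h1 : ∑' i : ℕ, P.rateV i t * P.U i (Torus.repr x 0) = P.rateV j t * P.U j (Torus.repr x 0) :=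
    tsum_eq_single j fun i hij => by rw [P.rateV_eq_zero_of_mem_V_of_ne ht hij, zero_mul]
  have h2 : ∑' i : ℕ, P.rateH i t * P.U i (Torus.repr x 1) = 0 := by
    simp [P.rateH_eq_zero_of_mem_V ht]
  rw [field, h1, h2]

/-- Both rates are nonnegative when `γ ≥ 0` (the bump is nonnegative). [cite: ElgindiLissMattingly2025, Rmk. 1.4 (φ ≥ 0)] -/
theorem rateH_nonneg (hγ : 0 ≤ P.γ) (j : ℕ) (t : ℝ) : 0 ≤ P.rateH j t :=
  mul_nonneg (div_nonneg hγ (tHalf_pos j).le) (bump_nonneg _)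

/-- Both rates are nonnegative when `γ ≥ 0`. [cite: ElgindiLissMattingly2025, Rmk. 1.4 (φ ≥ 0)] -/
theorem rateV_nonneg (hγ : 0 ≤ P.γ) (j : ℕ) (t : ℝ) : 0 ≤ P.rateV j t :=
  mul_nonneg (div_nonneg hγ (tHalf_pos j).le) (bump_nonneg _)

end CascadeParams

/-! ## Part 10 — slopes (proved): `tri`, `S_δ = roundedSaw δ` and `U j` are `1`-Lipschitz, `|U_j′| ≤ 1`,
and the field gradient on each half-slot

`tri θ = π/2 − ‖θ − π/2‖_{ℝ/2πℤ}` (`tri_eq_pi_div_two_sub_norm`: the triangle wave is the distance to the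
corner lattice), so `tri` is `1`-Lipschitz (`abs_tri_sub_tri_le`); the Gaussian kernel has mass one
(`integral_gaussKernel`), so the rounded sawtooth `S_δ = tri ⋆ gaussKernel δ` is `1`-Lipschitz
(`abs_roundedSaw_sub_le`), and so is every rescaled profile `U j` (`CascadeParams.abs_U_sub_U_le`), whence
`|U_j′| ≤ 1` everywhere (`CascadeParams.abs_deriv_U_le_one`; Mathlib's junk value `0` of `deriv` included).
On the H half-slot the field `(rateH j t · U j (x₂), 0)` therefore has `∂₁ ≡ 0` and
`∂₂ = rateH j t · U_j′(x₂) · e₁` with `|⟪∂₂ ū, v⟫| ≤ rateH j t · |v₁|`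
(`CascadeParams.partialDeriv_field_of_mem_H`, `CascadeParams.abs_inner_partialDeriv_field_le_of_mem_H`), and
symmetrically on the V half-slot — exactly the velocity-gradient input of
`Torus.IsClassicalScalarTransportOn.abs_partialDeriv_le_add_mul_integral_of_shear`
(`PassiveScalarGradientTransport`) for the K3′ line's `ShearGradientEnvelope` (x-gradient conserved and
y-gradient amplified by at most `∫ rateH = γ` times the x-gradient over an H half-pulse, and vice versa). -/

/-- `tri` is continuous. [cite: ElgindiLissMattingly2025, §1 (the Lipschitz profiles H_α, V_α)] -/
theorem continuous_tri : Continuous tri := by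
  unfold tri
  exact Real.continuous_arcsin.comp Real.continuous_sin

/-- **`tri θ = π/2 − ‖θ − π/2‖_{ℝ/2πℤ}`**: the triangle wave is `π/2` minus the distance from `θ − π/2` to `2πℤ`.
[cite: ElgindiLissMattingly2025, §1 (the piecewise-linear profiles H_α, V_α)] -/
theorem tri_eq_pi_div_two_sub_norm (θ : ℝ) :
    tri θ = Real.pi / 2 - ‖((θ - Real.pi / 2 : ℝ) : AddCircle (2 * Real.pi))‖ := by
  have hπ : 0 < Real.pi := Real.pi_pos
  rw [AddCircle.norm_eq]
  set n : ℤ := round ((2 * Real.pi)⁻¹ * (θ - Real.pi / 2)) with hn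
  set x₀ : ℝ := θ - Real.pi / 2 - n * (2 * Real.pi) with hx₀
  have hx₀abs : |x₀| ≤ Real.pi := by
    have h := abs_sub_round ((2 * Real.pi)⁻¹ * (θ - Real.pi / 2))
    rw [← hn] at h
    have e : x₀ = ((2 * Real.pi)⁻¹ * (θ - Real.pi / 2) - n) * (2 * Real.pi) := by
      rw [hx₀]
      field_simp
    rw [e, abs_mul, abs_of_pos (by positivity : (0 : ℝ) < 2 * Real.pi)]
    calc |(2 * Real.pi)⁻¹ * (θ - Real.pi / 2) - ↑n| * (2 * Real.pi) ≤ 1 / 2 * (2 * Real.pi) := by gcongr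
      _ = Real.pi := by ring
  have hθ : θ = x₀ + Real.pi / 2 + n * (2 * Real.pi) := by
    rw [hx₀]
    ring
  have hper : tri θ = tri (x₀ + Real.pi / 2) := by
    conv_lhs => rw [hθ]
    exact (tri_periodic.int_mul n) _
  rw [hper]
  rcases le_or_gt x₀ 0 with h0 | h0
  · rw [abs_of_nonpos h0, tri_eq_self (by linarith [(abs_le.mp hx₀abs).1]) (by linarith)]
    ring
  · rw [abs_of_pos h0, tri_eq_pi_sub (by linarith) (by linarith [(abs_le.mp hx₀abs).2])]
    ring

/-- **`tri` is `1`-Lipschitz**: `|tri a − tri b| ≤ |a − b|`. [cite: ElgindiLissMattingly2025, §1 (H_α, V_α Lipschitz with slope ±1)] -/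
theorem abs_tri_sub_tri_le (a b : ℝ) : |tri a - tri b| ≤ |a - b| := by
  rw [tri_eq_pi_div_two_sub_norm a, tri_eq_pi_div_two_sub_norm b]
  have h1 := abs_norm_sub_norm_le ((a - Real.pi / 2 : ℝ) : AddCircle (2 * Real.pi))
    ((b - Real.pi / 2 : ℝ) : AddCircle (2 * Real.pi))
  have h2 : ‖((a - Real.pi / 2 : ℝ) : AddCircle (2 * Real.pi)) -
      ((b - Real.pi / 2 : ℝ) : AddCircle (2 * Real.pi))‖ ≤ |a - b| := by
    rw [← AddCircle.coe_sub, show a - Real.pi / 2 - (b - Real.pi / 2) = a - b by ring]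
    exact QuotientAddGroup.norm_mk_le_norm.trans_eq (Real.norm_eq_abs _)
  rw [show Real.pi / 2 - ‖((a - Real.pi / 2 : ℝ) : AddCircle (2 * Real.pi))‖ -
      (Real.pi / 2 - ‖((b - Real.pi / 2 : ℝ) : AddCircle (2 * Real.pi))‖) =
      -(‖((a - Real.pi / 2 : ℝ) : AddCircle (2 * Real.pi))‖ -
        ‖((b - Real.pi / 2 : ℝ) : AddCircle (2 * Real.pi))‖) by ring, abs_neg]
  exact h1.trans h2

/-- `tri` is `1`-Lipschitz (bundled). [cite: ElgindiLissMattingly2025, §1 (H_α, V_α Lipschitz with slope ±1)] -/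
theorem lipschitzWith_tri : LipschitzWith 1 tri :=
  LipschitzWith.of_dist_le_mul fun a b => by simpa [Real.dist_eq] using abs_tri_sub_tri_le a b

/-- The Gaussian kernel is nonnegative (`δ ≥ 0`). [cite: Folland1999, Prop. 2.53 (the Gaussian e^{−a|x|²}, a > 0)] -/
theorem gaussKernel_nonneg {δ : ℝ} (hδ : 0 ≤ δ) (y : ℝ) : 0 ≤ gaussKernel δ y := by
  unfold gaussKernel
  positivity

/-- The Gaussian kernel in Mathlib's `exp (-b y²)` normal form. [folklore] -/
private theorem gaussKernel_eq (δ : ℝ) :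
    gaussKernel δ = fun y => Real.exp (-(1 / (2 * δ ^ 2)) * y ^ 2) / (δ * Real.sqrt (2 * Real.pi)) := by
  funext y
  simp only [gaussKernel]
  congr 2
  ring

/-- The Gaussian kernel is integrable (`δ > 0`). [cite: Folland1999, Prop. 2.53 (∫ e^{−a|x|²} dx = (π/a)^{n/2} < ∞, n = 1)] -/
theorem integrable_gaussKernel {δ : ℝ} (hδ : 0 < δ) : Integrable (gaussKernel δ) := by
  rw [gaussKernel_eq]
  exact (integrable_exp_neg_mul_sq (by positivity : (0 : ℝ) < 1 / (2 * δ ^ 2))).div_const _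

/-- **The Gaussian kernel has mass one**: `∫ gaussKernel δ = 1` (`δ > 0`), from `∫ e^{-b y²} dy = √(π/b)`.
[cite: Folland1999, Prop. 2.53 (∫ e^{−a|x|²} dx = (π/a)^{n/2}, n = 1, a = 1/(2δ²))] -/
theorem integral_gaussKernel {δ : ℝ} (hδ : 0 < δ) : ∫ y, gaussKernel δ y = 1 := by
  have hc : 0 < δ * Real.sqrt (2 * Real.pi) := by positivity
  rw [gaussKernel_eq]
  simp only
  rw [integral_div, integral_gaussian]
  have : Real.pi / (1 / (2 * δ ^ 2)) = δ ^ 2 * (2 * Real.pi) := by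
    field_simp
  rw [this, Real.sqrt_mul (sq_nonneg δ), Real.sqrt_sq hδ.le, div_self hc.ne']

/-- The rounded sawtooth is `2π`-periodic (translation commutes with convolution).
[cite: Folland1999, §8.2 Prop. 8.6 (τ_a(f ∗ g) = (τ_a f) ∗ g)] -/
theorem roundedSaw_periodic (δ : ℝ) : Function.Periodic (roundedSaw δ) (2 * Real.pi) := fun θ => by
  simp only [roundedSaw]
  congr 1
  funext y
  rw [show θ + 2 * Real.pi - y = θ - y + 2 * Real.pi by ring, tri_periodic]

/-- The integrand of `roundedSaw δ θ` is integrable (`δ > 0`). [folklore] -/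
private theorem integrable_tri_sub_mul_gaussKernel {δ : ℝ} (hδ : 0 < δ) (θ : ℝ) :
    Integrable (fun y => tri (θ - y) * gaussKernel δ y) := by
  refine (integrable_gaussKernel hδ).bdd_mul (c := Real.pi / 2) ?_ (ae_of_all _ fun y => ?_)
  · exact (continuous_tri.comp (continuous_const.sub continuous_id)).aestronglyMeasurable
  · rw [Real.norm_eq_abs]
    exact abs_tri_le _

/-- **The rounded sawtooth `S_δ = tri ⋆ gaussKernel δ` is `1`-Lipschitz** (`δ > 0`): convolution with a
probability density preserves the Lipschitz constant (`‖(τ_h tri − tri) ∗ g‖_u ≤ ‖τ_h tri − tri‖_∞ ‖g‖₁ ≤ |h|`).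
[cite: Folland1999, §8.2 Prop. 8.8 (‖f ∗ g‖_u ≤ ‖f‖_p ‖g‖_q with p = ∞, q = 1) and Prop. 8.6 (τ_a(f ∗ g) = (τ_a f) ∗ g)] -/
theorem abs_roundedSaw_sub_le {δ : ℝ} (hδ : 0 < δ) (a b : ℝ) :
    |roundedSaw δ a - roundedSaw δ b| ≤ |a - b| := by
  simp only [roundedSaw]
  rw [← integral_sub (integrable_tri_sub_mul_gaussKernel hδ a) (integrable_tri_sub_mul_gaussKernel hδ b)]
  calc |∫ y, (tri (a - y) * gaussKernel δ y - tri (b - y) * gaussKernel δ y)|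
      ≤ ∫ y, |a - b| * gaussKernel δ y := by
        rw [← Real.norm_eq_abs]
        refine norm_integral_le_of_norm_le ((integrable_gaussKernel hδ).const_mul _)
          (ae_of_all _ fun y => ?_)
        rw [Real.norm_eq_abs, ← sub_mul, abs_mul, abs_of_nonneg (gaussKernel_nonneg hδ.le y)]
        refine mul_le_mul_of_nonneg_right ?_ (gaussKernel_nonneg hδ.le y)
        calc |tri (a - y) - tri (b - y)| ≤ |a - y - (b - y)| := abs_tri_sub_tri_le _ _
          _ = |a - b| := by rw [show a - y - (b - y) = a - b by ring]
    _ = |a - b| := by rw [integral_const_mul, integral_gaussKernel hδ, mul_one]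

/-- The rounded sawtooth is `1`-Lipschitz (bundled; `δ > 0`).
[cite: Folland1999, §8.2 Prop. 8.8 (‖f ∗ g‖_u ≤ ‖f‖_∞ ‖g‖₁)] -/
theorem lipschitzWith_roundedSaw {δ : ℝ} (hδ : 0 < δ) : LipschitzWith 1 (roundedSaw δ) :=
  LipschitzWith.of_dist_le_mul fun a b => by simpa [Real.dist_eq] using abs_roundedSaw_sub_le hδ a b

/-- `bump` is continuous. [cite: ElgindiLissMattingly2025, Rmk. 1.4 (smooth-in-time pulses φ)] -/
theorem continuous_bump : Continuous CascadeParams.bump := by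
  unfold CascadeParams.bump
  exact ((expNegInvGlue.contDiff (n := 0)).continuous.mul
    ((expNegInvGlue.contDiff (n := 0)).continuous.comp (continuous_const.sub continuous_id))).div_const _

/-- Derivative of `s ↦ c(s) • eᵢ` in `ℝ²` with no differentiability hypothesis (junk values agree). [folklore] -/
private theorem deriv_smul_single (c : ℝ → ℝ) (i : Fin 2) (s : ℝ) :
    deriv (fun y => c y • EuclideanSpace.single i (1 : ℝ)) s =
      deriv c s • EuclideanSpace.single i (1 : ℝ) := by
  by_cases hc : DifferentiableAt ℝ c s
  · exact deriv_smul_const hc _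
  · have hc' : ¬ DifferentiableAt ℝ (fun y => c y • EuclideanSpace.single i (1 : ℝ)) s := by
      intro h
      apply hc
      have h2 := (EuclideanSpace.proj i : EuclideanSpace ℝ (Fin 2) →L[ℝ] ℝ).differentiableAt.comp s h
      have h3 : ((EuclideanSpace.proj i : EuclideanSpace ℝ (Fin 2) →L[ℝ] ℝ) ∘
          fun y => c y • EuclideanSpace.single i (1 : ℝ)) = c := by
        funext y
        simp
      rwa [h3] at h2
    rw [deriv_zero_of_not_differentiableAt hc, deriv_zero_of_not_differentiableAt hc', zero_smul]

namespace CascadeParams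

variable (P : CascadeParams)

/-- The pulse rates are continuous in time. [cite: ElgindiLissMattingly2025, Rmk. 1.4 (smooth-in-time pulses φ)] -/
theorem continuous_rateH (j : ℕ) : Continuous (P.rateH j) := by
  unfold rateH
  exact continuous_const.mul (continuous_bump.comp ((continuous_id.sub continuous_const).div_const _))

/-- The pulse rates are continuous in time. [cite: ElgindiLissMattingly2025, Rmk. 1.4 (smooth-in-time pulses φ)] -/
theorem continuous_rateV (j : ℕ) : Continuous (P.rateV j) := by
  unfold rateV
  exact continuous_const.mul
    (continuous_bump.comp (((continuous_id.sub continuous_const).sub continuous_const).div_const _))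

/-- Each profile `U j` is `1`-periodic (it lives on the unit circle coordinate). [cite: ElgindiLissMattingly2025, §1 (H_α, V_α on 𝕋²)] -/
theorem U_periodic (j : ℕ) : Function.Periodic (P.U j) 1 := fun y => by
  simp only [U]
  rw [show 2 * Real.pi * (P.N j : ℝ) * (y + 1) = 2 * Real.pi * P.N j * y + P.N j * (2 * Real.pi) by ring,
    (roundedSaw_periodic _).nat_mul (P.N j)]

/-- **Each profile `U j` is `1`-Lipschitz** (`δ j > 0`): rescaling `y ↦ S_δ(2πN y)/(2πN)` preserves the
Lipschitz constant `1` of `S_δ`. [cite: ElgindiLissMattingly2025, §1 (H_α, V_α Lipschitz with slope ±1)] -/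
theorem abs_U_sub_U_le {j : ℕ} (hδ : 0 < P.δ j) (y y' : ℝ) : |P.U j y - P.U j y'| ≤ |y - y'| := by
  simp only [U]
  rcases eq_or_ne (2 * Real.pi * (P.N j : ℝ)) 0 with hc | hc
  · rw [hc]
    simp
  · rw [← sub_div, abs_div, div_le_iff₀ (abs_pos.mpr hc)]
    calc |roundedSaw (P.δ j) (2 * Real.pi * P.N j * y) - roundedSaw (P.δ j) (2 * Real.pi * P.N j * y')|
        ≤ |2 * Real.pi * P.N j * y - 2 * Real.pi * P.N j * y'| := abs_roundedSaw_sub_le hδ _ _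
      _ = |y - y'| * |2 * Real.pi * (P.N j : ℝ)| := by rw [← mul_sub, abs_mul, mul_comm]

/-- `U j` is `1`-Lipschitz (bundled; `δ j > 0`). [cite: ElgindiLissMattingly2025, §1 (H_α, V_α Lipschitz with slope ±1)] -/
theorem lipschitzWith_U {j : ℕ} (hδ : 0 < P.δ j) : LipschitzWith 1 (P.U j) :=
  LipschitzWith.of_dist_le_mul fun y y' => by simpa [Real.dist_eq] using P.abs_U_sub_U_le hδ y y'

/-- **`|U_j′| ≤ 1` everywhere** (`δ j > 0`; where `U j` is not differentiable Mathlib's `deriv` is `0`).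
[cite: ElgindiLissMattingly2025, §1 (H_α, V_α have slope ±1)] -/
theorem abs_deriv_U_le_one {j : ℕ} (hδ : 0 < P.δ j) (y : ℝ) : |deriv (P.U j) y| ≤ 1 := by
  have h := norm_deriv_le_of_lipschitz (x₀ := y) (P.lipschitzWith_U hδ)
  simpa [Real.norm_eq_abs] using h

/-- **Velocity gradient on an H half-slot**: for `t ∈ [tStart j, tStart j + tHalf j]` the field
`(rateH j t · U j (x₂), 0)` has `∂₁ ū = 0` and `∂₂ ū = rateH j t · U_j′(x₂) · e₁`.
[cite: ElgindiLissMattingly2025, §1 (u_α = H_α(x₂) e₁ on its half period)] -/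
theorem partialDeriv_field_of_mem_H {j : ℕ} {t : ℝ} (ht : t ∈ Icc (tStart j) (tStart j + tHalf j))
    (x : UnitAddTorus (Fin 2)) :
    Torus.partialDeriv 0 (P.field t) x = 0 ∧
      Torus.partialDeriv 1 (P.field t) x =
        (P.rateH j t * deriv (P.U j) (Torus.repr x 1)) • EuclideanSpace.single 0 (1 : ℝ) := by
  set Φ : ℝ → EuclideanSpace ℝ (Fin 2) :=
    fun s => (P.rateH j t * P.U j s) • EuclideanSpace.single 0 (1 : ℝ) with hΦ
  have hfield : P.field t = fun x => Φ (Torus.repr x 1) := by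
    funext x
    rw [P.field_eq_of_mem_H ht x]
    ext i
    fin_cases i <;> simp [Φ]
  have hΦper : Function.Periodic Φ 1 := fun s => by
    simp [Φ, P.U_periodic j s]
  refine ⟨?_, ?_⟩
  · rw [hfield]
    exact Torus.partialDeriv_coordFun_of_ne hΦper (by decide) x
  · rw [hfield, Torus.partialDeriv_coordFun_self hΦper 1 x, hΦ, deriv_smul_single]
    congr 1
    exact deriv_const_mul_field _

/-- **Velocity gradient on a V half-slot**: for `t ∈ [tStart j + tHalf j, tStart (j+1)]` the field
`(0, rateV j t · U j (x₁))` has `∂₂ ū = 0` and `∂₁ ū = rateV j t · U_j′(x₁) · e₂`.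
[cite: ElgindiLissMattingly2025, §1 (u_α = V_α(x₁) e₂ on its half period)] -/
theorem partialDeriv_field_of_mem_V {j : ℕ} {t : ℝ} (ht : t ∈ Icc (tStart j + tHalf j) (tStart (j + 1)))
    (x : UnitAddTorus (Fin 2)) :
    Torus.partialDeriv 1 (P.field t) x = 0 ∧
      Torus.partialDeriv 0 (P.field t) x =
        (P.rateV j t * deriv (P.U j) (Torus.repr x 0)) • EuclideanSpace.single 1 (1 : ℝ) := by
  set Φ : ℝ → EuclideanSpace ℝ (Fin 2) :=
    fun s => (P.rateV j t * P.U j s) • EuclideanSpace.single 1 (1 : ℝ) with hΦ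
  have hfield : P.field t = fun x => Φ (Torus.repr x 0) := by
    funext x
    rw [P.field_eq_of_mem_V ht x]
    ext i
    fin_cases i <;> simp [Φ]
  have hΦper : Function.Periodic Φ 1 := fun s => by
    simp [Φ, P.U_periodic j s]
  refine ⟨?_, ?_⟩
  · rw [hfield]
    exact Torus.partialDeriv_coordFun_of_ne hΦper (by decide) x
  · rw [hfield, Torus.partialDeriv_coordFun_self hΦper 0 x, hΦ, deriv_smul_single]
    congr 1
    exact deriv_const_mul_field _

/-- **On an H half-slot `|⟪∂₂ ū(t,x), v⟫| ≤ rateH j t · |v₁|`** for every `v ∈ ℝ²` (`γ ≥ 0`, `δ j > 0`):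
the hypothesis `|⟪∂ⱼu, ∇θ⟫| ≤ A(t) |∂ᵢθ|` of
`Torus.IsClassicalScalarTransportOn.abs_partialDeriv_le_add_mul_integral_of_shear` with `A = rateH j`.
[cite: ElgindiLissMattingly2025, §1 (u_α = H_α(x₂) e₁, slope ±α)] -/
theorem abs_inner_partialDeriv_field_le_of_mem_H (hγ : 0 ≤ P.γ) {j : ℕ} (hδ : 0 < P.δ j) {t : ℝ}
    (ht : t ∈ Icc (tStart j) (tStart j + tHalf j)) (x : UnitAddTorus (Fin 2))
    (v : EuclideanSpace ℝ (Fin 2)) :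
    |@inner ℝ _ _ (Torus.partialDeriv 1 (P.field t) x) v| ≤ P.rateH j t * |v 0| := by
  rw [(P.partialDeriv_field_of_mem_H ht x).2, real_inner_smul_left, EuclideanSpace.inner_single_left]
  simp only [map_one, one_mul]
  rw [abs_mul, abs_mul, abs_of_nonneg (P.rateH_nonneg hγ j t)]
  calc P.rateH j t * |deriv (P.U j) (Torus.repr x 1)| * |v 0| ≤ P.rateH j t * 1 * |v 0| := by
        gcongr
        · exact P.rateH_nonneg hγ j t
        · exact P.abs_deriv_U_le_one hδ _
    _ = P.rateH j t * |v 0| := by ring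

/-- **On a V half-slot `|⟪∂₁ ū(t,x), v⟫| ≤ rateV j t · |v₂|`** for every `v ∈ ℝ²` (`γ ≥ 0`, `δ j > 0`).
[cite: ElgindiLissMattingly2025, §1 (u_α = V_α(x₁) e₂, slope ±α)] -/
theorem abs_inner_partialDeriv_field_le_of_mem_V (hγ : 0 ≤ P.γ) {j : ℕ} (hδ : 0 < P.δ j) {t : ℝ}
    (ht : t ∈ Icc (tStart j + tHalf j) (tStart (j + 1))) (x : UnitAddTorus (Fin 2))
    (v : EuclideanSpace ℝ (Fin 2)) :
    |@inner ℝ _ _ (Torus.partialDeriv 0 (P.field t) x) v| ≤ P.rateV j t * |v 1| := by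
  rw [(P.partialDeriv_field_of_mem_V ht x).2, real_inner_smul_left, EuclideanSpace.inner_single_left]
  simp only [map_one, one_mul]
  rw [abs_mul, abs_mul, abs_of_nonneg (P.rateV_nonneg hγ j t)]
  calc P.rateV j t * |deriv (P.U j) (Torus.repr x 0)| * |v 1| ≤ P.rateV j t * 1 * |v 1| := by
        gcongr
        · exact P.rateV_nonneg hγ j t
        · exact P.abs_deriv_U_le_one hδ _
    _ = P.rateV j t * |v 1| := by ring

end CascadeParams

/-! ## Part 11 — energy growth of a linearised perturbation over one half pulse (proved): the
classical `HalfPulseEnergyBound`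

On each half-slot the cascade field is a divergence-free shear (`isDivFree_field_of_mem_H/V`), so the
variable-rate energy bound of `TorusLinearisedNSShear`
(`Torus.linearisedNS_integral_norm_sq_le_mul_exp_integral_of_shear`, rate `r = rateH j` resp. `rateV j`
by Part 10) gives, for every CLASSICAL solution `(w, q)` of the linearised Navier–Stokes equation
`∂ₜw + (ū·∇)w + (w·∇)ū = νΔw − ∇q`, `div w = 0` along the cascade field on that half-slot,
`∫ ‖w(t)‖² ≤ (∫ ‖w(a)‖²) exp(∫ₐᵗ rate) ≤ e^γ ∫ ‖w(a)‖²` (`∫ rate = γ`, `integral_rateH/V`) — the K3′ line's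
`HalfPulseEnergyBound` for classical (not weak) perturbations. The joint smoothness of the field on the
half-slot is a hypothesis (cf. `CascadeFieldSmooth`). -/

namespace CascadeParams

variable (P : CascadeParams)

/-- **The field is divergence free on an H half-slot** (`(rateH j t · U j (x₂), 0)` does not depend on `x₁`).
[cite: ElgindiLissMattingly2025, §1 (u_α is divergence free: H_α(x₂) e₁)] -/
theorem isDivFree_field_of_mem_H {j : ℕ} {t : ℝ} (ht : t ∈ Icc (tStart j) (tStart j + tHalf j)) :
    Torus.IsDivFree (P.field t) := by
  intro x
  have h0 : (fun y => P.field t y 0) = fun y => (fun s => P.rateH j t * P.U j s) (Torus.repr y 1) := by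
    funext y
    rw [P.field_eq_of_mem_H ht y]
    simp
  have h1 : (fun y => P.field t y 1) = fun y => (fun _ : ℝ => (0 : ℝ)) (Torus.repr y 1) := by
    funext y
    rw [P.field_eq_of_mem_H ht y]
    simp
  have hper0 : Function.Periodic (fun s => P.rateH j t * P.U j s) 1 := fun s => by
    simp only [P.U_periodic j s]
  have hper1 : Function.Periodic (fun _ : ℝ => (0 : ℝ)) 1 := fun _ => rfl
  rw [Torus.divergence, Fin.sum_univ_two, h0, h1, Torus.partialDeriv_coordFun_of_ne hper0 (by decide) x,
    Torus.partialDeriv_coordFun_self hper1 1 x, deriv_const, add_zero]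

/-- **The field is divergence free on a V half-slot** (`(0, rateV j t · U j (x₁))` does not depend on `x₂`).
[cite: ElgindiLissMattingly2025, §1 (u_α is divergence free: V_α(x₁) e₂)] -/
theorem isDivFree_field_of_mem_V {j : ℕ} {t : ℝ} (ht : t ∈ Icc (tStart j + tHalf j) (tStart (j + 1))) :
    Torus.IsDivFree (P.field t) := by
  intro x
  have h0 : (fun y => P.field t y 0) = fun y => (fun _ : ℝ => (0 : ℝ)) (Torus.repr y 0) := by
    funext y
    rw [P.field_eq_of_mem_V ht y]
    simp
  have h1 : (fun y => P.field t y 1) = fun y => (fun s => P.rateV j t * P.U j s) (Torus.repr y 0) := by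
    funext y
    rw [P.field_eq_of_mem_V ht y]
    simp
  have hper1 : Function.Periodic (fun s => P.rateV j t * P.U j s) 1 := fun s => by
    simp only [P.U_periodic j s]
  have hper0 : Function.Periodic (fun _ : ℝ => (0 : ℝ)) 1 := fun _ => rfl
  rw [Torus.divergence, Fin.sum_univ_two, h0, h1, Torus.partialDeriv_coordFun_self hper0 0 x,
    Torus.partialDeriv_coordFun_of_ne hper1 (by decide) x, deriv_const, add_zero]

/-- The partial strain of an H half-pulse is at most `γ`: `∫_{tStart j}^{t} rateH j ≤ γ` for `t` in the slot
(`rateH ≥ 0`, total `γ`). [cite: ElgindiLissMattingly2025, Rmk. 1.4 (∫φ = α, φ ≥ 0)] -/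
theorem integral_rateH_le (hγ : 0 ≤ P.γ) {j : ℕ} {t : ℝ} (ht : t ∈ Icc (tStart j) (tStart j + tHalf j)) :
    ∫ s in tStart j..t, P.rateH j s ≤ P.γ := by
  have hc := P.continuous_rateH j
  have hsplit := intervalIntegral.integral_add_adjacent_intervals
    (hc.intervalIntegrable (μ := volume) (tStart j) t) (hc.intervalIntegrable (μ := volume) t (tStart j + tHalf j))
  have hrest : 0 ≤ ∫ s in t..(tStart j + tHalf j), P.rateH j s :=
    intervalIntegral.integral_nonneg ht.2 fun s _ => P.rateH_nonneg hγ j s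
  rw [P.integral_rateH j] at hsplit
  linarith

/-- The partial strain of a V half-pulse is at most `γ`. [cite: ElgindiLissMattingly2025, Rmk. 1.4 (∫φ = α, φ ≥ 0)] -/
theorem integral_rateV_le (hγ : 0 ≤ P.γ) {j : ℕ} {t : ℝ}
    (ht : t ∈ Icc (tStart j + tHalf j) (tStart (j + 1))) :
    ∫ s in (tStart j + tHalf j)..t, P.rateV j s ≤ P.γ := by
  have hc := P.continuous_rateV j
  have hsplit := intervalIntegral.integral_add_adjacent_intervals
    (hc.intervalIntegrable (μ := volume) (tStart j + tHalf j) t)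
    (hc.intervalIntegrable (μ := volume) t (tStart (j + 1)))
  have hrest : 0 ≤ ∫ s in t..tStart (j + 1), P.rateV j s :=
    intervalIntegral.integral_nonneg ht.2 fun s _ => P.rateV_nonneg hγ j s
  rw [P.integral_rateV j] at hsplit
  linarith

/-- **Classical half-pulse energy bound, H half-slot.** Let the cascade field be jointly smooth on the
H half-slot `[a, b] = [tStart j, tStart j + tHalf j]` (cf. `CascadeFieldSmooth`), `γ ≥ 0`, `δ j > 0`,
`ν ≥ 0`, and let `(w, q)` be a smooth solution there of the linearised Navier–Stokes equation along the
field, `∂ₜw + (ū·∇)w + (w·∇)ū = νΔw − ∇q`, `div w = 0`. Then for `t ∈ [a, b]`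
`∫ ‖w(t)‖² ≤ (∫ ‖w(a)‖²) · exp(∫ₐᵗ rateH j) ≤ e^γ ∫ ‖w(a)‖²`: the perturbation energy grows by at most
`e^γ` over the half pulse (production `2|⟪(w·∇)ū, w⟫| ≤ rateH |U_j′| ‖w‖² ≤ rateH ‖w‖²`).
[cite: MajdaBertozziCUP2002, §3.1.1 Prop. 3.1 with Lemma 3.1 (energy estimate + Grönwall); ElgindiLissMattingly2025, §1 and Rmk. 1.4 (pulsed shear of strain α)] -/
theorem linearised_energy_le_of_mem_H (hγ : 0 ≤ P.γ) {j : ℕ} (hδ : 0 < P.δ j) {ν : ℝ} (hν : 0 ≤ ν)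
    (hu : Torus.IsSmoothSpaceTimeOn (Icc (tStart j) (tStart j + tHalf j)) P.field)
    {w : ℝ → UnitAddTorus (Fin 2) → EuclideanSpace ℝ (Fin 2)} {q : ℝ → UnitAddTorus (Fin 2) → ℝ}
    (hw : Torus.IsSmoothSpaceTimeOn (Icc (tStart j) (tStart j + tHalf j)) w)
    (hq : Torus.IsSmoothSpaceTimeOn (Icc (tStart j) (tStart j + tHalf j)) q)
    (hwdiv : ∀ t ∈ Icc (tStart j) (tStart j + tHalf j), Torus.IsDivFree (w t))
    (hlin : ∀ t ∈ Icc (tStart j) (tStart j + tHalf j), ∀ x,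
      Torus.timeDerivWithin (Icc (tStart j) (tStart j + tHalf j)) w t x + Torus.convect (P.field t) (w t) x +
        Torus.convect (w t) (P.field t) x = ν • Torus.laplacian (w t) x - Torus.gradient (q t) x)
    {t : ℝ} (ht : t ∈ Icc (tStart j) (tStart j + tHalf j)) :
    ∫ x, ‖w t x‖ ^ 2 ≤ (∫ x, ‖w (tStart j) x‖ ^ 2) * Real.exp (∫ s in tStart j..t, P.rateH j s) ∧
      ∫ x, ‖w t x‖ ^ 2 ≤ Real.exp P.γ * ∫ x, ‖w (tStart j) x‖ ^ 2 := by
  have h1 : ∫ x, ‖w t x‖ ^ 2 ≤ (∫ x, ‖w (tStart j) x‖ ^ 2) * Real.exp (∫ s in tStart j..t, P.rateH j s) :=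
    Torus.linearisedNS_integral_norm_sq_le_mul_exp_integral_of_shear hν hu
      (fun s hs => P.isDivFree_field_of_mem_H hs) hw hq hwdiv hlin (k := 1) (m := 0) (by decide)
      (c := fun s x => P.rateH j s * deriv (P.U j) (Torus.repr x 1)) (r := P.rateH j)
      (fun s hs x i hi => by
        obtain rfl : i = 0 := by omega
        exact (P.partialDeriv_field_of_mem_H hs x).1)
      (fun s hs x => (P.partialDeriv_field_of_mem_H hs x).2)
      (fun s hs x => by
        rw [abs_mul, abs_of_nonneg (P.rateH_nonneg hγ j s)]
        calc P.rateH j s * |deriv (P.U j) (Torus.repr x 1)| ≤ P.rateH j s * 1 := by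
              gcongr
              · exact P.rateH_nonneg hγ j s
              · exact P.abs_deriv_U_le_one hδ _
          _ = P.rateH j s := mul_one _)
      (P.continuous_rateH j).continuousOn ht
  refine ⟨h1, h1.trans ?_⟩
  rw [mul_comm]
  exact mul_le_mul_of_nonneg_right (Real.exp_le_exp.2 (P.integral_rateH_le hγ ht))
    (integral_nonneg fun x => sq_nonneg _)

/-- **Classical half-pulse energy bound, V half-slot**: as `linearised_energy_le_of_mem_H` on
`[tStart j + tHalf j, tStart (j+1)]` with the rate `rateV j`.
[cite: MajdaBertozziCUP2002, §3.1.1 Prop. 3.1 with Lemma 3.1 (energy estimate + Grönwall); ElgindiLissMattingly2025, §1 and Rmk. 1.4 (pulsed shear of strain α)] -/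
theorem linearised_energy_le_of_mem_V (hγ : 0 ≤ P.γ) {j : ℕ} (hδ : 0 < P.δ j) {ν : ℝ} (hν : 0 ≤ ν)
    (hu : Torus.IsSmoothSpaceTimeOn (Icc (tStart j + tHalf j) (tStart (j + 1))) P.field)
    {w : ℝ → UnitAddTorus (Fin 2) → EuclideanSpace ℝ (Fin 2)} {q : ℝ → UnitAddTorus (Fin 2) → ℝ}
    (hw : Torus.IsSmoothSpaceTimeOn (Icc (tStart j + tHalf j) (tStart (j + 1))) w)
    (hq : Torus.IsSmoothSpaceTimeOn (Icc (tStart j + tHalf j) (tStart (j + 1))) q)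
    (hwdiv : ∀ t ∈ Icc (tStart j + tHalf j) (tStart (j + 1)), Torus.IsDivFree (w t))
    (hlin : ∀ t ∈ Icc (tStart j + tHalf j) (tStart (j + 1)), ∀ x,
      Torus.timeDerivWithin (Icc (tStart j + tHalf j) (tStart (j + 1))) w t x +
        Torus.convect (P.field t) (w t) x + Torus.convect (w t) (P.field t) x =
          ν • Torus.laplacian (w t) x - Torus.gradient (q t) x)
    {t : ℝ} (ht : t ∈ Icc (tStart j + tHalf j) (tStart (j + 1))) :
    ∫ x, ‖w t x‖ ^ 2 ≤ (∫ x, ‖w (tStart j + tHalf j) x‖ ^ 2) *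
        Real.exp (∫ s in (tStart j + tHalf j)..t, P.rateV j s) ∧
      ∫ x, ‖w t x‖ ^ 2 ≤ Real.exp P.γ * ∫ x, ‖w (tStart j + tHalf j) x‖ ^ 2 := by
  have h1 : ∫ x, ‖w t x‖ ^ 2 ≤ (∫ x, ‖w (tStart j + tHalf j) x‖ ^ 2) *
      Real.exp (∫ s in (tStart j + tHalf j)..t, P.rateV j s) :=
    Torus.linearisedNS_integral_norm_sq_le_mul_exp_integral_of_shear hν hu
      (fun s hs => P.isDivFree_field_of_mem_V hs) hw hq hwdiv hlin (k := 0) (m := 1) (by decide)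
      (c := fun s x => P.rateV j s * deriv (P.U j) (Torus.repr x 0)) (r := P.rateV j)
      (fun s hs x i hi => by
        obtain rfl : i = 1 := by omega
        exact (P.partialDeriv_field_of_mem_V hs x).1)
      (fun s hs x => (P.partialDeriv_field_of_mem_V hs x).2)
      (fun s hs x => by
        rw [abs_mul, abs_of_nonneg (P.rateV_nonneg hγ j s)]
        calc P.rateV j s * |deriv (P.U j) (Torus.repr x 0)| ≤ P.rateV j s * 1 := by
              gcongr
              · exact P.rateV_nonneg hγ j s
              · exact P.abs_deriv_U_le_one hδ _
          _ = P.rateV j s := mul_one _)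
      (P.continuous_rateV j).continuousOn ht
  refine ⟨h1, h1.trans ?_⟩
  rw [mul_comm]
  exact mul_le_mul_of_nonneg_right (Real.exp_le_exp.2 (P.integral_rateV_le hγ ht))
    (integral_nonneg fun x => sq_nonneg _)

end CascadeParams

end

end Literature.Analysis.FluidPDE.SawtoothCascade
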